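import Literature.NumberTheory.Automorphic.CDTTheorem712
import Literature.NumberTheory.EllipticCurves.ModFiveCongruenceHesseFamily
import Literature.NumberTheory.GaloisRepresentations.AbsGaloisGroup
import HarnessLib
import Literature.NumberTheory.EllipticCurves.LeadingTermBSZOrdinaryProofs
import Literature.NumberTheory.EllipticCurves.CongruentNumberCurveJacobiSums
import Literature.NumberTheory.EllipticCurves.GlobalMinimalModelProofs
import Literature.NumberTheory.EllipticCurves.WeilPairingProofs
import Literature.NumberTheory.EllipticCurves.DivisionField
import Mathlib.NumberTheory.LSeries.PrimesInAP
import Literature.NumberTheory.EllipticCurves.ModPIrreducibleCongruenceTransferProofs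
import Literature.NumberTheory.EllipticCurves.GeomReductionFrobeniusProofs
import Summits.ABC.ABC.Theorems.DefiniteXiFreyModularityStubAbsIrrNegThreeGroup
import Literature.NumberTheory.EllipticCurves.HeightFamily
import Literature.NumberTheory.GaloisRepresentations.ChebotarevOpenSubgroup
import Literature.NumberTheory.GaloisRepresentations.ArtinRestriction
import Literature.NumberTheory.GaloisRepresentations.HeckeCharacterProofs
import Literature.AlgebraicGeometry.Motives.ZetaFunctionProofs
import Mathlib.NumberTheory.Padics.HeightOneSpectrum
import Mathlib.RingTheory.Localization.Integral

/-!
# THE k3 ROAD for `stub_switch`, ASSEMBLED (generation 11): `Fisher 13.2 (i) → CDT_three_five_switch`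

This file is the mechanical concatenation of the two kernel-checked crux workfiles
`STUB_IDEAS_stub_switch_3g10_Sketch.lean` (ns `…StubSwitchK3g10`: `core1728_of_icosahedral_descent :
Core1728`, Klein's icosahedral invariant theory, 0 sorries) and `STUB_IDEAS_stub_switch_3g11_Sketch.lean`
(ns `…StubSwitchK3g11`: F2, G2, G3, G6 and g4's tail/assembly, 0 sorries), followed by the one-line
join `CDT_three_five_switch_of_thm132`.  The two copies of `def Core1728` are character-identical, so
the join elaborates by `δ`-unfolding.  Nothing else is new here.
-/

/-!
# stub-ideation k3 · GENERATION 10 — `stub_switch` (= `CDT_three_five_switch`), crux `FreyModularity`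

**g4's `Core1728` IS A THEOREM — ρ̄-FREE ICOSAHEDRAL DESCENT, SORRY-FREE.**
Namespace `…Cruxes.FreyModularity.StubSwitchK3g10`.  `lean check` (farm): **rc 0, 0 errors, 0 `sorry`s,
wall 312 s** (≈ 250 s of it are g9's verbatim `ring` proofs of L84-D / `chain_*` / `hesse_syzygy_F`).
Final theorems: `core1728At_of_icosahedral_descent (c₄ c₆ : ℤ) (hc : c₄^3 ≠ c₆^2) (h6 : c₆ ≠ 0) :
Core1728At c₄ c₆` and `core1728_of_icosahedral_descent : Core1728` (the `def Core1728` is g4's,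
character for character, so it discharges the `hCore` hypothesis of g4's kernel-checked
`stub_switch_of_core_and_tail : F1 → Core1728 → FrobeniusCertificate → CDT_three_five_switch`).
PROVED HERE: Klein identities (Euler, `Jac(D,c₄^{Kl}) = 20 c₆^{Kl}`, syzygy; L84-D/C4, H-ROOT reproduced
from g9), T1 `exists_torsorPoint`, G1 `vertex_fixed`, G2 `edge_fixed` (explicit splitting of
`c₆^{Kl}(x,1)` over `ℚ(i, ζ₅)`), H1 `exists_sigma_fix20_negSqrt3` (`√−3 ∉ ℚ(ζ₂₀)` by degrees 8 ∤ 16),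
H6 `klein_comp_Gm`, H7′ `exists_pos_pow_smul_eq`, K1 `Gm_cocycle`, K2 `gal_Gm_eq_smul`, H8
`Gm_galois_pow`, I2/I3/I5, **INV = `edge_of_eigenvector`**, and the assembly.

THE POINT (g10).  g9 proved `Core1728At c₄ c₆` from T1 + G1…G7, where G3 (cusps ↔ `W[5]`, Fisher
Thm 12.2), G5/G6 (icosahedral stabiliser `= A₅`, a finite check) and G7 (`SL₂(𝔽₅)` + `det ρ̄ = χ̄₅`)
tie the descent to `ρ̄_{W,5}`.  NONE OF THAT IS NEEDED: for the transition matrix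
`g_σ := M_{σv} M_v⁻¹` (two torsor points of the same `(c₄, c₆)`), L84-D/L84-C4 give
`D∘g_σ = c·D` (`c⁵ = 1`) and `c₄^{Kl}∘g_σ = c₄^{Kl}` EXACTLY; `[g_{σ^k}] = [g_σ]^k` for `σ ⊇ μ₅` (H8),
and a power of `σ` fixes `v` (H7′, finite Galois orbits), so `[g_σ]` has a finite projective order `N`.  Take `σ ⊇ μ₂₀` inverting
`√−3`.  If `N` is odd, `σ^N` still inverts `√−3` and `M_{σ^N v} ∝ M_v`, so `σ^N` fixes the good root
`t_i(v)`.  If `N = 2m`, `[g_{σ^m}]` is a NON-SCALAR INVOLUTION preserving `D` (up to a 5th root of 1)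
and `c₄^{Kl}` (exactly); the new lemma INV says ITS FIXED POINTS ARE EDGE MIDPOINTS (`c₆^{Kl} = 0 ≠
c₄^{Kl}`) — proof: both `t ↦ D(e+te')`, `t ↦ c₄^{Kl}(e+te')` are even, so `∇D(e) ∥ ∇c₄^{Kl}(e)` and
`20·c₆^{Kl} = Jac(D, c₄^{Kl})` vanishes at `e`; an eigenvector `e` of `g_σ` is then a `σ`-fixed
(`e ∈ ℙ¹(ℚ(ζ₂₀))`, G2) edge point with `σ·t_e(v) = t_e(v)`.  So `Core1728` is a theorem of Klein's
invariant theory + `√−3 ∉ ℚ(ζ₂₀)`: no `W[5]`, no `ρ̄`, no moduli, no `decide` over `GL₂(𝔽₅)`.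
(j = 1728 ⇔ edge midpoints ⇔ fixed points of the involutions: the "extreme fibre" is the fixed locus.)

kit j345457 (sympy, 6 s): `Jac(D,c₄^{Kl}) = 20 c₆^{Kl}`, `Hess D = −121 c₄^{Kl}`, `gcd(D, c₄^{Kl}) = 1`
(`Res = 5⁵⁰`, Bezout degrees 19/10, denominators `≤ 5⁵`), all three forms squarefree, `D(x,1)` splits
over `ℚ(ζ₅)` and `c₆^{Kl}(x,1)` over `ℚ(ζ₂₀)` into linear factors, and the eigenvectors of Klein's
involution `U` and its conjugates are edge midpoints (`|c₆^{Kl}(e)| < 10⁻¹⁵`, `c₄^{Kl}(e), D(e) ≠ 0`).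
-/

set_option linter.dupNamespace false

namespace Summit.ABC.ABC.Cruxes.FreyModularity.StubSwitchK3g10

open Literature.NumberTheory.EllipticCurves Literature.NumberTheory.EllipticCurves.HesseFamilyFive
open Literature.NumberTheory.Automorphic Literature.NumberTheory.GaloisRepresentations
open Literature.NumberTheory.Automorphic.BCDT WeierstrassCurve

/-! ## §0 Carriers (verbatim from k3-g4 / g8 / g9) -/

/-- `E : y² = x³ − 27c₄x − 54c₆`. -/
abbrev base (c₄ c₆ : ℚ) : WeierstrassCurve ℚ := ⟨0, 0, 0, -27 * c₄, -54 * c₆⟩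

/-- g4's CORE (verbatim). -/
def Core1728 : Prop :=
  ∀ (c₄ c₆ : ℤ), c₄ ^ 3 ≠ c₆ ^ 2 → c₆ ≠ 0 →
    ∃ (τ : Field.absoluteGaloisGroup ℚ) (t₁ : AlgebraicClosure ℚ),
      (∀ s : AlgebraicClosure ℚ, s ^ 2 = -3 → τ • s = -s) ∧
      (∀ z : AlgebraicClosure ℚ, z ^ 4 = 1 → τ • z = z) ∧
      C6 (c₄ : AlgebraicClosure ℚ) c₆ t₁ 1 = 0 ∧ C4 (c₄ : AlgebraicClosure ℚ) c₆ t₁ 1 ≠ 0 ∧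
        τ • t₁ = t₁

/-- g8's pointwise CORE (verbatim). -/
def Core1728At (c₄ c₆ : ℤ) : Prop :=
  ∃ (τ : Field.absoluteGaloisGroup ℚ) (t₁ : AlgebraicClosure ℚ),
    (∀ s : AlgebraicClosure ℚ, s ^ 2 = -3 → τ • s = -s) ∧
    (∀ z : AlgebraicClosure ℚ, z ^ 4 = 1 → τ • z = z) ∧
    C6 (c₄ : AlgebraicClosure ℚ) c₆ t₁ 1 = 0 ∧ C4 (c₄ : AlgebraicClosure ℚ) c₆ t₁ 1 ≠ 0 ∧ τ • t₁ = t₁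

theorem core1728_iff : Core1728 ↔ ∀ c₄ c₆ : ℤ, c₄ ^ 3 ≠ c₆ ^ 2 → c₆ ≠ 0 → Core1728At c₄ c₆ :=
  Iff.rfl

/-! ## §1 Klein's icosahedral forms (verbatim g9 §1) + the NEW first-order identities (PROVED) -/

section Klein
variable {R : Type*} [CommRing R]

def kD (a b : R) : R := a ^ 11 * b - 11 * a ^ 6 * b ^ 6 - a * b ^ 11
/-- `∂D/∂a`. -/
def kDa (a b : R) : R := 11 * a ^ 10 * b - 66 * a ^ 5 * b ^ 6 - b ^ 11
/-- `∂D/∂b`. -/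
def kDb (a b : R) : R := a ^ 11 - 66 * a ^ 6 * b ^ 5 - 11 * a * b ^ 10
def kC4 (a b : R) : R :=
  a ^ 20 + 228 * a ^ 15 * b ^ 5 + 494 * a ^ 10 * b ^ 10 - 228 * a ^ 5 * b ^ 15 + b ^ 20
def kC6 (a b : R) : R :=
  -a ^ 30 + 522 * a ^ 25 * b ^ 5 + 10005 * a ^ 20 * b ^ 10 + 10005 * a ^ 10 * b ^ 20
    - 522 * a ^ 5 * b ^ 25 - b ^ 30
/-- NEW (g10): `∂c₄^{Kl}/∂a`, `∂c₄^{Kl}/∂b`. -/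
def kC4a (a b : R) : R :=
  20 * a ^ 19 + 3420 * a ^ 14 * b ^ 5 + 4940 * a ^ 9 * b ^ 10 - 1140 * a ^ 4 * b ^ 15
def kC4b (a b : R) : R :=
  1140 * a ^ 15 * b ^ 4 + 4940 * a ^ 10 * b ^ 9 - 3420 * a ^ 5 * b ^ 14 + 20 * b ^ 19
/-- Fisher's `M_v(λ,μ) = (λa − μ∂_bD, λb + μ∂_aD)` (Lemma 8.4), first and second coordinate. -/
def Mv1 (a b l m : R) : R := l * a - m * kDb a b
def Mv2 (a b l m : R) : R := l * b + m * kDa a b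

theorem klein_euler (a b : R) : a * kDa a b + b * kDb a b = 12 * kD a b := by
  simp only [kD, kDa, kDb]; ring

/-- NEW (PROVED): Euler for `c₄^{Kl}`. -/
theorem klein_euler_C4 (a b : R) : a * kC4a a b + b * kC4b a b = 20 * kC4 a b := by
  simp only [kC4, kC4a, kC4b]; ring

set_option maxHeartbeats 4000000 in
/-- NEW (PROVED; kit j345457 A1): Klein's `c₆^{Kl} = Jac(D, c₄^{Kl})/20`. -/
theorem klein_jacobian (a b : R) :
    kDa a b * kC4b a b - kDb a b * kC4a a b = 20 * kC6 a b := by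
  simp only [kDa, kDb, kC4a, kC4b, kC6]; ring

set_option maxHeartbeats 4000000 in
theorem klein_syzygy (a b : R) : kC4 a b ^ 3 - kC6 a b ^ 2 = 1728 * kD a b ^ 5 := by
  simp only [kD, kC4, kC6]; ring

theorem kD_smul (s a b : R) : kD (s * a) (s * b) = s ^ 12 * kD a b := by
  simp only [kD]; ring
theorem kC4_smul (s a b : R) : kC4 (s * a) (s * b) = s ^ 20 * kC4 a b := by
  simp only [kC4]; ring
theorem kC6_smul (s a b : R) : kC6 (s * a) (s * b) = s ^ 30 * kC6 a b := by
  simp only [kC6]; ring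

/-- The edge midpoint `(i : 1)`. -/
theorem kC6_I (i : R) (hi : i ^ 2 = -1) : kC6 i 1 = 0 := by
  have e5 : i ^ 5 = i := by rw [show i ^ 5 = (i ^ 2) ^ 2 * i by ring, hi]; ring
  have e10 : i ^ 10 = -1 := by rw [show i ^ 10 = (i ^ 2) ^ 5 by ring, hi]; ring
  have e20 : i ^ 20 = 1 := by rw [show i ^ 20 = (i ^ 2) ^ 10 by ring, hi]; ring
  have e25 : i ^ 25 = i := by rw [show i ^ 25 = (i ^ 2) ^ 12 * i by ring, hi]; ring
  have e30 : i ^ 30 = -1 := by rw [show i ^ 30 = (i ^ 2) ^ 15 by ring, hi]; ring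
  simp only [kC6]
  linear_combination (-1 : R) * e30 + 522 * e25 + 10005 * e20 + 10005 * e10 - 522 * e5

/-- NEW (PROVED): the Klein forms commute with ring homomorphisms. -/
theorem map_kC4 {S : Type*} [CommRing S] (f : R →+* S) (a b : R) :
    f (kC4 a b) = kC4 (f a) (f b) := by
  simp only [kC4, map_add, map_sub, map_mul, map_pow, map_ofNat]

theorem map_kD {S : Type*} [CommRing S] (f : R →+* S) (a b : R) :
    f (kD a b) = kD (f a) (f b) := by
  simp only [kD, map_sub, map_mul, map_pow, map_ofNat]

theorem map_kC6 {S : Type*} [CommRing S] (f : R →+* S) (a b : R) :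
    f (kC6 a b) = kC6 (f a) (f b) := by
  simp only [kC6, map_add, map_sub, map_neg, map_mul, map_pow, map_ofNat]

open Polynomial in
/-- NEW (PROVED): the derivative at `0` of `t ↦ c₄^{Kl}(x + tu, y + tw)` is `∇c₄^{Kl}(x,y)·(u,w)`. -/
theorem lineDeriv_kC4 (x y u w : R) :
    (derivative (kC4 (C x + C u * X) (C y + C w * X))).eval 0 = kC4a x y * u + kC4b x y * w := by
  simp [kC4, kC4a, kC4b, derivative_mul, derivative_pow]
  ring

open Polynomial in
theorem lineDeriv_kD (x y u w : R) :
    (derivative (kD (C x + C u * X) (C y + C w * X))).eval 0 = kDa x y * u + kDb x y * w := by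
  simp [kD, kDa, kDb, derivative_mul, derivative_pow]
  ring

end Klein

section KleinField
variable {F : Type*} [Field F]

theorem kC4_I_ne [CharZero F] (i : F) (hi : i ^ 2 = -1) : kC4 i 1 ≠ 0 := by
  have e5 : i ^ 5 = i := by rw [show i ^ 5 = (i ^ 2) ^ 2 * i by ring, hi]; ring
  have e10 : i ^ 10 = -1 := by rw [show i ^ 10 = (i ^ 2) ^ 5 by ring, hi]; ring
  have e15 : i ^ 15 = -i := by rw [show i ^ 15 = (i ^ 2) ^ 7 * i by ring, hi]; ring
  have e20 : i ^ 20 = 1 := by rw [show i ^ 20 = (i ^ 2) ^ 10 by ring, hi]; ring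
  intro h
  simp only [kC4] at h
  have key : (456 : F) * i = -492 := by
    linear_combination -h + e20 + 228 * e15 + 494 * e10 - 228 * e5
  have h2 : (456 : F) ^ 2 * i ^ 2 = (-492) ^ 2 := by rw [← mul_pow, key]
  rw [hi] at h2
  norm_num at h2

theorem kD_ne_zero_of_ne (a b : F) (h : kC4 a b ^ 3 ≠ kC6 a b ^ 2) : kD a b ≠ 0 := by
  intro hD
  apply h
  have := klein_syzygy a b
  rw [hD] at this
  exact sub_eq_zero.mp (by simpa using this)

theorem edge_nondeg (a b e₁ e₂ : F) (he6 : kC6 e₁ e₂ = 0) (he4 : kC4 e₁ e₂ ≠ 0)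
    (h6 : kC6 a b ≠ 0) : e₂ * a - e₁ * b ≠ 0 := by
  intro h
  have hab : e₂ * a = e₁ * b := sub_eq_zero.mp h
  by_cases he2 : e₂ = 0
  · subst he2
    have he1 : e₁ ≠ 0 := by rintro rfl; exact he4 (by simp [kC4])
    have hb : b = 0 := by
      rcases mul_eq_zero.mp (show e₁ * b = 0 by rw [← hab]; ring) with h | h
      · exact absurd h he1
      · exact h
    subst hb
    have h60 : kC6 e₁ (0 : F) = -e₁ ^ 30 := by simp [kC6]
    rw [h60, neg_eq_zero] at he6
    exact he1 (pow_eq_zero_iff (by norm_num) |>.mp he6)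
  · have key : e₂ ^ 30 * kC6 a b = b ^ 30 * kC6 e₁ e₂ := by
      rw [← kC6_smul, ← kC6_smul, hab, mul_comm e₂ b, mul_comm e₁ b]
    rw [he6, mul_zero] at key
    rcases mul_eq_zero.mp key with h' | h'
    · exact he2 (pow_eq_zero_iff (by norm_num) |>.mp h')
    · exact h6 h'

/-! ## §2 Lemma 8.4 and the good root (PROVED in g9; proofs reproduced verbatim — crux workfiles do not import) -/

set_option maxHeartbeats 40000000 in
/-- **L84-D (PROVED g9, `ring` ≈ 20 s; verbatim).** [Fisher2012Hessian Lemma 8.4 p.12] -/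
theorem lemma84_D (a b l m : F) :
    D (kC4 a b) (kC6 a b) l m * kD a b = kD (Mv1 a b l m) (Mv2 a b l m) := by
  simp only [D, kC4, kC6, kD, Mv1, Mv2, kDa, kDb]
  ring

/-- second partials of Klein's `D` (g9). -/
def kDaa (a b : F) : F := 110 * a ^ 9 * b - 330 * a ^ 4 * b ^ 6
def kDab (a b : F) : F := 11 * a ^ 10 - 396 * a ^ 5 * b ^ 5 - 11 * b ^ 10
def kDbb (a b : F) : F := -330 * a ^ 6 * b ^ 4 - 110 * a * b ^ 9

/-- Klein: `Hess(D) = −121·c₄^{Kl}` (g9; kit j345457 A3). -/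
theorem klein_hessian (a b : F) : kDaa a b * kDbb a b - kDab a b ^ 2 = -121 * kC4 a b := by
  simp only [kDaa, kDab, kDbb, kC4]; ring

set_option maxHeartbeats 40000000 in
/-- `∂²/∂λ²` of L84-D (g9, verbatim). -/
theorem chain_ll (a b l m : F) :
    Dll (kC4 a b) (kC6 a b) l m * kD a b =
      a ^ 2 * kDaa (Mv1 a b l m) (Mv2 a b l m) + 2 * a * b * kDab (Mv1 a b l m) (Mv2 a b l m)
        + b ^ 2 * kDbb (Mv1 a b l m) (Mv2 a b l m) := by
  simp only [Dll, kC4, kC6, kD, kDaa, kDab, kDbb, Mv1, Mv2, kDa, kDb]; ring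

set_option maxHeartbeats 40000000 in
/-- `∂²/∂λ∂μ` of L84-D (g9, verbatim). -/
theorem chain_lm (a b l m : F) :
    Dlm (kC4 a b) (kC6 a b) l m * kD a b =
      -(a * kDb a b) * kDaa (Mv1 a b l m) (Mv2 a b l m)
        + (a * kDa a b - b * kDb a b) * kDab (Mv1 a b l m) (Mv2 a b l m)
        + b * kDa a b * kDbb (Mv1 a b l m) (Mv2 a b l m) := by
  simp only [Dlm, kC4, kC6, kD, kDaa, kDab, kDbb, Mv1, Mv2, kDa, kDb]; ring

set_option maxHeartbeats 40000000 in
/-- `∂²/∂μ²` of L84-D (g9, verbatim). -/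
theorem chain_mm (a b l m : F) :
    Dmm (kC4 a b) (kC6 a b) l m * kD a b =
      kDb a b ^ 2 * kDaa (Mv1 a b l m) (Mv2 a b l m)
        - 2 * kDa a b * kDb a b * kDab (Mv1 a b l m) (Mv2 a b l m)
        + kDa a b ^ 2 * kDbb (Mv1 a b l m) (Mv2 a b l m) := by
  simp only [Dmm, kC4, kC6, kD, kDaa, kDab, kDbb, Mv1, Mv2, kDa, kDb]; ring

/-- **L84-C4 (PROVED g9 via the Hessian chain rule; verbatim).** [Fisher2012Hessian Lemma 8.4] -/
theorem lemma84_C4 [CharZero F] (a b l m : F) (hD : kD a b ≠ 0) :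
    C4 (kC4 a b) (kC6 a b) l m = kC4 (Mv1 a b l m) (Mv2 a b l m) := by
  have hll := chain_ll a b l m
  have hlm := chain_lm a b l m
  have hmm := chain_mm a b l m
  have heul := klein_euler a b
  have hhess := klein_hessian (Mv1 a b l m) (Mv2 a b l m)
  have hk2 : kD a b ^ 2 ≠ 0 := pow_ne_zero _ hD
  have h2 : Dll (kC4 a b) (kC6 a b) l m * Dmm (kC4 a b) (kC6 a b) l m
      - Dlm (kC4 a b) (kC6 a b) l m ^ 2 = -17424 * kC4 (Mv1 a b l m) (Mv2 a b l m) := by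
    apply mul_right_cancel₀ hk2
    linear_combination (Dmm (kC4 a b) (kC6 a b) l m * kD a b) * hll
      + (a ^ 2 * kDaa (Mv1 a b l m) (Mv2 a b l m) + 2 * a * b * kDab (Mv1 a b l m) (Mv2 a b l m)
          + b ^ 2 * kDbb (Mv1 a b l m) (Mv2 a b l m)) * hmm
      - (Dlm (kC4 a b) (kC6 a b) l m * kD a b
          + (-(a * kDb a b) * kDaa (Mv1 a b l m) (Mv2 a b l m)
            + (a * kDa a b - b * kDb a b) * kDab (Mv1 a b l m) (Mv2 a b l m)
            + b * kDa a b * kDbb (Mv1 a b l m) (Mv2 a b l m))) * hlm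
      + ((kDaa (Mv1 a b l m) (Mv2 a b l m) * kDbb (Mv1 a b l m) (Mv2 a b l m)
          - kDab (Mv1 a b l m) (Mv2 a b l m) ^ 2) * (a * kDa a b + b * kDb a b + 12 * kD a b)) * heul
      + (144 * kD a b ^ 2) * hhess
  rw [C4, h2]
  field_simp

set_option maxHeartbeats 16000000 in
/-- Hesse syzygy at `μ = 1` over any char-0 field (PROVED g9, ≈ 70 s). [Fisher2012Hessian (8.1)] -/
theorem hesse_syzygy_F [CharZero F] (c₄ c₆ l : F) :
    C4 c₄ c₆ l 1 ^ 3 - C6 c₄ c₆ l 1 ^ 2 = (c₄ ^ 3 - c₆ ^ 2) * D c₄ c₆ l 1 ^ 5 := by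
  simp only [C4, C6, C4l, C4m, D, Dl, Dm, Dll, Dlm, Dmm, Dlll, Dllm, Dlmm, Dmmm]
  field_simp
  ring

/-- `t_e(v) = M_v⁻¹(e)` (g9). -/
def tE (a b e₁ e₂ : F) : F := (e₂ * kDb a b + e₁ * kDa a b) / (e₂ * a - e₁ * b)

/-- `M_v(t_e(v), 1) ∝ e` (PROVED, g9). -/
theorem Mv_at_tE (a b e₁ e₂ : F) (hne : e₂ * a - e₁ * b ≠ 0) :
    Mv1 a b (tE a b e₁ e₂) 1 = e₁ * (12 * kD a b) / (e₂ * a - e₁ * b) ∧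
      Mv2 a b (tE a b e₁ e₂) 1 = e₂ * (12 * kD a b) / (e₂ * a - e₁ * b) := by
  constructor
  · simp only [Mv1, tE]
    have h : (e₂ * kDb a b + e₁ * kDa a b) / (e₂ * a - e₁ * b) * a - 1 * kDb a b =
        e₁ * (a * kDa a b + b * kDb a b) / (e₂ * a - e₁ * b) := by
      field_simp
      ring
    rw [h, klein_euler]
  · simp only [Mv2, tE]
    have h : (e₂ * kDb a b + e₁ * kDa a b) / (e₂ * a - e₁ * b) * b + 1 * kDa a b =
        e₂ * (a * kDa a b + b * kDb a b) / (e₂ * a - e₁ * b) := by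
      field_simp
      ring
    rw [h, klein_euler]

/-- **H-ROOT (PROVED g9 from L84-D, L84-C4 and the two syzygies; copy verbatim):** `t_e(v)` is a
GOOD root of `𝔠₆` for every edge midpoint `e` not proportional to the torsor point `v`. -/
theorem goodRoot_tE [CharZero F] (a b e₁ e₂ : F) (he6 : kC6 e₁ e₂ = 0) (he4 : kC4 e₁ e₂ ≠ 0)
    (hD : kD a b ≠ 0) (hne : e₂ * a - e₁ * b ≠ 0) :
    C6 (kC4 a b) (kC6 a b) (tE a b e₁ e₂) 1 = 0 ∧
      C4 (kC4 a b) (kC6 a b) (tE a b e₁ e₂) 1 ≠ 0 := by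
  obtain ⟨h1, h2⟩ := Mv_at_tE a b e₁ e₂ hne
  set s : F := 12 * kD a b / (e₂ * a - e₁ * b) with hs_def
  have hs : s ≠ 0 := div_ne_zero (mul_ne_zero (by norm_num) hD) hne
  have hM1 : Mv1 a b (tE a b e₁ e₂) 1 = s * e₁ := by rw [h1, hs_def]; ring
  have hM2 : Mv2 a b (tE a b e₁ e₂) 1 = s * e₂ := by rw [h2, hs_def]; ring
  have h4 : C4 (kC4 a b) (kC6 a b) (tE a b e₁ e₂) 1 = s ^ 20 * kC4 e₁ e₂ := by
    rw [lemma84_C4 a b _ _ hD, hM1, hM2, kC4_smul]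
  have hDD : D (kC4 a b) (kC6 a b) (tE a b e₁ e₂) 1 * kD a b = s ^ 12 * kD e₁ e₂ := by
    rw [lemma84_D, hM1, hM2, kD_smul]
  refine ⟨?_, by rw [h4]; exact mul_ne_zero (pow_ne_zero _ hs) he4⟩
  have hsyz := hesse_syzygy_F (kC4 a b) (kC6 a b) (tE a b e₁ e₂)
  have hK := klein_syzygy a b
  have hKe := klein_syzygy e₁ e₂
  have hsq : C6 (kC4 a b) (kC6 a b) (tE a b e₁ e₂) 1 ^ 2 = 0 := by
    calc C6 (kC4 a b) (kC6 a b) (tE a b e₁ e₂) 1 ^ 2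
        = C4 (kC4 a b) (kC6 a b) (tE a b e₁ e₂) 1 ^ 3
            - (kC4 a b ^ 3 - kC6 a b ^ 2) * D (kC4 a b) (kC6 a b) (tE a b e₁ e₂) 1 ^ 5 := by
          linear_combination (-1 : F) * hsyz
      _ = (s ^ 20 * kC4 e₁ e₂) ^ 3
            - 1728 * (D (kC4 a b) (kC6 a b) (tE a b e₁ e₂) 1 * kD a b) ^ 5 := by
          rw [h4, hK]; ring
      _ = (s ^ 20 * kC4 e₁ e₂) ^ 3 - 1728 * (s ^ 12 * kD e₁ e₂) ^ 5 := by rw [hDD]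
      _ = 0 := by linear_combination (s ^ 60) * hKe + (s ^ 60 * kC6 e₁ e₂) * he6
  exact pow_eq_zero_iff (by norm_num) |>.mp hsq

/-! ## §3 NEW (g10): the transition matrix `g = M_{v'} M_v⁻¹` and its invariants -/

/-- `M_v` as a matrix (columns `v` and `(−∂_bD(v), ∂_aD(v))`); `det = 12 D(v)` (Euler). -/
def Mv (a b : F) : Matrix (Fin 2) (Fin 2) F := !![a, -kDb a b; b, kDa a b]

theorem Mv_det (a b : F) : (Mv a b).det = 12 * kD a b := by
  rw [Mv, Matrix.det_fin_two_of]
  linear_combination klein_euler a b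

/-- apply a `2 × 2` matrix to `(x, y)`. -/
def ap (g : Matrix (Fin 2) (Fin 2) F) (x y : F) : F × F :=
  (g 0 0 * x + g 0 1 * y, g 1 0 * x + g 1 1 * y)

theorem ap_Mv (a b l m : F) : ap (Mv a b) l m = (Mv1 a b l m, Mv2 a b l m) := by
  refine Prod.ext ?_ ?_ <;> simp [ap, Mv, Mv1, Mv2] <;> ring

theorem ap_mul (g h : Matrix (Fin 2) (Fin 2) F) (x y : F) :
    ap (g * h) x y = ap g (ap h x y).1 (ap h x y).2 := by
  simp only [ap, Matrix.mul_apply, Fin.sum_univ_two]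
  refine Prod.ext ?_ ?_ <;> dsimp only <;> ring

theorem ap_smul (l : F) (g : Matrix (Fin 2) (Fin 2) F) (x y : F) :
    ap (l • g) x y = (l * (ap g x y).1, l * (ap g x y).2) := by
  simp only [ap, Matrix.smul_apply, smul_eq_mul]
  refine Prod.ext ?_ ?_ <;> dsimp only <;> ring

theorem ap_one (x y : F) : ap (1 : Matrix (Fin 2) (Fin 2) F) x y = (x, y) := by
  simp [ap, Matrix.one_apply]

/-- eigenvectors pass to powers. -/
theorem ap_pow_of_eigen (g : Matrix (Fin 2) (Fin 2) F) (x y ν : F) (h : ap g x y = (ν * x, ν * y))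
    (k : ℕ) : ap (g ^ k) x y = (ν ^ k * x, ν ^ k * y) := by
  induction k with
  | zero => simp [ap_one]
  | succ k ih =>
    have h1 := congrArg Prod.fst h
    have h2 := congrArg Prod.snd h
    simp only [ap] at h1 h2
    rw [pow_succ', ap_mul, ih]
    simp only [ap]
    refine Prod.ext ?_ ?_ <;> dsimp only
    · linear_combination (ν ^ k) * h1
    · linear_combination (ν ^ k) * h2

/-- an invertible matrix has no eigenvalue `0` on a nonzero vector. -/
theorem eigen_ne_zero (g : Matrix (Fin 2) (Fin 2) F) (hg : g.det ≠ 0) (x y ν : F)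
    (h0 : (x, y) ≠ (0, 0)) (h : ap g x y = (ν * x, ν * y)) : ν ≠ 0 := by
  rintro rfl
  have h1 := congrArg Prod.fst h
  have h2 := congrArg Prod.snd h
  simp only [ap, zero_mul] at h1 h2
  rw [Matrix.det_fin_two] at hg
  apply h0
  have hx : (g 0 0 * g 1 1 - g 0 1 * g 1 0) * x = 0 := by
    linear_combination (g 1 1) * h1 - (g 0 1) * h2
  have hy : (g 0 0 * g 1 1 - g 0 1 * g 1 0) * y = 0 := by
    linear_combination (g 0 0) * h2 - (g 1 0) * h1
  rw [mul_eq_zero] at hx hy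
  rw [Prod.mk.injEq]
  exact ⟨hx.resolve_left hg, hy.resolve_left hg⟩

/-- The transition matrix between two torsor points. -/
noncomputable def Gm (a b a' b' : F) : Matrix (Fin 2) (Fin 2) F := Mv a' b' * (Mv a b)⁻¹

theorem Gm_mul_Mv [CharZero F] (a b a' b' : F) (hD : kD a b ≠ 0) : Gm a b a' b' * Mv a b = Mv a' b' := by
  have hu : IsUnit (Mv a b).det := by
    rw [Mv_det]; exact isUnit_iff_ne_zero.mpr (mul_ne_zero (by norm_num) hD)
  rw [Gm, Matrix.mul_assoc, Matrix.nonsing_inv_mul _ hu, Matrix.mul_one]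

theorem Gm_self [CharZero F] (a b : F) (hD : kD a b ≠ 0) : Gm a b a b = 1 := by
  have hu : IsUnit (Mv a b).det := by
    rw [Mv_det]; exact isUnit_iff_ne_zero.mpr (mul_ne_zero (by norm_num) hD)
  rw [Gm, Matrix.mul_nonsing_inv _ hu]

theorem Gm_det_ne [CharZero F] (a b a' b' : F) (hD : kD a b ≠ 0) (hD' : kD a' b' ≠ 0) :
    (Gm a b a' b').det ≠ 0 := by
  intro h
  have := congrArg Matrix.det (Gm_mul_Mv a b a' b' hD)
  rw [Matrix.det_mul, h, zero_mul, Mv_det] at this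
  exact mul_ne_zero (by norm_num) hD' this.symm

/-- `Gm = l • 1` means `M_{v'} = l • M_v`. -/
theorem Mv_eq_smul_of_Gm [CharZero F] (a b a' b' l : F) (hD : kD a b ≠ 0) (h : Gm a b a' b' = l • 1) :
    Mv a' b' = l • Mv a b := by
  rw [← Gm_mul_Mv a b a' b' hD, h, Matrix.smul_mul, Matrix.one_mul]

/-- `t_e` only depends on `[M_v]`: proportional `M`'s give the same `t_e`. -/
theorem tE_eq_of_Mv_smul (a b a' b' l : F) (hl : l ≠ 0) (h : Mv a' b' = l • Mv a b) (e₁ e₂ : F) :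
    tE a' b' e₁ e₂ = tE a b e₁ e₂ := by
  have e00 : a' = l * a := by simpa [Mv] using congrFun (congrFun h 0) 0
  have e10 : b' = l * b := by simpa [Mv] using congrFun (congrFun h 1) 0
  have e01 : kDb a' b' = l * kDb a b := by
    have := congrFun (congrFun h 0) 1
    simp [Mv] at this
    linear_combination this
  have e11 : kDa a' b' = l * kDa a b := by simpa [Mv] using congrFun (congrFun h 1) 1
  simp only [tE]
  rw [e01, e11, e00, e10]
  rw [show e₂ * (l * kDb a b) + e₁ * (l * kDa a b) = l * (e₂ * kDb a b + e₁ * kDa a b) by ring,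
    show e₂ * (l * a) - e₁ * (l * b) = l * (e₂ * a - e₁ * b) by ring,
    mul_div_mul_left _ _ hl]

theorem ap_mul_right (g : Matrix (Fin 2) (Fin 2) F) (x y s : F) :
    ap g (x * s) (y * s) = ((ap g x y).1 * s, (ap g x y).2 * s) := by
  simp only [ap]
  refine Prod.ext ?_ ?_ <;> dsimp only <;> ring

/-- **glue (PROVED): `t_e` is unchanged when `M_{v'} = g·M_v` and `e = (x:1)` is an eigenvector of
`g`.**  `M_v(t_e(v),1) = s·e` (`Mv_at_tE`), so `M_{v'}(t_e(v),1) = sν·e`, and this pins `t_e(v')`. -/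
theorem tE_eq_of_eigen [CharZero F] (a b a' b' : F) (hD : kD a b ≠ 0) (x ν : F)
    (hg : ap (Gm a b a' b') x 1 = (ν * x, ν))
    (hne : 1 * a - x * b ≠ 0) (hne' : 1 * a' - x * b' ≠ 0) :
    tE a' b' x 1 = tE a b x 1 := by
  obtain ⟨h1, h2⟩ := Mv_at_tE a b x 1 hne
  have key : ap (Mv a' b') (tE a b x 1) 1 =
      ap (Gm a b a' b') (Mv1 a b (tE a b x 1) 1) (Mv2 a b (tE a b x 1) 1) := by
    rw [← Gm_mul_Mv a b a' b' hD, ap_mul, ap_Mv]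
  have h1' : Mv1 a b (tE a b x 1) 1 = x * (12 * kD a b / (1 * a - x * b)) := by rw [h1]; ring
  have h2' : Mv2 a b (tE a b x 1) 1 = 1 * (12 * kD a b / (1 * a - x * b)) := by rw [h2]; ring
  rw [h1', h2', ap_mul_right, hg, ap_Mv] at key
  have k1 := congrArg Prod.fst key
  have k2 := congrArg Prod.snd key
  simp only [Mv1, Mv2] at k1 k2
  show (1 * kDb a' b' + x * kDa a' b') / (1 * a' - x * b') = tE a b x 1
  rw [div_eq_iff hne']
  linear_combination -k1 + x * k2

/-- **glue (PROVED): a `2 × 2` matrix over an algebraically closed field has an eigenvector.** -/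
theorem exists_eigen [IsAlgClosed F] (g : Matrix (Fin 2) (Fin 2) F) :
    ∃ x y ν : F, (x, y) ≠ (0, 0) ∧ ap g x y = (ν * x, ν * y) := by
  by_cases h10 : g 1 0 = 0
  · refine ⟨1, 0, g 0 0, by simp, ?_⟩
    simp only [ap, h10]
    refine Prod.ext ?_ ?_ <;> dsimp only <;> ring
  · -- a root `ν` of the characteristic polynomial, eigenvector `(ν - g₁₁, g₁₀)`
    open Polynomial in
    obtain ⟨ν, hν⟩ := IsAlgClosed.exists_root
      (C (1 : F) * X ^ 2 + C (-(g 0 0 + g 1 1)) * X + C (g 0 0 * g 1 1 - g 0 1 * g 1 0))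
      (by rw [Polynomial.degree_quadratic (one_ne_zero)]; decide)
    have hν' : ν ^ 2 - (g 0 0 + g 1 1) * ν + (g 0 0 * g 1 1 - g 0 1 * g 1 0) = 0 := by
      have := hν
      simp only [Polynomial.IsRoot.def, Polynomial.eval_add, Polynomial.eval_mul, Polynomial.eval_C,
        Polynomial.eval_pow, Polynomial.eval_X] at this
      linear_combination this
    refine ⟨ν - g 1 1, g 1 0, ν, ?_, ?_⟩
    · intro h
      exact h10 (congrArg Prod.snd h)
    · simp only [ap]
      refine Prod.ext ?_ ?_ <;> dsimp only
      · linear_combination -hν'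
      · ring

/-- **H6 (PROVED here from L84-D / L84-C4, themselves PROVED in g9): the transition matrix
preserves `D` up to the scalar `c = D(v')/D(v)` and `c₄^{Kl}` EXACTLY.** -/
theorem klein_comp_Gm [CharZero F] (a b a' b' : F) (hD : kD a b ≠ 0)
    (h4 : kC4 a' b' = kC4 a b) (h6 : kC6 a' b' = kC6 a b) :
    (∀ x y : F, kD (ap (Gm a b a' b') x y).1 (ap (Gm a b a' b') x y).2 = kD a' b' / kD a b * kD x y) ∧
    (∀ x y : F, kC4 (ap (Gm a b a' b') x y).1 (ap (Gm a b a' b') x y).2 = kC4 x y) := by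
  have hu : IsUnit (Mv a b).det := by
    rw [Mv_det]; exact isUnit_iff_ne_zero.mpr (mul_ne_zero (by norm_num) hD)
  have hD' : kD a' b' ≠ 0 := by
    refine kD_ne_zero_of_ne a' b' ?_
    rw [h4, h6]
    intro h
    have := klein_syzygy a b
    rw [h, sub_self] at this
    exact hD (pow_eq_zero_iff (by norm_num) |>.mp
      ((mul_eq_zero.mp this.symm).resolve_left (by norm_num)))
  have pre : ∀ x y : F,
      ap (Mv a b) (ap (Mv a b)⁻¹ x y).1 (ap (Mv a b)⁻¹ x y).2 = (x, y) := by
    intro x y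
    rw [← ap_mul, Matrix.mul_nonsing_inv _ hu, ap_one]
  have hG : ∀ x y : F, ap (Gm a b a' b') x y =
      ap (Mv a' b') (ap (Mv a b)⁻¹ x y).1 (ap (Mv a b)⁻¹ x y).2 := by
    intro x y
    rw [Gm, ap_mul]
  refine ⟨fun x y => ?_, fun x y => ?_⟩
  · have e := pre x y
    rw [hG x y]
    obtain ⟨L, hL⟩ : ∃ L, ap (Mv a b)⁻¹ x y = L := ⟨_, rfl⟩
    rw [hL] at e ⊢
    obtain ⟨l, m⟩ := L
    dsimp only at e ⊢
    rw [ap_Mv] at e ⊢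
    have e1 := congrArg Prod.fst e
    have e2 := congrArg Prod.snd e
    dsimp only at e1 e2 ⊢
    have key := lemma84_D a b l m
    rw [e1, e2] at key
    rw [← lemma84_D a' b' l m, h4, h6, ← key, div_mul_eq_mul_div, eq_div_iff hD]
    ring
  · have e := pre x y
    rw [hG x y]
    obtain ⟨L, hL⟩ : ∃ L, ap (Mv a b)⁻¹ x y = L := ⟨_, rfl⟩
    rw [hL] at e ⊢
    obtain ⟨l, m⟩ := L
    dsimp only at e ⊢
    rw [ap_Mv] at e ⊢
    have e1 := congrArg Prod.fst e
    have e2 := congrArg Prod.snd e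
    dsimp only at e1 e2 ⊢
    have key := lemma84_C4 a b l m hD
    rw [e1, e2] at key
    rw [← lemma84_C4 a' b' l m hD', h4, h6, ← key]

/-- **I5 (S, certificate; kit j345457 A5/A9: `Res(D, c₄^{Kl}) = 5⁵⁰`, Bezout cofactors of degrees
19/10 with denominators `≤ 5⁵`): vertices are not face centres.** -/
theorem kC4_ne_zero_of_kD_eq_zero [CharZero F] (x y : F) (h0 : (x, y) ≠ (0, 0)) (hD : kD x y = 0) :
    kC4 x y ≠ 0 := by
  intro h4
  apply h0
  -- `D = x·y·r` with `r = x¹⁰ − 11x⁵y⁵ − y¹⁰`, and `c₄^{Kl} ≡ 5⁵·y¹⁵(11x⁵ + y⁵) (mod r)`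
  have hfac : x * y * (x ^ 10 - 11 * x ^ 5 * y ^ 5 - y ^ 10) = 0 := by
    rw [← hD]; simp only [kD]; ring
  have hid : kC4 x y = (x ^ 10 + 239 * x ^ 5 * y ^ 5 + 3124 * y ^ 10) *
      (x ^ 10 - 11 * x ^ 5 * y ^ 5 - y ^ 10) + 3125 * y ^ 15 * (11 * x ^ 5 + y ^ 5) := by
    simp only [kC4]; ring
  have hx0 : ∀ {x y : F}, x = 0 → kC4 x y = 0 → (x, y) = (0, 0) := by
    intro x y hx h
    subst hx
    have : y ^ 20 = 0 := by simpa [kC4] using h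
    rw [pow_eq_zero_iff (by norm_num)] at this
    rw [this]
  rcases mul_eq_zero.mp hfac with hxy | hr
  · rcases mul_eq_zero.mp hxy with hx | hy
    · exact hx0 hx h4
    · subst hy
      have : x ^ 20 = 0 := by simpa [kC4] using h4
      rw [pow_eq_zero_iff (by norm_num)] at this
      rw [this]
  · rw [h4, hr, mul_zero, zero_add] at hid
    rcases mul_eq_zero.mp hid.symm with h' | h'
    · rcases mul_eq_zero.mp h' with h'' | h''
      · exact absurd h'' (by norm_num)
      · have hy : y = 0 := (pow_eq_zero_iff (by norm_num)).mp h''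
        subst hy
        have hx : x ^ 10 = 0 := by simpa using hr
        rw [(pow_eq_zero_iff (by norm_num)).mp hx]
    · have hy5 : y ^ 5 = -11 * x ^ 5 := by linear_combination h'
      have hx10 : x ^ 10 = 0 := by
        have e : x ^ 10 = x ^ 10 - 11 * x ^ 5 * y ^ 5 - y ^ 10 := by
          rw [show y ^ 10 = (y ^ 5) ^ 2 by ring, hy5]; ring
        rw [e]; exact hr
      have hx : x = 0 := (pow_eq_zero_iff (by norm_num)).mp hx10
      subst hx
      have hy : y = 0 := by
        have : y ^ 5 = 0 := by rw [hy5]; ring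
        exact (pow_eq_zero_iff (by norm_num)).mp this
      rw [hy]

/-- **I2+I3 (S, "an even polynomial function has no linear Taylor term"), for `c₄^{Kl}`:** -/
theorem kC4_dir_deriv_eq_zero_of_even [CharZero F] (x y u w : F)
    (hev : ∀ t : F, kC4 (x + t * u) (y + t * w) = kC4 (x - t * u) (y - t * w)) :
    kC4a x y * u + kC4b x y * w = 0 := by
  haveI : Infinite F := Infinite.of_injective (Nat.cast : ℕ → F) Nat.cast_injective
  have hP : kC4 (Polynomial.C x + Polynomial.C u * Polynomial.X)
        (Polynomial.C y + Polynomial.C w * Polynomial.X) =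
      kC4 (Polynomial.C x + Polynomial.C (-u) * Polynomial.X)
        (Polynomial.C y + Polynomial.C (-w) * Polynomial.X) := by
    apply Polynomial.funext
    intro t
    rw [← Polynomial.coe_evalRingHom, map_kC4, map_kC4]
    simp only [Polynomial.coe_evalRingHom, Polynomial.eval_add, Polynomial.eval_mul,
      Polynomial.eval_C, Polynomial.eval_X]
    have h := hev t
    convert h using 2 <;> ring
  have hD := congrArg (fun p => (Polynomial.derivative p).eval 0) hP
  rw [lineDeriv_kC4, lineDeriv_kC4] at hD
  have h2 : (2 : F) * (kC4a x y * u + kC4b x y * w) = 0 := by linear_combination hD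
  exact (mul_eq_zero.mp h2).resolve_left two_ne_zero

/-- … and for `D`. -/
theorem kD_dir_deriv_eq_zero_of_even [CharZero F] (x y u w : F)
    (hev : ∀ t : F, kD (x + t * u) (y + t * w) = kD (x - t * u) (y - t * w)) :
    kDa x y * u + kDb x y * w = 0 := by
  haveI : Infinite F := Infinite.of_injective (Nat.cast : ℕ → F) Nat.cast_injective
  have hP : kD (Polynomial.C x + Polynomial.C u * Polynomial.X)
        (Polynomial.C y + Polynomial.C w * Polynomial.X) =
      kD (Polynomial.C x + Polynomial.C (-u) * Polynomial.X)
        (Polynomial.C y + Polynomial.C (-w) * Polynomial.X) := by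
    apply Polynomial.funext
    intro t
    rw [← Polynomial.coe_evalRingHom, map_kD, map_kD]
    simp only [Polynomial.coe_evalRingHom, Polynomial.eval_add, Polynomial.eval_mul,
      Polynomial.eval_C, Polynomial.eval_X]
    have h := hev t
    convert h using 2 <;> ring
  have hD := congrArg (fun p => (Polynomial.derivative p).eval 0) hP
  rw [lineDeriv_kD, lineDeriv_kD] at hD
  have h2 : (2 : F) * (kDa x y * u + kDb x y * w) = 0 := by linear_combination hD
  exact (mul_eq_zero.mp h2).resolve_left two_ne_zero

theorem ap_mul_left (g : Matrix (Fin 2) (Fin 2) F) (s x y : F) :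
    ap g (s * x) (s * y) = (s * (ap g x y).1, s * (ap g x y).2) := by
  simp only [ap]
  refine Prod.ext ?_ ?_ <;> dsimp only <;> ring

theorem ap_add_mul (g : Matrix (Fin 2) (Fin 2) F) (x y t u w : F) :
    ap g (x + t * u) (y + t * w) =
      ((ap g x y).1 + t * (ap g u w).1, (ap g x y).2 + t * (ap g u w).2) := by
  simp only [ap]
  refine Prod.ext ?_ ?_ <;> dsimp only <;> ring

/-- **H9 = INV (THE NEW LEMMA; PROVED here from I2+I3 and I5): fixed points of a non-scalar
projective involution `g = M_{v'}M_v⁻¹` between two torsor points of the same `(c₄, c₆)` are EDGE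
MIDPOINTS.**  By H6, `D∘g = c·D` with `c⁵ = 1` and `c₄^{Kl}∘g = c₄^{Kl}`; `g² = μ·1` gives
`μ²⁰ = 1`, `c² = μ¹²`, so `c = ν³²` for the eigenvalue `ν` (`ν² = μ`); comparing at the eigenvector
forces `ν²⁰ = 1` (I5: `D`, `c₄^{Kl}` have no common zero), hence `c = ν¹²`, and then
`t ↦ c₄^{Kl}(e + te')`, `t ↦ D(e + te')` are even (`e'` the `−ν`-eigenvector), so (I2+I3) both
gradients at `e` kill `e'`, `Jac(D, c₄^{Kl})(e) = 20 c₆^{Kl}(e) = 0` (`klein_jacobian`), and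
`c₄^{Kl}(e) ≠ 0` by the syzygy and I5. -/
theorem edge_of_eigenvector [CharZero F] (a b a' b' : F) (hne : kC4 a b ^ 3 ≠ kC6 a b ^ 2)
    (h4 : kC4 a' b' = kC4 a b) (h6 : kC6 a' b' = kC6 a b)
    (μ : F) (hsq : Gm a b a' b' * Gm a b a' b' = μ • 1) (hns : ∀ l : F, Gm a b a' b' ≠ l • 1)
    (x y ν : F) (h0 : (x, y) ≠ (0, 0)) (he : ap (Gm a b a' b') x y = (ν * x, ν * y)) :
    kC6 x y = 0 ∧ kC4 x y ≠ 0 := by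
  have hD : kD a b ≠ 0 := kD_ne_zero_of_ne a b hne
  have hD' : kD a' b' ≠ 0 := kD_ne_zero_of_ne a' b' (by rw [h4, h6]; exact hne)
  obtain ⟨hgD, hg4⟩ := klein_comp_Gm a b a' b' hD h4 h6
  have hdetG : (Gm a b a' b').det ≠ 0 := Gm_det_ne a b a' b' hD hD'
  obtain ⟨G, hG⟩ : ∃ G, G = Gm a b a' b' := ⟨_, rfl⟩
  rw [← hG] at hsq hns he hgD hg4 hdetG
  obtain ⟨c, hc⟩ : ∃ c, c = kD a' b' / kD a b := ⟨_, rfl⟩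
  rw [← hc] at hgD
  have hc0 : c ≠ 0 := by rw [hc]; exact div_ne_zero hD' hD
  -- `c⁵ = 1` from the syzygy for `v` and `v'`
  have hc5 : c ^ 5 = 1 := by
    have h1 := klein_syzygy a b
    have h2 := klein_syzygy a' b'
    rw [h4, h6, h1] at h2
    have h3 : kD a b ^ 5 = kD a' b' ^ 5 := mul_left_cancel₀ (by norm_num : (1728 : F) ≠ 0) h2
    rw [hc, div_pow, ← h3, div_self (pow_ne_zero _ hD)]
  -- consequences of `G² = μ`
  have hsq_ap : ∀ u w : F, ap G (ap G u w).1 (ap G u w).2 = (μ * u, μ * w) := by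
    intro u w
    rw [← ap_mul, hsq, ap_smul, ap_one]
  have hμ20 : μ ^ 20 = 1 := by
    have := hg4 (ap G 1 0).1 (ap G 1 0).2
    rw [hsq_ap, hg4] at this
    dsimp only at this
    rw [kC4_smul] at this
    have h10 : kC4 (1 : F) 0 = 1 := by simp [kC4]
    rw [h10, mul_one] at this
    exact this
  have hc2 : c ^ 2 = μ ^ 12 := by
    have := hgD (ap G 1 1).1 (ap G 1 1).2
    rw [hsq_ap, hgD] at this
    dsimp only at this
    rw [kD_smul] at this
    have h11 : kD (1 : F) 1 = -11 := by simp only [kD]; norm_num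
    rw [h11] at this
    have h' : (-11 : F) * c ^ 2 = (-11) * μ ^ 12 := by linear_combination -this
    exact mul_left_cancel₀ (by norm_num : (-11 : F) ≠ 0) h'
  -- the eigenvalue
  have hν0 : ν ≠ 0 := eigen_ne_zero G hdetG x y ν h0 he
  have hν2 : ν ^ 2 = μ := by
    have h1 := hsq_ap x y
    rw [he] at h1
    dsimp only at h1
    rw [ap_mul_left, he] at h1
    dsimp only at h1
    have hx := congrArg Prod.fst h1
    have hy := congrArg Prod.snd h1
    dsimp only at hx hy
    by_contra hc'
    apply h0
    have hx' : (ν ^ 2 - μ) * x = 0 := by linear_combination hx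
    have hy' : (ν ^ 2 - μ) * y = 0 := by linear_combination hy
    have hs : ν ^ 2 - μ ≠ 0 := sub_ne_zero.mpr hc'
    rw [Prod.mk.injEq]
    exact ⟨(mul_eq_zero.mp hx').resolve_left hs, (mul_eq_zero.mp hy').resolve_left hs⟩
  have hν40 : ν ^ 40 = 1 := by rw [show ν ^ 40 = (ν ^ 2) ^ 20 by ring, hν2, hμ20]
  have hc32 : c = ν ^ 32 := by
    have h6' : c ^ 6 = ν ^ 32 := by
      rw [show c ^ 6 = (c ^ 2) ^ 3 by ring, hc2, ← hν2]
      linear_combination ν ^ 32 * hν40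
    calc c = c * c ^ 5 := by rw [hc5, mul_one]
      _ = c ^ 6 := by ring
      _ = ν ^ 32 := h6'
  -- the second eigenvector `e' = (u, w)`: `G e' = -ν e'`
  have hE := fun i j => congrFun (congrFun hsq i) j
  have e00 := hE 0 0
  have e01 := hE 0 1
  have e10 := hE 1 0
  have e11 := hE 1 1
  simp [Matrix.mul_apply, Fin.sum_univ_two, Matrix.smul_apply] at e00 e01 e10 e11
  obtain ⟨u, w, huw0, huw⟩ : ∃ u w : F, (u, w) ≠ (0, 0) ∧ ap G u w = (-ν * u, -ν * w) := by
    by_cases hp : (G 0 0 - ν, G 1 0) ≠ ((0 : F), (0 : F))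
    · refine ⟨G 0 0 - ν, G 1 0, hp, ?_⟩
      simp only [ap]
      refine Prod.ext ?_ ?_ <;> dsimp only
      · linear_combination e00 - hν2
      · linear_combination e10
    by_cases hq : (G 0 1, G 1 1 - ν) ≠ ((0 : F), (0 : F))
    · refine ⟨G 0 1, G 1 1 - ν, hq, ?_⟩
      simp only [ap]
      refine Prod.ext ?_ ?_ <;> dsimp only
      · linear_combination e01
      · linear_combination e11 - hν2
    exfalso
    push_neg at hp hq
    rw [Prod.mk.injEq] at hp hq
    apply hns ν
    ext i j
    fin_cases i <;> fin_cases j <;> simp [Matrix.smul_apply]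
    · linear_combination hp.1
    · exact hq.1
    · exact hp.2
    · linear_combination hq.2
  -- twisted evenness along `e'`
  have hev4 : ∀ t : F, kC4 (x + t * u) (y + t * w) = ν ^ 20 * kC4 (x - t * u) (y - t * w) := by
    intro t
    have := hg4 (x + t * u) (y + t * w)
    rw [ap_add_mul, he, huw] at this
    dsimp only at this
    rw [show ν * x + t * (-ν * u) = ν * (x - t * u) by ring,
      show ν * y + t * (-ν * w) = ν * (y - t * w) by ring, kC4_smul] at this
    exact this.symm
  have hevD : ∀ t : F, c * kD (x + t * u) (y + t * w) = ν ^ 12 * kD (x - t * u) (y - t * w) := by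
    intro t
    have := hgD (x + t * u) (y + t * w)
    rw [ap_add_mul, he, huw] at this
    dsimp only at this
    rw [show ν * x + t * (-ν * u) = ν * (x - t * u) by ring,
      show ν * y + t * (-ν * w) = ν * (y - t * w) by ring, kD_smul] at this
    exact this.symm
  -- `ν²⁰ = 1` (here I5 enters), hence `c = ν¹²` and genuine evenness
  have hν20 : ν ^ 20 = 1 := by
    by_contra hν20
    have h4x : kC4 x y = 0 := by
      have h := hev4 0
      simp only [zero_mul, add_zero, sub_zero] at h
      have h' : (ν ^ 20 - 1) * kC4 x y = 0 := by linear_combination -h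
      exact (mul_eq_zero.mp h').resolve_left (sub_ne_zero.mpr hν20)
    have hDx : kD x y ≠ 0 := fun h => kC4_ne_zero_of_kD_eq_zero x y h0 h h4x
    have hc12 : c = ν ^ 12 := by
      have h := hevD 0
      simp only [zero_mul, add_zero, sub_zero] at h
      exact mul_right_cancel₀ hDx h
    apply hν20
    have key : ν ^ 12 * (ν ^ 20 - 1) = 0 := by linear_combination -hc32 + hc12
    exact sub_eq_zero.mp ((mul_eq_zero.mp key).resolve_left (pow_ne_zero _ hν0))
  have hc12 : c = ν ^ 12 := by rw [hc32]; linear_combination ν ^ 12 * hν20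
  have hev4' : ∀ t : F, kC4 (x + t * u) (y + t * w) = kC4 (x - t * u) (y - t * w) := by
    intro t
    rw [hev4 t, hν20, one_mul]
  have hevD' : ∀ t : F, kD (x + t * u) (y + t * w) = kD (x - t * u) (y - t * w) := by
    intro t
    have h := hevD t
    rw [hc12] at h
    exact mul_left_cancel₀ (pow_ne_zero _ hν0) h
  -- (I2+I3): both gradients at `e` kill `e'`, so the Jacobian vanishes at `e`
  have g4 := kC4_dir_deriv_eq_zero_of_even x y u w hev4'
  have gD := kD_dir_deriv_eq_zero_of_even x y u w hevD'
  have hJ : kDa x y * kC4b x y - kDb x y * kC4a x y = 0 := by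
    have hu' : (kDa x y * kC4b x y - kDb x y * kC4a x y) * u = 0 := by
      linear_combination kC4b x y * gD - kDb x y * g4
    have hw' : (kDa x y * kC4b x y - kDb x y * kC4a x y) * w = 0 := by
      linear_combination kDa x y * g4 - kC4a x y * gD
    by_contra hJ
    apply huw0
    rw [Prod.mk.injEq]
    exact ⟨(mul_eq_zero.mp hu').resolve_left hJ, (mul_eq_zero.mp hw').resolve_left hJ⟩
  have h6x : kC6 x y = 0 := by
    have h := klein_jacobian x y
    rw [hJ] at h
    exact (mul_eq_zero.mp h.symm).resolve_left (by norm_num)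
  refine ⟨h6x, fun h4x => ?_⟩
  have h := klein_syzygy x y
  rw [h4x, h6x] at h
  have hDx : kD x y = 0 := by
    have h' : (1728 : F) * kD x y ^ 5 = 0 := by rw [← h]; norm_num
    exact pow_eq_zero_iff (by norm_num) |>.mp ((mul_eq_zero.mp h').resolve_left (by norm_num))
  exact kC4_ne_zero_of_kD_eq_zero x y h0 hDx h4x

end KleinField

section KleinAlgClosed
variable {F : Type*} [Field F]

open Polynomial in
/-- **H2 = T1 (PROVED here; was open in g9): torsor points exist.**  Recipe (uses I5, proved above): the
polynomial `p(a) := c₆²·c₄^{Kl}(a,1)³ − c₄³·c₆^{Kl}(a,1)²` has degree EXACTLY 60 (leading coefficient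
`c₆² − c₄³ ≠ 0`), so it has a root `a₀` (`IsAlgClosed.exists_root`); `c₄^{Kl}, c₆^{Kl}` have no common
zero on `(a₀,1)` (syzygy + I5), so `v₀ = (a₀, 1)` has `c₄^{Kl}(v₀)³ : c₆^{Kl}(v₀)² = c₄³ : c₆²`; rescale
`v = λ v₀` with `λ¹⁰ = (c₆ c₄^{Kl}(v₀)) / (c₄ c₆^{Kl}(v₀))` (then `λ²⁰ = c₄/c₄^{Kl}(v₀)`,
`λ³⁰ = c₆/c₆^{Kl}(v₀)`); the cases `c₄ = 0` / `c₆ = 0` use a root of `c₄^{Kl}(a,1)` / `c₆^{Kl}(a,1)` and a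
30th / 20th root. -/
theorem exists_torsorPoint [IsAlgClosed F] [CharZero F] (c₄ c₆ : F) (h : c₄ ^ 3 ≠ c₆ ^ 2) :
    ∃ a b : F, kC4 a b = c₄ ∧ kC6 a b = c₆ := by
  -- the dehomogenised forms as honest polynomials
  have hA4 : kC4 (X : F[X]) 1 = X ^ 20 + 228 * X ^ 15 + 494 * X ^ 10 - 228 * X ^ 5 + 1 := by
    simp only [kC4]; ring
  have hA6 : kC6 (X : F[X]) 1 =
      -(X ^ 30 - 522 * X ^ 25 - 10005 * X ^ 20 - 10005 * X ^ 10 + 522 * X ^ 5 + 1) := by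
    simp only [kC6]; ring
  have hm4 : (kC4 (X : F[X]) 1).Monic := by rw [hA4]; monicity!
  have hd4 : (kC4 (X : F[X]) 1).natDegree = 20 := by rw [hA4]; compute_degree!
  have hm6 : (-kC6 (X : F[X]) 1).Monic := by rw [hA6, neg_neg]; monicity!
  have hd6 : (-kC6 (X : F[X]) 1).natDegree = 30 := by rw [hA6, neg_neg]; compute_degree!
  have ev4 : ∀ a : F, (kC4 (X : F[X]) 1).eval a = kC4 a 1 := by
    intro a; rw [← Polynomial.coe_evalRingHom, map_kC4]; simp
  have ev6 : ∀ a : F, (kC6 (X : F[X]) 1).eval a = kC6 a 1 := by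
    intro a; rw [← Polynomial.coe_evalRingHom, map_kC6]; simp
  -- no common zero of `c₄^{Kl}(·,1)` and `c₆^{Kl}(·,1)` (syzygy + I5)
  have hnc : ∀ a : F, kC4 a 1 = 0 → kC6 a 1 ≠ 0 := by
    intro a h4 h6
    have hs := klein_syzygy a 1
    rw [h4, h6] at hs
    have hD : kD a 1 = 0 := by
      have h' : (1728 : F) * kD a 1 ^ 5 = 0 := by rw [← hs]; norm_num
      exact pow_eq_zero_iff (by norm_num) |>.mp ((mul_eq_zero.mp h').resolve_left (by norm_num))
    exact kC4_ne_zero_of_kD_eq_zero a 1 (by simp) hD h4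
  -- roots of the one-variable forms exist
  have root4 : ∃ a : F, kC4 a 1 = 0 := by
    have hdeg : (kC4 (X : F[X]) 1).degree ≠ 0 := by
      rw [Polynomial.degree_eq_natDegree hm4.ne_zero, hd4]; decide
    obtain ⟨a, ha⟩ := IsAlgClosed.exists_root _ hdeg
    exact ⟨a, by rw [← ev4]; exact ha⟩
  have root6 : ∃ a : F, kC6 a 1 = 0 := by
    have hdeg : (-kC6 (X : F[X]) 1).degree ≠ 0 := by
      rw [Polynomial.degree_eq_natDegree hm6.ne_zero, hd6]; decide
    obtain ⟨a, ha⟩ := IsAlgClosed.exists_root _ hdeg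
    refine ⟨a, ?_⟩
    have : (-kC6 (X : F[X]) 1).eval a = 0 := ha
    rw [Polynomial.eval_neg, neg_eq_zero, ev6] at this
    exact this
  by_cases h4 : c₄ = 0
  · -- `c₄ = 0`, `c₆ ≠ 0`: a zero of `c₄^{Kl}` rescaled by a 30th root
    have h6 : c₆ ≠ 0 := by rintro rfl; apply h; rw [h4]; ring
    obtain ⟨a, ha⟩ := root4
    have hK6 := hnc a ha
    obtain ⟨l, hl⟩ := IsAlgClosed.exists_pow_nat_eq (c₆ / kC6 a 1) (by norm_num : 0 < 30)
    refine ⟨l * a, l * 1, ?_, ?_⟩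
    · rw [kC4_smul, ha, mul_zero, h4]
    · rw [kC6_smul, hl, div_mul_cancel₀ _ hK6]
  by_cases h6 : c₆ = 0
  · -- `c₆ = 0`, `c₄ ≠ 0`: a zero of `c₆^{Kl}` rescaled by a 20th root
    obtain ⟨a, ha⟩ := root6
    have hK4 : kC4 a 1 ≠ 0 := fun h4' => hnc a h4' ha
    obtain ⟨l, hl⟩ := IsAlgClosed.exists_pow_nat_eq (c₄ / kC4 a 1) (by norm_num : 0 < 20)
    refine ⟨l * a, l * 1, ?_, ?_⟩
    · rw [kC4_smul, hl, div_mul_cancel₀ _ hK4]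
    · rw [kC6_smul, ha, mul_zero, h6]
  -- generic case: a root of `P := c₆² (c₄^{Kl})³ − c₄³ (c₆^{Kl})²`, of degree 60
  obtain ⟨P, hP⟩ : ∃ P : F[X],
      P = Polynomial.C (c₆ ^ 2) * (kC4 (X : F[X]) 1) ^ 3 -
        Polynomial.C (c₄ ^ 3) * (kC6 (X : F[X]) 1) ^ 2 := ⟨_, rfl⟩
  have hc4 : ((kC4 (X : F[X]) 1) ^ 3).coeff 60 = 1 := by
    have hm := hm4.pow 3
    have hd : ((kC4 (X : F[X]) 1) ^ 3).natDegree = 60 := by rw [hm4.natDegree_pow, hd4]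
    have := hm.coeff_natDegree; rwa [hd] at this
  have hc6 : ((kC6 (X : F[X]) 1) ^ 2).coeff 60 = 1 := by
    have hm := hm6.pow 2
    have hd : ((-kC6 (X : F[X]) 1) ^ 2).natDegree = 60 := by rw [hm6.natDegree_pow, hd6]
    have := hm.coeff_natDegree; rw [hd, neg_pow, show ((-1 : F[X]) ^ 2) = 1 by norm_num,
      one_mul] at this; exact this
  have hP60 : P.coeff 60 = c₆ ^ 2 - c₄ ^ 3 := by
    rw [hP, Polynomial.coeff_sub, Polynomial.coeff_C_mul, Polynomial.coeff_C_mul, hc4, hc6]; ring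
  have hdeg : P.degree ≠ 0 := by
    intro h0
    have h60 : ((60 : ℕ) : WithBot ℕ) ≤ P.degree :=
      Polynomial.le_degree_of_ne_zero (by rw [hP60]; exact sub_ne_zero.mpr (Ne.symm h))
    rw [h0] at h60
    exact absurd h60 (by decide)
  obtain ⟨a, ha⟩ := IsAlgClosed.exists_root P hdeg
  have hPa : c₆ ^ 2 * kC4 a 1 ^ 3 - c₄ ^ 3 * kC6 a 1 ^ 2 = 0 := by
    have : P.eval a = 0 := ha
    rwa [hP, Polynomial.eval_sub, Polynomial.eval_mul, Polynomial.eval_mul, Polynomial.eval_C,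
      Polynomial.eval_C, Polynomial.eval_pow, Polynomial.eval_pow, ev4, ev6] at this
  have hK4 : kC4 a 1 ≠ 0 := by
    intro h4'
    have : c₄ ^ 3 * kC6 a 1 ^ 2 = 0 := by rw [h4'] at hPa; linear_combination -hPa
    rcases mul_eq_zero.mp this with h' | h'
    · exact h4 ((pow_eq_zero_iff (by norm_num)).mp h')
    · exact hnc a h4' ((pow_eq_zero_iff (by norm_num)).mp h')
  have hK6 : kC6 a 1 ≠ 0 := by
    intro h6'
    have : c₆ ^ 2 * kC4 a 1 ^ 3 = 0 := by rw [h6'] at hPa; linear_combination hPa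
    rcases mul_eq_zero.mp this with h' | h'
    · exact h6 ((pow_eq_zero_iff (by norm_num)).mp h')
    · exact hK4 ((pow_eq_zero_iff (by norm_num)).mp h')
  -- rescale by `λ` with `λ¹⁰ = t := (c₆/K6)/(c₄/K4)`; then `λ²⁰ K4 = c₄`, `λ³⁰ K6 = c₆`
  obtain ⟨t, ht⟩ : ∃ t : F, t = (c₆ * kC4 a 1) / (c₄ * kC6 a 1) := ⟨_, rfl⟩
  have ht2 : t ^ 2 * kC4 a 1 = c₄ := by
    rw [ht]; field_simp; linear_combination hPa
  have ht3 : t ^ 3 * kC6 a 1 = c₆ := by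
    rw [ht]; field_simp; linear_combination hPa
  obtain ⟨l, hl⟩ := IsAlgClosed.exists_pow_nat_eq t (by norm_num : 0 < 10)
  refine ⟨l * a, l * 1, ?_, ?_⟩
  · rw [kC4_smul, show l ^ 20 = (l ^ 10) ^ 2 by ring, hl, ht2]
  · rw [kC6_smul, show l ^ 30 = (l ^ 10) ^ 3 by ring, hl, ht3]

end KleinAlgClosed

/-! ## §4 NEW (g10): Galois side — three small helpers -/

section Galois

local notation "ℚbar" => AlgebraicClosure ℚ
local notation "Γ" => Field.absoluteGaloisGroup ℚ

/-- **H1 (Galois glue; PROOF ATTEMPTED here): an element of `Γ_{ℚ(ζ₂₀)}` inverting `√−3`** (`√−3 ∉ ℚ(ζ₂₀) = ℚ(i, ζ₅)`,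
whose quadratic subfields are `ℚ(i), ℚ(√5), ℚ(√−5)`).  Recipe: `F := ℚ⟮ζ₂₀⟯ ≤ ℚbar`
(`IntermediateField.adjoin`), `[F(√−3) : F] = 2` from `ℚ(ζ₂₀, √−3) = ℚ(ζ₆₀)` of degree `φ(60) = 16 > 8`
(`Polynomial.cyclotomic.irreducible_rat`, `IsCyclotomicExtension.finrank`); the non-trivial
`F`-automorphism of `F(√−3)` extends to `ℚbar` (`IsAlgClosed.lift`, bijective by
`Algebra.IsAlgebraic.algHom_bijective`), and is transported to `Γ` by `Field.absoluteGaloisGroup.toAlgEquiv`. -/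
theorem exists_sigma_fix20_negSqrt3 :
    ∃ σ : Γ, (∀ z : ℚbar, z ^ 20 = 1 → σ • z = z) ∧ (∀ s : ℚbar, s ^ 2 = -3 → σ • s = -s) := by
  haveI : Algebra.IsAlgebraic ℚ ℚbar := AlgebraicClosure.isAlgebraic ℚ
  -- a primitive 20th root of unity `ζ` and a square root `r` of `−3`
  obtain ⟨ζ, hζ⟩ : ∃ ζ : ℚbar, IsPrimitiveRoot ζ 20 := by
    have hdeg : (Polynomial.cyclotomic 20 ℚbar).degree ≠ 0 :=
      (Polynomial.degree_cyclotomic_pos 20 ℚbar (by norm_num)).ne'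
    obtain ⟨ζ, hζ⟩ := IsAlgClosed.exists_root _ hdeg
    exact ⟨ζ, Polynomial.isRoot_cyclotomic_iff.mp hζ⟩
  obtain ⟨r, hr⟩ : ∃ r : ℚbar, r ^ 2 = -3 := IsAlgClosed.exists_pow_nat_eq (-3) (by norm_num)
  -- `K = ℚ(ζ) = ℚ(μ₂₀)`, of degree `φ(20) = 8`
  obtain ⟨K, hK⟩ : ∃ K : IntermediateField ℚ ℚbar, K = IntermediateField.adjoin ℚ {ζ} := ⟨_, rfl⟩
  have hζK : ζ ∈ K := by rw [hK]; exact IntermediateField.mem_adjoin_simple_self ℚ ζ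
  have hζint : IsIntegral ℚ ζ := (Algebra.IsAlgebraic.isAlgebraic ζ).isIntegral
  have hKdeg : Module.finrank ℚ K = 8 := by
    rw [hK, IntermediateField.adjoin.finrank hζint, ← Polynomial.cyclotomic_eq_minpoly_rat hζ
      (by norm_num), Polynomial.natDegree_cyclotomic]
    decide
  haveI : FiniteDimensional ℚ K := by
    rw [hK]; exact IntermediateField.adjoin.finiteDimensional hζint
  -- `√−3 ∉ ℚ(μ₂₀)`: otherwise `ζ₃ ∈ K`, so `K ∋` a primitive 60th root of unity, `16 ≤ 8`
  have hrK : r ∉ K := by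
    intro hrK
    have h2K : (2 : ℚbar) ∈ K := by
      rw [← one_add_one_eq_two]; exact add_mem (one_mem K) (one_mem K)
    have hωK : (-1 + r) / 2 ∈ K := div_mem (add_mem (neg_mem (one_mem K)) hrK) h2K
    have hω : IsPrimitiveRoot ((-1 + r) / 2 : ℚbar) 3 := by
      refine (IsPrimitiveRoot.iff (by norm_num)).mpr ⟨?_, ?_⟩
      · linear_combination ((r - 3) / 8) * hr
      · intro l hl0 hl3 h
        interval_cases l
        · have h3 : r = 3 := by linear_combination 2 * h
          rw [h3] at hr; norm_num at hr
        · have h3 : r = -3 := by linear_combination (-2) * h + (1 / 2) * hr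
          rw [h3] at hr; norm_num at hr
    have h60 := IsPrimitiveRoot.pow_mul_pow_lcm hζ hω (by norm_num) (by norm_num)
    obtain ⟨μ, hμ⟩ : ∃ μ : ℚbar, μ = ζ ^ (20 / Nat.factorizationLCMLeft 20 3) *
        ((-1 + r) / 2) ^ (3 / Nat.factorizationLCMRight 20 3) := ⟨_, rfl⟩
    rw [← hμ, show Nat.lcm 20 3 = 60 by decide] at h60
    have hμK : μ ∈ K := by rw [hμ]; exact mul_mem (pow_mem hζK _) (pow_mem hωK _)
    have hμint : IsIntegral ℚ μ := (Algebra.IsAlgebraic.isAlgebraic μ).isIntegral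
    have h16 : Module.finrank ℚ (IntermediateField.adjoin ℚ {μ}) = 16 := by
      rw [IntermediateField.adjoin.finrank hμint, ← Polynomial.cyclotomic_eq_minpoly_rat h60
        (by norm_num), Polynomial.natDegree_cyclotomic]
      decide
    have hle : IntermediateField.adjoin ℚ {μ} ≤ K := IntermediateField.adjoin_simple_le_iff.mpr hμK
    have := IntermediateField.finrank_le_of_le_right hle
    rw [h16, hKdeg] at this
    norm_num at this
  -- `σ ∈ Gal(ℚbar/K)` with `σ(√−3) = −√−3`, from `minpoly_K(√−3) = X² + 3`
  haveI : IsAlgClosure ℚ ℚbar := AlgebraicClosure.instIsAlgClosure ℚ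
  haveI : Normal ℚ ℚbar := IsAlgClosure.normal ℚ ℚbar
  haveI : Normal K ℚbar := Normal.tower_top_of_normal ℚ K ℚbar
  have hrint : IsIntegral K r :=
    IsIntegral.tower_top ((Algebra.IsAlgebraic.isAlgebraic (R := ℚ) r).isIntegral)
  have hconj : IsConjRoot K r (-r) := by
    apply isConjRoot_of_aeval_eq_zero hrint
    have hdvd : minpoly K r ∣ Polynomial.X ^ 2 + 3 :=
      minpoly.dvd K r (by
        simp only [map_add, map_pow, Polynomial.aeval_X, map_ofNat, hr]; norm_num)
    have h2 : 2 ≤ (minpoly K r).natDegree :=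
      (minpoly.two_le_natDegree_iff hrint).mpr (by rintro ⟨k, hk⟩; exact hrK (hk ▸ k.2))
    have hq : (Polynomial.X ^ 2 + 3 : Polynomial K).Monic := by monicity!
    have hqd : (Polynomial.X ^ 2 + 3 : Polynomial K).natDegree = 2 := by compute_degree!
    have heq : Polynomial.X ^ 2 + 3 = minpoly K r :=
      Polynomial.eq_of_monic_of_dvd_of_natDegree_le (minpoly.monic hrint) hq hdvd
        (by rw [hqd]; exact h2)
    rw [← heq]
    simp only [map_add, map_pow, Polynomial.aeval_X, map_ofNat]
    linear_combination hr
  obtain ⟨σ, hσ⟩ := hconj.exists_algEquiv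
  have hσr : σ r = -r := by
    have := hσ; rw [map_neg] at this; linear_combination -this
  refine ⟨(Field.absoluteGaloisGroup.toAlgEquiv ℚ).symm (σ.restrictScalars ℚ), ?_, ?_⟩
  · intro z hz
    obtain ⟨i, -, rfl⟩ := hζ.eq_pow_of_pow_eq_one hz
    rw [Field.absoluteGaloisGroup.smul_def, MulEquiv.apply_symm_apply]
    show σ (ζ ^ i) = ζ ^ i
    have : σ ζ = ζ := σ.commutes (⟨ζ, hζK⟩ : K)
    rw [map_pow, this]
  · intro s hs
    rw [Field.absoluteGaloisGroup.smul_def, MulEquiv.apply_symm_apply]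
    show σ s = -s
    have hs' : (s - r) * (s + r) = 0 := by linear_combination hs - hr
    rcases mul_eq_zero.mp hs' with h | h
    · have : s = r := by linear_combination h
      rw [this, hσr]
    · have : s = -r := by linear_combination h
      rw [this, map_neg, hσr, neg_neg]

/-! ### G2 engine: `ℚ(ζ₂₀) = ℚ(i, η)`-identities for the edge midpoints (checked by `grind`) -/

theorem g2_sqrt5 {F : Type*} [Field F] (η : F) (hη : η ^ 4 + η ^ 3 + η ^ 2 + η + 1 = 0) :
    (2 * (-(η ^ 2 + η ^ 3)) - 1) ^ 2 = 5 := by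
  grind

/-- `x¹⁰ − u₊x⁵ − 1 = (x⁵ − (φ+c)⁵)(x⁵ − (φ−c)⁵)`, `φ = 2cos(π/5)`, `c = 2cos(π/10)`, `u₊ = 261+125√5`. -/
theorem g2_factorP {F : Type*} [Field F] (η i x : F) (hη : η ^ 4 + η ^ 3 + η ^ 2 + η + 1 = 0)
    (hi : i ^ 2 = -1) :
    x ^ 10 - (261 + 125 * (2 * (-(η ^ 2 + η ^ 3)) - 1)) * x ^ 5 - 1 =
      (x ^ 5 - (-(η ^ 2 + η ^ 3) + i * (η ^ 4 - η)) ^ 5) *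
        (x ^ 5 - (-(η ^ 2 + η ^ 3) - i * (η ^ 4 - η)) ^ 5) := by
  grind

/-- the `√5 ↦ −√5` conjugate: `φ' = −1/φ`, `c' = 2cos(3π/10)`, `u₋ = 261 − 125√5`. -/
theorem g2_factorM {F : Type*} [Field F] (η i x : F) (hη : η ^ 4 + η ^ 3 + η ^ 2 + η + 1 = 0)
    (hi : i ^ 2 = -1) :
    x ^ 10 - (261 - 125 * (2 * (-(η ^ 2 + η ^ 3)) - 1)) * x ^ 5 - 1 =
      (x ^ 5 - (-(η + η ^ 4) + i * (η ^ 3 - η ^ 2)) ^ 5) *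
        (x ^ 5 - (-(η + η ^ 4) - i * (η ^ 3 - η ^ 2)) ^ 5) := by
  grind

theorem g2_unitP {F : Type*} [Field F] (η i : F) (hη : η ^ 4 + η ^ 3 + η ^ 2 + η + 1 = 0)
    (hi : i ^ 2 = -1) :
    (-(η ^ 2 + η ^ 3) + i * (η ^ 4 - η)) * (-(η ^ 2 + η ^ 3) - i * (η ^ 4 - η)) = -1 := by
  grind

theorem g2_unitM {F : Type*} [Field F] (η i : F) (hη : η ^ 4 + η ^ 3 + η ^ 2 + η + 1 = 0)
    (hi : i ^ 2 = -1) :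
    (-(η + η ^ 4) + i * (η ^ 3 - η ^ 2)) * (-(η + η ^ 4) - i * (η ^ 3 - η ^ 2)) = -1 := by
  grind

theorem smul_eq_of_pow_five_eq (σ : Γ) (h5 : ∀ z : ℚbar, z ^ 5 = 1 → σ • z = z)
    {x r : ℚbar} (hr : r ≠ 0) (hσr : σ • r = r) (h5' : x ^ 5 = r ^ 5) : σ • x = x := by
  have hω : (x / r) ^ 5 = 1 := by rw [div_pow, h5', div_self (pow_ne_zero _ hr)]
  have hx : x = (x / r) * r := (div_mul_cancel₀ x hr).symm
  rw [hx, smul_mul', h5 _ hω, hσr]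

/-! ### G1 (was g9's): the twelve vertices are `ℚ(ζ₅)`-rational -/

theorem g1_factor {F : Type*} [Field F] (η x : F) (hη : η ^ 4 + η ^ 3 + η ^ 2 + η + 1 = 0) :
    x ^ 10 - 11 * x ^ 5 - 1 = (x ^ 5 - (-(η ^ 2 + η ^ 3)) ^ 5) * (x ^ 5 - (-(η + η ^ 4)) ^ 5) := by
  grind

theorem g1_unit {F : Type*} [Field F] (η : F) (hη : η ^ 4 + η ^ 3 + η ^ 2 + η + 1 = 0) :
    (-(η ^ 2 + η ^ 3)) * (-(η + η ^ 4)) = -1 := by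
  grind

/-- the golden ratio `φ = −(η² + η³)` is a vertex: `D(φ, 1) = 0`. -/
theorem g1_vertex {F : Type*} [Field F] (η : F) (hη : η ^ 4 + η ^ 3 + η ^ 2 + η + 1 = 0) :
    kD (-(η ^ 2 + η ^ 3)) (1 : F) = 0 := by
  simp only [kD]; grind

open Polynomial in
theorem exists_phi5_root : ∃ η : ℚbar, η ^ 4 + η ^ 3 + η ^ 2 + η + 1 = 0 := by
  have hdeg : (X ^ 4 + X ^ 3 + X ^ 2 + X + 1 : Polynomial ℚbar).degree ≠ 0 := by
    have : (X ^ 4 + X ^ 3 + X ^ 2 + X + 1 : Polynomial ℚbar).degree = 4 := by compute_degree!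
    rw [this]; decide
  obtain ⟨η, hη⟩ := IsAlgClosed.exists_root _ hdeg
  refine ⟨η, ?_⟩
  have : (X ^ 4 + X ^ 3 + X ^ 2 + X + 1 : Polynomial ℚbar).eval η = 0 := hη
  simpa only [Polynomial.eval_add, Polynomial.eval_pow, Polynomial.eval_X,
    Polynomial.eval_one] using this

theorem phi5_root_fixed (σ : Γ) (h5 : ∀ z : ℚbar, z ^ 5 = 1 → σ • z = z) {η : ℚbar}
    (hη : η ^ 4 + η ^ 3 + η ^ 2 + η + 1 = 0) : σ • η = η :=
  h5 η (by linear_combination (η - 1) * hη)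

/-- **G1 (PROVED): every root of `D(x,1) = x(x¹⁰ − 11x⁵ − 1)` is fixed by `σ ⊇ μ₅`**
(`x = 0` or `x⁵ = φ⁵, φ'⁵` with `φ, φ' = −1/φ ∈ ℚ(ζ₅)`). -/
theorem vertex_fixed (σ : Γ) (h5 : ∀ z : ℚbar, z ^ 5 = 1 → σ • z = z) (x : ℚbar)
    (hx : kD x 1 = 0) : σ • x = x := by
  obtain ⟨η, hη⟩ := exists_phi5_root
  have fixH : Field.absoluteGaloisGroup.toAlgEquiv ℚ σ η = η := phi5_root_fixed σ h5 hη
  have hx' : x * (x ^ 10 - 11 * x ^ 5 - 1) = 0 := by rw [← hx]; simp only [kD]; ring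
  rcases mul_eq_zero.mp hx' with h0 | h
  · rw [h0, smul_zero]
  obtain ⟨φ, hφ⟩ : ∃ φ : ℚbar, φ = -(η ^ 2 + η ^ 3) := ⟨_, rfl⟩
  obtain ⟨φ', hφ'⟩ : ∃ φ' : ℚbar, φ' = -(η + η ^ 4) := ⟨_, rfl⟩
  have hσφ : σ • φ = φ := by
    rw [Field.absoluteGaloisGroup.smul_def, hφ]; simp only [map_neg, map_add, map_pow, fixH]
  have hσφ' : σ • φ' = φ' := by
    rw [Field.absoluteGaloisGroup.smul_def, hφ']; simp only [map_neg, map_add, map_pow, fixH]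
  have hprod : φ * φ' = -1 := by rw [hφ, hφ']; exact g1_unit η hη
  have h1 : φ ≠ 0 := fun h => by rw [h, zero_mul] at hprod; norm_num at hprod
  have h2 : φ' ≠ 0 := fun h => by rw [h, mul_zero] at hprod; norm_num at hprod
  have hf : x ^ 10 - 11 * x ^ 5 - 1 = (x ^ 5 - φ ^ 5) * (x ^ 5 - φ' ^ 5) := by
    rw [hφ, hφ']; exact g1_factor η x hη
  rw [hf, mul_eq_zero] at h
  rcases h with h | h
  · exact smul_eq_of_pow_five_eq σ h5 h1 hσφ (sub_eq_zero.mp h)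
  · exact smul_eq_of_pow_five_eq σ h5 h2 hσφ' (sub_eq_zero.mp h)

open Polynomial in
/-- **G2 (PROVED here; was open in g9; kit j345457 A11: `c₆^{Kl}(x,1)` splits into 30 linear factors over
`ℚ(ζ₂₀)`): edge midpoints are `ℚ(ζ₂₀)`-rational.**  Recipe: `c₆^{Kl}(x,1) = −(x²+1)·∏(x − e_j)` with the
30 roots `i^a ζ₅^b·(explicit units of ℚ(ζ₂₀))` — equivalently the orbit of `i` under Klein's generators
`S, T, U ∈ GL₂(ℚ(ζ₂₀))` (kit A12); prove the factorisation by `ring` modulo `Φ₂₀(ζ) = 0`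
(`Polynomial.X_pow_sub_C_eq_prod` blocks of 5 as in H8/K2), then `σ` fixes each root. -/
theorem edge_fixed (σ : Γ) (h20 : ∀ z : ℚbar, z ^ 20 = 1 → σ • z = z) (x : ℚbar)
    (hx : kC6 x 1 = 0) : σ • x = x := by
  -- `ℚ(ζ₂₀) = ℚ(i, η)` with `i² = −1`, `Φ₅(η) = 0`
  have h5 : ∀ z : ℚbar, z ^ 5 = 1 → σ • z = z := fun z hz =>
    h20 z (by rw [show (20 : ℕ) = 5 * 4 from rfl, pow_mul, hz, one_pow])
  obtain ⟨i, hi⟩ : ∃ i : ℚbar, i ^ 2 = -1 := IsAlgClosed.exists_pow_nat_eq (-1) (by norm_num)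
  obtain ⟨η, hη⟩ := exists_phi5_root
  have hσi : σ • i = i :=
    h20 i (by rw [show (20 : ℕ) = 2 * 10 from rfl, pow_mul, hi]; norm_num)
  have fixI : Field.absoluteGaloisGroup.toAlgEquiv ℚ σ i = i := hσi
  have fixH : Field.absoluteGaloisGroup.toAlgEquiv ℚ σ η = η := phi5_root_fixed σ h5 hη
  -- `φ = 2cos(π/5)`, `c = 2cos(π/10)`, and their `√5 ↦ −√5` conjugates `φ'`, `c' = 2cos(3π/10)`
  obtain ⟨φ, hφ⟩ : ∃ φ : ℚbar, φ = -(η ^ 2 + η ^ 3) := ⟨_, rfl⟩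
  obtain ⟨c, hc⟩ : ∃ c : ℚbar, c = i * (η ^ 4 - η) := ⟨_, rfl⟩
  obtain ⟨φ', hφ'⟩ : ∃ φ' : ℚbar, φ' = -(η + η ^ 4) := ⟨_, rfl⟩
  obtain ⟨c', hc'⟩ : ∃ c' : ℚbar, c' = i * (η ^ 3 - η ^ 2) := ⟨_, rfl⟩
  have hσφ : σ • φ = φ := by
    rw [Field.absoluteGaloisGroup.smul_def, hφ]; simp only [map_neg, map_add, map_pow, fixH]
  have hσc : σ • c = c := by
    rw [Field.absoluteGaloisGroup.smul_def, hc]; simp only [map_mul, map_sub, map_pow, fixH, fixI]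
  have hσφ' : σ • φ' = φ' := by
    rw [Field.absoluteGaloisGroup.smul_def, hφ']; simp only [map_neg, map_add, map_pow, fixH]
  have hσc' : σ • c' = c' := by
    rw [Field.absoluteGaloisGroup.smul_def, hc']; simp only [map_mul, map_sub, map_pow, fixH, fixI]
  -- `√5 = 2φ − 1` and the factorisation of `c₆^{Kl}(x,1)` over `ℚ(√5)`
  have hs2 : (2 * φ - 1) ^ 2 = 5 := by rw [hφ]; exact g2_sqrt5 η hη
  have hfac : kC6 x 1 = -((x ^ 10 + 1) * ((x ^ 10 - (261 + 125 * (2 * φ - 1)) * x ^ 5 - 1) *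
      (x ^ 10 - (261 - 125 * (2 * φ - 1)) * x ^ 5 - 1))) := by
    simp only [kC6]; linear_combination (-15625 * (x ^ 10 + 1) * x ^ 10) * hs2
  rw [hfac, neg_eq_zero, mul_eq_zero, mul_eq_zero] at hx
  rcases hx with h10 | hP5 | hM5
  · -- `x ∈ μ₂₀`
    apply h20
    have : x ^ 10 = -1 := by linear_combination h10
    rw [show (20 : ℕ) = 10 * 2 from rfl, pow_mul, this]; norm_num
  · -- `x⁵ = (φ ± c)⁵`: the edges around the vertices `∞`, `0`
    have hf : x ^ 10 - (261 + 125 * (2 * φ - 1)) * x ^ 5 - 1 =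
        (x ^ 5 - (φ + c) ^ 5) * (x ^ 5 - (φ - c) ^ 5) := by rw [hφ, hc]; exact g2_factorP η i x hη hi
    have hprod : (φ + c) * (φ - c) = -1 := by rw [hφ, hc]; exact g2_unitP η i hη hi
    have hr1 : φ + c ≠ 0 := fun h => by rw [h, zero_mul] at hprod; norm_num at hprod
    have hr2 : φ - c ≠ 0 := fun h => by rw [h, mul_zero] at hprod; norm_num at hprod
    rw [hf, mul_eq_zero] at hP5
    rcases hP5 with h | h
    · exact smul_eq_of_pow_five_eq σ h5 hr1 (by rw [smul_add, hσφ, hσc]) (sub_eq_zero.mp h)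
    · exact smul_eq_of_pow_five_eq σ h5 hr2 (by rw [smul_sub, hσφ, hσc]) (sub_eq_zero.mp h)
  · -- `x⁵ = (φ' ± c')⁵`: the remaining ten edges
    have hf : x ^ 10 - (261 - 125 * (2 * φ - 1)) * x ^ 5 - 1 =
        (x ^ 5 - (φ' + c') ^ 5) * (x ^ 5 - (φ' - c') ^ 5) := by rw [hφ, hφ', hc']; exact g2_factorM η i x hη hi
    have hprod : (φ' + c') * (φ' - c') = -1 := by rw [hφ', hc']; exact g2_unitM η i hη hi
    have hr1 : φ' + c' ≠ 0 := fun h => by rw [h, zero_mul] at hprod; norm_num at hprod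
    have hr2 : φ' - c' ≠ 0 := fun h => by rw [h, mul_zero] at hprod; norm_num at hprod
    rw [hf, mul_eq_zero] at hM5
    rcases hM5 with h | h
    · exact smul_eq_of_pow_five_eq σ h5 hr1 (by rw [smul_add, hσφ', hσc']) (sub_eq_zero.mp h)
    · exact smul_eq_of_pow_five_eq σ h5 hr2 (by rw [smul_sub, hσφ', hσc']) (sub_eq_zero.mp h)

/-- **H7′ (PROVED; replaces g10-draft H7 "finite projective order"): Galois orbits are finite, so
some positive power of `σ` fixes `a`** (pigeonhole on the root set of `minpoly ℚ a`).  With H8 at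
`k = P` this gives `g_σ^P ∝ g_{σ^P} = 1`, i.e. the finite projective order of `g_σ`, for free. -/
theorem exists_pos_pow_smul_eq (σ : Γ) (a : ℚbar) : ∃ P : ℕ, 0 < P ∧ (σ ^ P) • a = a := by
  classical
  haveI : Algebra.IsAlgebraic ℚ ℚbar := AlgebraicClosure.isAlgebraic ℚ
  have hint : IsIntegral ℚ a := (Algebra.IsAlgebraic.isAlgebraic a).isIntegral
  have hroot : ∀ k : ℕ, (σ ^ k) • a ∈ (minpoly ℚ a).rootSet ℚbar := by
    intro k
    rw [Polynomial.mem_rootSet_of_ne (minpoly.ne_zero hint), Field.absoluteGaloisGroup.smul_def]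
    have key := Polynomial.aeval_algHom_apply
      (AlgEquiv.toAlgHom (Field.absoluteGaloisGroup.toAlgEquiv ℚ (σ ^ k))) a (minpoly ℚ a)
    rw [minpoly.aeval, map_zero] at key
    exact key
  have hfin := Polynomial.rootSet_finite (minpoly ℚ a) ℚbar
  obtain ⟨i, j, hij, heq⟩ : ∃ i j : ℕ, i ≠ j ∧ (σ ^ i) • a = (σ ^ j) • a := by
    by_contra hcon
    push_neg at hcon
    have hinj : Function.Injective (fun k : ℕ => (σ ^ k) • a) :=
      fun i j h => by_contra fun hne => hcon i j hne h
    exact Set.infinite_of_injective_forall_mem hinj hroot hfin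
  -- wlog `i < j`; cancel `σ^i`
  have main : ∀ i j : ℕ, i < j → (σ ^ i) • a = (σ ^ j) • a → ∃ P : ℕ, 0 < P ∧ (σ ^ P) • a = a := by
    intro i j h heq
    refine ⟨j - i, Nat.sub_pos_of_lt h, ?_⟩
    apply MulAction.injective (σ ^ i)
    dsimp only
    rw [smul_smul, ← pow_add, Nat.add_sub_cancel' h.le, ← heq]
  rcases Nat.lt_or_gt_of_ne hij with h | h
  · exact main i j h heq
  · exact main j i h heq.symm

/-! ### proved Galois glue -/

theorem smul_fix_pow (σ : Γ) {z : ℚbar} (h : σ • z = z) (k : ℕ) : (σ ^ k) • z = z := by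
  induction k with
  | zero => simp
  | succ k ih => rw [pow_succ, mul_smul, h, ih]

theorem smul_neg_pow_odd (σ : Γ) {s : ℚbar} (h : σ • s = -s) {k : ℕ} (hk : Odd k) :
    (σ ^ k) • s = -s := by
  obtain ⟨j, rfl⟩ := hk
  have h2 : (σ ^ 2) • s = s := by rw [pow_two, mul_smul, h, smul_neg, h, neg_neg]
  rw [pow_succ, mul_smul, h, smul_neg, pow_mul, smul_fix_pow (σ ^ 2) h2 j]

theorem smul_kC4 (τ : Γ) (a b : ℚbar) : τ • kC4 a b = kC4 (τ • a) (τ • b) := by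
  simp only [Field.absoluteGaloisGroup.smul_def, kC4, map_add, map_sub, map_mul, map_pow, map_ofNat]

theorem smul_kC6 (τ : Γ) (a b : ℚbar) : τ • kC6 a b = kC6 (τ • a) (τ • b) := by
  simp only [Field.absoluteGaloisGroup.smul_def, kC6, map_add, map_sub, map_neg, map_mul, map_pow,
    map_ofNat]

theorem smul_tE (τ : Γ) (a b e₁ e₂ : ℚbar) :
    τ • tE a b e₁ e₂ = tE (τ • a) (τ • b) (τ • e₁) (τ • e₂) := by
  simp only [Field.absoluteGaloisGroup.smul_def, tE, kDa, kDb, map_div₀, map_add, map_sub, map_mul,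
    map_pow, map_ofNat]

/-! ### H8 machinery (g10, PROVED): `σ` acting on matrices, the cocycle, and `σ(g_σ) ∝ g_σ` -/

theorem smul_kD (τ : Γ) (a b : ℚbar) : τ • kD a b = kD (τ • a) (τ • b) := by
  simp only [Field.absoluteGaloisGroup.smul_def, kD, map_sub, map_mul, map_pow, map_ofNat]

/-- `σ` applied entrywise to a `2 × 2` matrix (a ring homomorphism). -/
noncomputable def gal (σ : Γ) : Matrix (Fin 2) (Fin 2) ℚbar →+* Matrix (Fin 2) (Fin 2) ℚbar :=
  ((Field.absoluteGaloisGroup.toAlgEquiv ℚ σ : ℚbar ≃ₐ[ℚ] ℚbar) : ℚbar →+* ℚbar).mapMatrix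

theorem gal_apply (σ : Γ) (M : Matrix (Fin 2) (Fin 2) ℚbar) (i j : Fin 2) :
    gal σ M i j = σ • M i j := by
  simp [gal, Field.absoluteGaloisGroup.smul_def]

theorem gal_smul (σ : Γ) (μ : ℚbar) (M : Matrix (Fin 2) (Fin 2) ℚbar) :
    gal σ (μ • M) = (σ • μ) • gal σ M := by
  ext i j; simp only [gal_apply, Matrix.smul_apply, smul_eq_mul, smul_mul']

theorem gal_det (σ : Γ) (M : Matrix (Fin 2) (Fin 2) ℚbar) : (gal σ M).det = σ • M.det := by
  simp only [Matrix.det_fin_two, gal_apply, smul_sub, smul_mul']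

theorem gal_Mv (σ : Γ) (a b : ℚbar) : gal σ (Mv a b) = Mv (σ • a) (σ • b) := by
  ext i j
  fin_cases i <;> fin_cases j <;>
    simp [gal_apply, Mv, kDa, kDb, Field.absoluteGaloisGroup.smul_def, map_sub, map_mul, map_pow,
      map_ofNat, map_neg]

theorem ap_gal (σ : Γ) (M : Matrix (Fin 2) (Fin 2) ℚbar) (x y : ℚbar) :
    ap (gal σ M) (σ • x) (σ • y) = (σ • (ap M x y).1, σ • (ap M x y).2) := by
  simp only [ap, gal_apply, smul_add, smul_mul']

/-- **K1 (PROVED), the cocycle:** `g_{σ∘w} = σ(g_w) · g_σ`. -/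
theorem Gm_cocycle (σ : Γ) (a b a' b' : ℚbar) (hD : kD a b ≠ 0) :
    Gm a b (σ • a') (σ • b') = gal σ (Gm a b a' b') * Gm a b (σ • a) (σ • b) := by
  calc Gm a b (σ • a') (σ • b') = Mv (σ • a') (σ • b') * (Mv a b)⁻¹ := rfl
    _ = gal σ (Mv a' b') * (Mv a b)⁻¹ := by rw [gal_Mv]
    _ = gal σ (Gm a b a' b' * Mv a b) * (Mv a b)⁻¹ := by rw [Gm_mul_Mv a b a' b' hD]
    _ = gal σ (Gm a b a' b') * (Mv (σ • a) (σ • b) * (Mv a b)⁻¹) := by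
      rw [map_mul, gal_Mv, Matrix.mul_assoc]
    _ = gal σ (Gm a b a' b') * Gm a b (σ • a) (σ • b) := rfl

/-- **K2 (PROVED), the key rigidity:** `σ(g_σ) = λ·g_σ` — `σ(g_σ) g_σ⁻¹` fixes the three
`σ`-fixed vertex lines `(1:0), (0:1), (φ:1)` because `g_σ` maps vertices to vertices (H6) and
every vertex line is `σ`-fixed (G1). -/
theorem gal_Gm_eq_smul (c₄ c₆ : ℤ) (hc : (c₄ : ℚbar) ^ 3 ≠ (c₆ : ℚbar) ^ 2) (a b : ℚbar)
    (hv : kC4 a b = c₄ ∧ kC6 a b = c₆) (σ : Γ) (h5 : ∀ z : ℚbar, z ^ 5 = 1 → σ • z = z) :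
    ∃ l : ℚbar, l ≠ 0 ∧ gal σ (Gm a b (σ • a) (σ • b)) = l • Gm a b (σ • a) (σ • b) := by
  have hne : kC4 a b ^ 3 ≠ kC6 a b ^ 2 := by rw [hv.1, hv.2]; exact hc
  have hD : kD a b ≠ 0 := kD_ne_zero_of_ne a b hne
  have hDσ : kD (σ • a) (σ • b) ≠ 0 := by
    rw [← smul_kD, Field.absoluteGaloisGroup.smul_def]
    have := (Field.absoluteGaloisGroup.toAlgEquiv ℚ σ).injective.ne hD
    rwa [map_zero] at this
  have h4 : kC4 (σ • a) (σ • b) = kC4 a b := by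
    rw [← smul_kC4, hv.1, Field.absoluteGaloisGroup.smul_def, map_intCast]
  have h6 : kC6 (σ • a) (σ • b) = kC6 a b := by
    rw [← smul_kC6, hv.2, Field.absoluteGaloisGroup.smul_def, map_intCast]
  obtain ⟨hDg, -⟩ := klein_comp_Gm a b (σ • a) (σ • b) hD h4 h6
  obtain ⟨g, hg⟩ : ∃ g : Matrix (Fin 2) (Fin 2) ℚbar, g = Gm a b (σ • a) (σ • b) := ⟨_, rfl⟩
  rw [← hg] at hDg ⊢
  have hdet : g.det ≠ 0 := by rw [hg]; exact Gm_det_ne a b _ _ hD hDσ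
  -- the golden ratio
  obtain ⟨η, hη⟩ := exists_phi5_root
  have fixH : Field.absoluteGaloisGroup.toAlgEquiv ℚ σ η = η := phi5_root_fixed σ h5 hη
  obtain ⟨φ, hφ⟩ : ∃ φ : ℚbar, φ = -(η ^ 2 + η ^ 3) := ⟨_, rfl⟩
  have hσφ : σ • φ = φ := by
    rw [Field.absoluteGaloisGroup.smul_def, hφ]; simp only [map_neg, map_add, map_pow, fixH]
  have hφ0 : φ ≠ 0 := by
    intro h
    have hprod := g1_unit η hη
    rw [← hφ, h, zero_mul] at hprod; norm_num at hprod
  have hDφ : kD φ 1 = 0 := by rw [hφ]; exact g1_vertex η hη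
  -- KEY: on a σ-fixed vertex vector, `σ(g)` and `g` agree projectively
  have key : ∀ x y : ℚbar, (x, y) ≠ (0, 0) → σ • x = x → σ • y = y → kD x y = 0 →
      ∃ t : ℚbar, (ap (gal σ g) x y).1 = t * (ap g x y).1 ∧
        (ap (gal σ g) x y).2 = t * (ap g x y).2 := by
    intro x y h0 hx hy hDxy
    obtain ⟨p, hp⟩ : ∃ p : ℚbar, p = (ap g x y).1 := ⟨_, rfl⟩
    obtain ⟨q, hq⟩ : ∃ q : ℚbar, q = (ap g x y).2 := ⟨_, rfl⟩
    have hpq : ap g x y = (p, q) := by rw [hp, hq]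
    have hDpq : kD p q = 0 := by
      have := hDg x y; rw [hpq, hDxy, mul_zero] at this; exact this
    have hpq0 : (p, q) ≠ (0, 0) := by
      intro h
      exact eigen_ne_zero g hdet x y 0 h0 (by rw [hpq, h, zero_mul, zero_mul]) rfl
    have hgal1 : (ap (gal σ g) x y).1 = σ • p := by
      have := congrArg Prod.fst (ap_gal σ g x y); rw [hx, hy] at this; rw [this, hp]
    have hgal2 : (ap (gal σ g) x y).2 = σ • q := by
      have := congrArg Prod.snd (ap_gal σ g x y); rw [hx, hy] at this; rw [this, hq]
    rw [hgal1, hgal2, hpq]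
    dsimp only
    by_cases hq0 : q = 0
    · -- the vertex `(1 : 0)`
      have hp0 : p ≠ 0 := by rintro rfl; exact hpq0 (by rw [hq0])
      refine ⟨σ • p / p, ?_, ?_⟩
      · rw [div_mul_cancel₀ _ hp0]
      · rw [hq0, smul_zero, mul_zero]
    · -- normalise to `(p/q : 1)`, a `σ`-fixed vertex by G1
      have hD0 : kD (p / q) 1 = 0 := by
        have := kD_smul q (p / q) 1
        rw [mul_div_cancel₀ _ hq0, mul_one, hDpq] at this
        exact (mul_eq_zero.mp this.symm).resolve_left (pow_ne_zero _ hq0)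
      have hfix : σ • (p / q) = p / q := vertex_fixed σ h5 _ hD0
      refine ⟨σ • q / q, ?_, ?_⟩
      · have hp' : p = p / q * q := (div_mul_cancel₀ p hq0).symm
        calc σ • p = σ • (p / q * q) := by rw [← hp']
          _ = p / q * σ • q := by rw [smul_mul', hfix]
          _ = σ • q / q * p := by field_simp
      · rw [div_mul_cancel₀ _ hq0]
  have hσ1 : σ • (1 : ℚbar) = 1 := smul_one σ
  have hσ0 : σ • (0 : ℚbar) = 0 := smul_zero σ
  obtain ⟨t₁, e1, e2⟩ := key 1 0 (by simp) hσ1 hσ0 (by simp [kD])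
  obtain ⟨t₂, e3, e4⟩ := key 0 1 (by simp) hσ0 hσ1 (by simp [kD])
  obtain ⟨t₃, e5, e6⟩ := key φ 1 (by simp) hσφ hσ1 hDφ
  simp only [ap, mul_one, mul_zero, add_zero, zero_add] at e1 e2 e3 e4 e5 e6
  -- e1 : G00 = t₁ g00, e2 : G10 = t₁ g10, e3 : G01 = t₂ g01, e4 : G11 = t₂ g11,
  -- e5 : G00 φ + G01 = t₃ (g00 φ + g01), e6 : G10 φ + G11 = t₃ (g10 φ + g11)
  have hu : g 0 0 * ((t₁ - t₃) * φ) + g 0 1 * (t₂ - t₃) = 0 := by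
    linear_combination e5 - φ * e1 - e3
  have hw : g 1 0 * ((t₁ - t₃) * φ) + g 1 1 * (t₂ - t₃) = 0 := by
    linear_combination e6 - φ * e2 - e4
  have hdet' : g 0 0 * g 1 1 - g 0 1 * g 1 0 ≠ 0 := by rwa [Matrix.det_fin_two] at hdet
  have h23 : t₂ = t₃ := by
    have : (g 0 0 * g 1 1 - g 0 1 * g 1 0) * (t₂ - t₃) = 0 := by
      linear_combination (g 0 0) * hw - (g 1 0) * hu
    linear_combination (mul_eq_zero.mp this).resolve_left hdet'
  have h13 : t₁ = t₃ := by
    have : (g 0 0 * g 1 1 - g 0 1 * g 1 0) * ((t₁ - t₃) * φ) = 0 := by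
      linear_combination (g 1 1) * hu - (g 0 1) * hw
    have := (mul_eq_zero.mp ((mul_eq_zero.mp this).resolve_left hdet')).resolve_right hφ0
    linear_combination this
  refine ⟨t₃, ?_, ?_⟩
  · intro ht
    have hG : (gal σ g).det = 0 := by
      rw [Matrix.det_fin_two, e1, e2, e3, e4, h13, h23, ht]; ring
    rw [gal_det, Field.absoluteGaloisGroup.smul_def] at hG
    have := (Field.absoluteGaloisGroup.toAlgEquiv ℚ σ).injective.ne hdet
    rw [map_zero] at this
    exact this hG
  · ext i j
    fin_cases i <;> fin_cases j <;> simp [Matrix.smul_apply, e1, e2, e3, e4, h13, h23]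

/-- **H8 (PROVED from K1 + K2 by induction): powers along one Galois element.**  For `σ ⊇ μ₅`
and a torsor point `v` of a RATIONAL `(c₄, c₆)`: `g_{σ^k} = μ_k · g_σ^k` (`μ_k ≠ 0`), with
`μ_{k+1} = σ(μ_k)·λ^k`.  Used at `k = P` (with H7′: finite projective order), `k = m` (even case)
and `k = N` (odd case) of the assembly. -/
theorem Gm_galois_pow (c₄ c₆ : ℤ) (hc : (c₄ : ℚbar) ^ 3 ≠ (c₆ : ℚbar) ^ 2) (a b : ℚbar)
    (hv : kC4 a b = c₄ ∧ kC6 a b = c₆) (σ : Γ) (h5 : ∀ z : ℚbar, z ^ 5 = 1 → σ • z = z) (k : ℕ) :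
    ∃ μ : ℚbar, μ ≠ 0 ∧
      Gm a b ((σ ^ k) • a) ((σ ^ k) • b) = μ • (Gm a b (σ • a) (σ • b)) ^ k := by
  have hne : kC4 a b ^ 3 ≠ kC6 a b ^ 2 := by rw [hv.1, hv.2]; exact hc
  have hD : kD a b ≠ 0 := kD_ne_zero_of_ne a b hne
  obtain ⟨l, hl0, hl⟩ := gal_Gm_eq_smul c₄ c₆ hc a b hv σ h5
  induction k with
  | zero =>
    exact ⟨1, one_ne_zero, by rw [pow_zero, one_smul, one_smul, pow_zero, one_smul, Gm_self a b hD]⟩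
  | succ k ih =>
    obtain ⟨μ, hμ0, hμ⟩ := ih
    have hσμ : σ • μ ≠ 0 := by
      rw [Field.absoluteGaloisGroup.smul_def]
      have := (Field.absoluteGaloisGroup.toAlgEquiv ℚ σ).injective.ne hμ0
      rwa [map_zero] at this
    refine ⟨σ • μ * l ^ k, mul_ne_zero hσμ (pow_ne_zero _ hl0), ?_⟩
    rw [pow_succ' σ k, mul_smul, mul_smul, Gm_cocycle σ a b _ _ hD, hμ, gal_smul, map_pow, hl,
      smul_pow, smul_smul, smul_mul_assoc, ← pow_succ]

/-! ## §5 ASSEMBLY (g10) — KERNEL-CHECKED, all inputs proved above (T1, H1, G1, G2, H6, H7′, H8, INV, H-ROOT) -/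

theorem core1728At_of_icosahedral_descent (c₄ c₆ : ℤ) (hc : c₄ ^ 3 ≠ c₆ ^ 2) (h6 : c₆ ≠ 0) :
    Core1728At c₄ c₆ := by
  classical
  have hc' : (c₄ : ℚbar) ^ 3 ≠ ((c₆ : ℤ) : ℚbar) ^ 2 := by exact_mod_cast hc
  obtain ⟨a, b, ha, hb⟩ := exists_torsorPoint (c₄ : ℚbar) ((c₆ : ℤ) : ℚbar) hc'
  obtain ⟨σ, h20, hs3⟩ := exists_sigma_fix20_negSqrt3
  have h5 : ∀ z : ℚbar, z ^ 5 = 1 → σ • z = z := fun z hz =>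
    h20 z (by rw [show (20 : ℕ) = 5 * 4 from rfl, pow_mul, hz, one_pow])
  have h4 : ∀ z : ℚbar, z ^ 4 = 1 → σ • z = z := fun z hz =>
    h20 z (by rw [show (20 : ℕ) = 4 * 5 from rfl, pow_mul, hz, one_pow])
  have hne : kC4 a b ^ 3 ≠ kC6 a b ^ 2 := by rw [ha, hb]; exact hc'
  have hD : kD a b ≠ 0 := kD_ne_zero_of_ne a b hne
  have h6' : kC6 a b ≠ 0 := by rw [hb]; exact_mod_cast h6
  -- every `σ^k • v` is a torsor point of the same `(c₄, c₆)`
  have htor : ∀ k : ℕ, kC4 ((σ ^ k) • a) ((σ ^ k) • b) = kC4 a b ∧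
      kC6 ((σ ^ k) • a) ((σ ^ k) • b) = kC6 a b := by
    intro k
    refine ⟨?_, ?_⟩
    · rw [← smul_kC4, ha, Field.absoluteGaloisGroup.smul_def, map_intCast]
    · rw [← smul_kC6, hb, Field.absoluteGaloisGroup.smul_def, map_intCast]
  have hDk : ∀ k : ℕ, kD ((σ ^ k) • a) ((σ ^ k) • b) ≠ 0 := fun k =>
    kD_ne_zero_of_ne _ _ (by rw [(htor k).1, (htor k).2]; exact hne)
  -- the transition matrix `g = g_σ` and its finite projective order `N`
  have htor1 := htor 1
  simp only [pow_one] at htor1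
  have hD1 : kD (σ • a) (σ • b) ≠ 0 := by simpa using hDk 1
  obtain ⟨hgD, -⟩ := klein_comp_Gm a b (σ • a) (σ • b) hD htor1.1 htor1.2
  have hgdet := Gm_det_ne a b (σ • a) (σ • b) hD hD1
  obtain ⟨g, hg_def⟩ : ∃ g, g = Gm a b (σ • a) (σ • b) := ⟨_, rfl⟩
  rw [← hg_def] at hgD hgdet
  -- H7′ + H8: `g_σ` has finite projective order (`σ^P` fixes `a` and `b`, so `g^P ∝ g_{σ^P} = 1`)
  obtain ⟨Pa, hPa0, hPa⟩ := exists_pos_pow_smul_eq σ a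
  obtain ⟨Pb, hPb0, hPb⟩ := exists_pos_pow_smul_eq σ b
  have hPa' : (σ ^ (Pa * Pb)) • a = a := by rw [pow_mul]; exact smul_fix_pow _ hPa Pb
  have hPb' : (σ ^ (Pa * Pb)) • b = b := by
    rw [mul_comm, pow_mul]; exact smul_fix_pow _ hPb Pa
  have hP : ∃ n : ℕ, 0 < n ∧ ∃ μ : ℚbar, g ^ n = μ • (1 : Matrix (Fin 2) (Fin 2) ℚbar) := by
    obtain ⟨μP, hμP0, hGP⟩ := Gm_galois_pow c₄ c₆ hc' a b ⟨ha, hb⟩ σ h5 (Pa * Pb)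
    rw [← hg_def, hPa', hPb', Gm_self a b hD] at hGP
    refine ⟨Pa * Pb, Nat.mul_pos hPa0 hPb0, μP⁻¹, ?_⟩
    rw [hGP, smul_smul, inv_mul_cancel₀ hμP0, one_smul]
  obtain ⟨N, hN_def⟩ : ∃ N, N = Nat.find hP := ⟨_, rfl⟩
  have hspec : 0 < N ∧ ∃ μ : ℚbar, g ^ N = μ • (1 : Matrix (Fin 2) (Fin 2) ℚbar) := by
    rw [hN_def]; exact Nat.find_spec hP
  obtain ⟨hNpos, μN, hμN⟩ := hspec
  have hmin : ∀ m, m < N → ¬ (0 < m ∧ ∃ μ : ℚbar, g ^ m = μ • (1 : Matrix (Fin 2) (Fin 2) ℚbar)) :=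
    fun m hm => Nat.find_min hP (by rw [← hN_def]; exact hm)
  rcases Nat.even_or_odd N with ⟨m, hm⟩ | hodd
  · /- EVEN projective order `N = m + m`: `[g_{σ^m}]` is a non-scalar involution; an eigenvector of
       `g_σ` is an edge midpoint (INV), `σ`-fixed (G2), and `σ` fixes its good root. -/
    have hm0 : 0 < m := by omega
    have hmN : m < N := by omega
    have hns_gm : ∀ l : ℚbar, g ^ m ≠ l • 1 := fun l h => hmin m hmN ⟨hm0, l, h⟩
    obtain ⟨μm, hμm0, hGm⟩ := Gm_galois_pow c₄ c₆ hc' a b ⟨ha, hb⟩ σ h5 m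
    rw [← hg_def] at hGm
    -- the involution property and non-scalarity of `g_{σ^m}`
    have hsq : Gm a b ((σ ^ m) • a) ((σ ^ m) • b) * Gm a b ((σ ^ m) • a) ((σ ^ m) • b) =
        (μm ^ 2 * μN) • (1 : Matrix (Fin 2) (Fin 2) ℚbar) := by
      rw [hGm, Matrix.smul_mul, Matrix.mul_smul, ← pow_add, ← hm, hμN, smul_smul, smul_smul]
      congr 1
      ring
    have hns : ∀ l : ℚbar, Gm a b ((σ ^ m) • a) ((σ ^ m) • b) ≠ l • 1 := by
      intro l h
      apply hns_gm (μm⁻¹ * l)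
      rw [hGm] at h
      calc g ^ m = μm⁻¹ • (μm • g ^ m) := by rw [smul_smul, inv_mul_cancel₀ hμm0, one_smul]
        _ = (μm⁻¹ * l) • 1 := by rw [h, smul_smul]
    -- an eigenvector of `g_σ`; it is one of `g_{σ^m} = μm • g^m`
    obtain ⟨x₀, y₀, ν, h0, heig⟩ := exists_eigen g
    have heig_m : ap (Gm a b ((σ ^ m) • a) ((σ ^ m) • b)) x₀ y₀ = (μm * ν ^ m * x₀, μm * ν ^ m * y₀) := by
      rw [hGm, ap_smul, ap_pow_of_eigen g x₀ y₀ ν heig m]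
      simp only [mul_assoc]
    obtain ⟨he6, he4⟩ := edge_of_eigenvector a b ((σ ^ m) • a) ((σ ^ m) • b) hne (htor m).1 (htor m).2
      _ hsq hns x₀ y₀ (μm * ν ^ m) h0 heig_m
    -- normalise the eigenvector to `(x : 1)`
    have hy₀ : y₀ ≠ 0 := by
      rintro rfl
      have : kC6 x₀ (0 : ℚbar) = -x₀ ^ 30 := by simp [kC6]
      rw [this, neg_eq_zero] at he6
      have hx : x₀ = 0 := pow_eq_zero_iff (by norm_num) |>.mp he6
      exact h0 (by rw [hx])
    obtain ⟨x, hx_def⟩ : ∃ x : ℚbar, x = x₀ / y₀ := ⟨_, rfl⟩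
    have hxy : y₀ * x = x₀ := by rw [hx_def]; field_simp
    have he6x : kC6 x 1 = 0 := by
      have := kC6_smul y₀ x 1
      rw [hxy, mul_one, he6] at this
      rcases mul_eq_zero.mp this.symm with h | h
      · exact absurd (pow_eq_zero_iff (by norm_num) |>.mp h) hy₀
      · exact h
    have he4x : kC4 x 1 ≠ 0 := by
      intro h
      have := kC4_smul y₀ x 1
      rw [hxy, mul_one, h, mul_zero] at this
      exact he4 this
    have heigx : ap g x 1 = (ν * x, ν) := by
      have h1 := congrArg Prod.fst heig
      have h2 := congrArg Prod.snd heig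
      simp only [ap] at h1 h2 ⊢
      rw [← hxy] at h1 h2
      rw [Prod.mk.injEq]
      constructor
      · have : y₀ * (g 0 0 * x + g 0 1 * 1) = y₀ * (ν * x) := by linear_combination h1
        exact mul_left_cancel₀ hy₀ this
      · have : y₀ * (g 1 0 * x + g 1 1 * 1) = y₀ * ν := by linear_combination h2
        exact mul_left_cancel₀ hy₀ this
    -- `σ` fixes `x` (G2) and hence the good root `t_x(v)`
    have hσx : σ • x = x := edge_fixed σ h20 x he6x
    have hnd : (1 : ℚbar) * a - x * b ≠ 0 := edge_nondeg a b x 1 he6x he4x h6'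
    have hnd' : (1 : ℚbar) * (σ • a) - x * (σ • b) ≠ 0 :=
      edge_nondeg (σ • a) (σ • b) x 1 he6x he4x (by rw [htor1.2]; exact h6')
    have hfix : σ • tE a b x 1 = tE a b x 1 := by
      rw [smul_tE, hσx, smul_one]
      rw [hg_def] at heigx
      exact tE_eq_of_eigen a b (σ • a) (σ • b) hD x ν heigx hnd hnd'
    obtain ⟨hC6, hC4⟩ := goodRoot_tE a b x 1 he6x he4x hD hnd
    rw [ha, hb] at hC6 hC4
    exact ⟨σ, tE a b x 1, hs3, h4, hC6, hC4, hfix⟩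
  · /- ODD projective order: `τ := σ^N` still inverts `√−3`, and `M_{τ v} ∝ M_v`, so `τ` fixes the
       good root `t_i(v)` attached to the edge midpoint `i`. -/
    obtain ⟨τ, hτ⟩ : ∃ τ : Γ, τ = σ ^ N := ⟨_, rfl⟩
    obtain ⟨μ', hμ'0, hGN⟩ := Gm_galois_pow c₄ c₆ hc' a b ⟨ha, hb⟩ σ h5 N
    rw [← hg_def, ← hτ] at hGN
    have hscal : Gm a b (τ • a) (τ • b) = (μ' * μN) • (1 : Matrix (Fin 2) (Fin 2) ℚbar) := by
      rw [hGN, hμN, smul_smul]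
    have hDτ : kD (τ • a) (τ • b) ≠ 0 := by rw [hτ]; exact hDk N
    have hl0 : μ' * μN ≠ 0 := by
      intro h
      exact Gm_det_ne a b (τ • a) (τ • b) hD hDτ
        (by rw [hscal, h, zero_smul]; exact Matrix.det_zero)
    have hMv : Mv (τ • a) (τ • b) = (μ' * μN) • Mv a b := Mv_eq_smul_of_Gm a b _ _ _ hD hscal
    obtain ⟨i, hi⟩ := IsAlgClosed.exists_pow_nat_eq (-1 : ℚbar) (n := 2) (by norm_num)
    have hi20 : i ^ 20 = 1 := by rw [show (20 : ℕ) = 2 * 10 from rfl, pow_mul, hi]; norm_num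
    have hτi : τ • i = i := by rw [hτ]; exact smul_fix_pow σ (h20 i hi20) N
    have hτ4 : ∀ z : ℚbar, z ^ 4 = 1 → τ • z = z := fun z hz => by
      rw [hτ]; exact smul_fix_pow σ (h4 z hz) N
    have hτ3 : ∀ s : ℚbar, s ^ 2 = -3 → τ • s = -s := fun s hs => by
      rw [hτ]; exact smul_neg_pow_odd σ (hs3 s hs) hodd
    have hfix : τ • tE a b i 1 = tE a b i 1 := by
      rw [smul_tE, hτi, smul_one]
      exact tE_eq_of_Mv_smul a b (τ • a) (τ • b) _ hl0 hMv i 1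
    have he6 : kC6 i (1 : ℚbar) = 0 := kC6_I i hi
    have he4 : kC4 i (1 : ℚbar) ≠ 0 := kC4_I_ne i hi
    have hnd : (1 : ℚbar) * a - i * b ≠ 0 := edge_nondeg a b i 1 he6 he4 h6'
    obtain ⟨hC6, hC4⟩ := goodRoot_tE a b i 1 he6 he4 hD hnd
    rw [ha, hb] at hC6 hC4
    exact ⟨τ, tE a b i 1, hτ3, hτ4, hC6, hC4, hfix⟩

/-- **g4's `Core1728` (hence, with the shared F1 `thm132_geomTorsionFive_of_hesseFamily` and g4's F2
`FrobeniusCertificate`, the stub via g4's kernel-checked `stub_switch_of_core_and_tail`).** -/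
theorem core1728_of_icosahedral_descent : Core1728 := by
  rw [core1728_iff]
  intro c₄ c₆ hc h6
  exact core1728At_of_icosahedral_descent c₄ c₆ hc h6

end Galois

end Summit.ABC.ABC.Cruxes.FreyModularity.StubSwitchK3g10


/-!
# stub-ideation k3, GENERATION 11 — `stub_switch` (= `BCDT.CDT_three_five_switch`, `Iff.rfl`):
# the `j = 1728` road with EVERY tail helper DISCHARGED

Road (kernel-checked since generation 4, `…StubSwitchK3g4.stub_switch_of_core_and_tail`):
`F1 (Fisher 13.2 (i), named fact) → Core1728 → F2 (FrobeniusCertificate) → CDT_three_five_switch`,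
the assembly consuming the helper statements G6a/G6b (integral `c₄c₆`-model), G3 (a Chebotarev
prime `ℓ ≡ 5 (12)` carrying an `𝔽_ℓ`-root of `𝔠₆(·,1)` off `𝔠₄ = 0`) and G2 (integral short
model of the Hesse member and its reduction).  Generation 10 PROVED `Core1728`
(`STUB_IDEAS_stub_switch_3g10_Sketch.lean`, `core1728_of_icosahedral_descent`, 0 sorries, 312 s).

THIS generation proves ALL the remaining helper statements, so that on the k3 road only the named
literature fact F1 `thm132_geomTorsionFive_of_hesseFamily` [Fisher, *The Hessian of a genus one
curve*, Thm 13.2 (i)] and the THEOREM `Core1728` (g10 file; kept here as the hypothesis `hCore`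
because crux workfiles are not importable on the farm — a prover concatenates the two files) stand
between the tree and `stub_switch`:

* **F2 `frobeniusCertificate : FrobeniusCertificate`** (§F2) — frame transport of `tr`/`det` of
  `Frob_q` on `E[3]` (`LinearEquiv.conj`, `LinearMap.det_conj`), `det = q̄ = −1 ∧ tr ≠ 0 ⇒ g⁸ = 1 ≠ g⁴`
  in `GL₂(𝔽₃)` (`decide`), tree PROVED `isAbsIrreducibleOverSqrt_negThree_of_orderOf_eq_eight`,
  `trace/det_galoisRepTorsion_frobenius_eq`, `det_eq_modPCyclotomicCharacter_of_isTorsionGaloisRep_holds`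
  (the ONLY place `det ρ̄ = χ̄` enters — honouring `Disproof.stub_switch_false_without_det`).
* **G6a/G6b** `exists_integral_scaling`, `base_scaled` (§G6) — `u := den c₄ · den c₆`,
  `fisherChange_smul`, `scale_smul_short`.
* **G2 `member_integral_short_mod`** (§G2) — INTEGER NUMERATORS `N4, N6 ∈ ℤ[c₄,c₆,l,m]` of Fisher's
  `𝔠₄ = N4/17424`, `𝔠₆ = N6/(17424·240)` (`17424 = 2⁴3²11²`, `240 = 2⁴·3·5`); the model
  `E_{A,B}`, `A = −27·17424³240⁴·N4`, `B = −54·17424⁵240⁵·N6`, scaling `v = 17424·240`.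
* **G3 `exists_prime_five_mod_twelve_root`** (§G3, verbatim g4 signature) — Chebotarev in the
  coset `σ·Gal(ℚ̄/E)`, `E` the normal closure of `ℚ(t₁, ζ₁₂)` (tree PROVED
  `exists_isArithFrobAt_mul_inv_mem_not_mem` [Neukirch ANT VII.13.4]); `φζ₁₂ = ζ₁₂⁵ ≡ ζ₁₂^ℓ (mod 𝔓)`
  forces `ℓ ≡ 5 (12)` (`mod_twelve_eq_five`: the other residues put `2` or `3` into `𝔓`);
  `β := n t₁ ∈ ℤ̄` is `φ`-fixed hence `≡ b ∈ ℤ (mod 𝔓)` (B5, k1-g11's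
  `helper_exists_int_congr_of_frob_fixed`, copied verbatim with credit); HOMOGENEITY
  `N4(nl, n) = n²⁰N4(l,1)`, `N6(nl,n) = n³⁰N6(l,1)` transports `N6 = 0` down to `𝔽_ℓ` at
  `t ≡ b n⁻¹`, and `N4(t,1) = 0` in `𝔽_ℓ` is excluded for `ℓ ∤ d`, where `d ∈ ℤ∖0` makes
  `d·N4(β,n)⁻¹` an algebraic integer (`IsAlgebraic.exists_integral_multiple`) — so `N4(β,n) ∈ 𝔓`
  would put `d ∈ 𝔓 ∩ ℤ = ℓℤ`.  No resultants, no minimal polynomials, no degree-`30` arithmetic.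

`lean check` (farm): rc 0, **0 `sorry`s**; the two `def … : Prop` atoms `Core1728` (THEOREM in g10) and
`FrobeniusCertificate` (THEOREM here) are g4's, character for character; §4–§5 (`N3`, `tail`,
`stub_switch_of_core_and_tail`) are g4 verbatim; the new bottom line is
`stub_switch_of_fisher_and_core : F1 → Core1728 → CDT_three_five_switch`.
-/

open scoped MatrixGroups NumberField
open Matrix Field IsDedekindDomain NumberField
open Literature.NumberTheory.EllipticCurves Literature.NumberTheory.EllipticCurves.HesseFamilyFive
open Literature.NumberTheory.EllipticCurves.BSZLemma17
open Literature.NumberTheory.Automorphic Literature.NumberTheory.GaloisRepresentations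
open Literature.NumberTheory.Automorphic.BCDT WeierstrassCurve
open Rat.HeightOneSpectrum

attribute [local instance] AddSubgroup.torsionBy.zmodModule

namespace Summit.ABC.ABC.Cruxes.FreyModularity.StubSwitchK3g11

noncomputable section

/-! # §F2 The order-8 Frobenius certificate (PROVED) -/


/-- F2 = k1's gen-2 atom `FrobeniusCertificate` (verbatim g4). -/
def FrobeniusCertificate : Prop :=
  ∀ (W : WeierstrassCurve ℚ) [W.IsElliptic] [W.IsGloballyMinimal] (q : ℕ) [Fact q.Prime],
    q % 3 = 2 → W.HasGoodReductionAtPrime q → ¬ (3 : ℤ) ∣ W.frobeniusTrace q →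
    ∀ ρ₃ : ModPGaloisRep ℚ (ZMod 3) 2, W.IsTorsionGaloisRep 3 ρ₃ → ρ₃.IsAbsIrreducibleOverSqrt (-3)

/-! ## F2-frame: trace and determinant of `σ` on `E[ℓ]` are those of the matrix `ρ̄(σ)` -/

/-- **Frame transport.**  For a framed model `ρ̄` of `E[ℓ]` (`e (σ • P) = ρ̄(σ) · e P`) the
`𝔽_ℓ`-linear map `P ↦ σ • P` of `E[ℓ]` is conjugate by the frame to `v ↦ ρ̄(σ) v`, so its trace and
determinant are `tr ρ̄(σ)` and `det ρ̄(σ)` (`LinearMap.trace_conj'`, `LinearMap.det_conj`). -/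
theorem trace_det_galoisRepTorsion_eq_of_isTorsionGaloisRep {F : Type*} [Field F]
    (W : WeierstrassCurve F) (ℓ : ℕ) [Fact ℓ.Prime] {ρ : ModPGaloisRep F (ZMod ℓ) 2}
    (hρ : W.IsTorsionGaloisRep ℓ ρ) (σ : absoluteGaloisGroup F) :
    LinearMap.trace (ZMod ℓ) (geomTorsion W ℓ)
        ((galoisRepTorsion W ℓ σ).toAdd.toAddMonoidHom.toZModLinearMap ℓ) =
      Matrix.trace ((ρ σ : GL (Fin 2) (ZMod ℓ)) : Matrix (Fin 2) (Fin 2) (ZMod ℓ)) ∧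
    LinearMap.det ((galoisRepTorsion W ℓ σ).toAdd.toAddMonoidHom.toZModLinearMap ℓ) =
      Matrix.det ((ρ σ : GL (Fin 2) (ZMod ℓ)) : Matrix (Fin 2) (Fin 2) (ZMod ℓ)) := by
  classical
  obtain ⟨e, he⟩ := hρ
  set M : Matrix (Fin 2) (Fin 2) (ZMod ℓ) :=
    ((ρ σ : GL (Fin 2) (ZMod ℓ)) : Matrix (Fin 2) (Fin 2) (ZMod ℓ)) with hM
  set f := (galoisRepTorsion W ℓ σ).toAdd.toAddMonoidHom.toZModLinearMap ℓ with hfdef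
  have hf : ∀ Q : geomTorsion W ℓ, f Q = σ • Q := fun Q ↦ rfl
  -- the frame as an `𝔽_ℓ`-linear equivalence
  let eₗ : geomTorsion W ℓ ≃ₗ[ZMod ℓ] (Fin 2 → ZMod ℓ) :=
    { e.toAddMonoidHom.toZModLinearMap ℓ with
      invFun := e.symm
      left_inv := e.left_inv
      right_inv := e.right_inv }
  have heₗ : ∀ P, eₗ P = e P := fun P ↦ rfl
  have heₗ' : ∀ v, eₗ.symm v = e.symm v := fun v ↦ rfl
  have hconj : eₗ.conj f = Matrix.toLin' M := by
    refine LinearMap.ext fun v ↦ ?_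
    rw [LinearEquiv.conj_apply_apply, Matrix.toLin'_apply, heₗ, heₗ', hf, he, hM,
      AddEquiv.apply_symm_apply]
  refine ⟨?_, ?_⟩
  · rw [← LinearMap.trace_conj' f eₗ, hconj, Matrix.trace_toLin'_eq]
  · rw [← LinearMap.det_conj f eₗ, ← LinearMap.det_toLin' M, ← hconj, LinearEquiv.conj_apply,
      LinearMap.comp_assoc]

/-! ## F2b: `det = -1`, `tr ≠ 0` in `GL₂(𝔽₃)` ⇒ order `8` -/

/-- In `M₂(𝔽₃)`: `det g = -1` and `tr g ≠ 0` force `g⁸ = 1 ≠ g⁴` (the characteristic polynomial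
`X² ∓ X − 1` is irreducible over `𝔽₃`, its roots in `𝔽₉` have order `8`).  Finite check. -/
theorem pow_eight_of_det_eq_neg_one_of_trace_ne_zero (g : Matrix (Fin 2) (Fin 2) (ZMod 3))
    (hg : g.det = -1) (htr : g.trace ≠ 0) : g ^ 8 = 1 ∧ g ^ 4 ≠ 1 := by
  obtain ⟨p, q, r, s, rfl⟩ : ∃ p q r s : ZMod 3, g = !![p, q; r, s] :=
    ⟨_, _, _, _, Matrix.eta_fin_two g⟩
  rw [Matrix.det_fin_two_of] at hg
  rw [Matrix.trace_fin_two_of] at htr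
  revert p q r s
  decide +kernel

/-- **F2b.** An element of `GL₂(𝔽₃)` with `det = -1` and `tr ≠ 0` has order `8`. -/
theorem orderOf_eq_eight_of_det_eq_neg_one (g : GL (Fin 2) (ZMod 3))
    (hdet : Matrix.det (g : Matrix (Fin 2) (Fin 2) (ZMod 3)) = -1)
    (htr : Matrix.trace (g : Matrix (Fin 2) (Fin 2) (ZMod 3)) ≠ 0) : orderOf g = 8 := by
  obtain ⟨h8, h4⟩ := pow_eight_of_det_eq_neg_one_of_trace_ne_zero _ hdet htr
  have h8' : g ^ 2 ^ (2 + 1) = 1 := by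
    rw [← Units.val_eq_one, Units.val_pow_eq_pow_val]
    exact h8
  have h4' : ¬ g ^ 2 ^ 2 = 1 := by
    intro h1
    apply h4
    have h2 := congrArg (fun u : GL (Fin 2) (ZMod 3) ↦ (u : Matrix (Fin 2) (Fin 2) (ZMod 3))) h1
    simp only [Units.val_pow_eq_pow_val, Units.val_one] at h2
    exact h2
  have := orderOf_eq_prime_pow h4' h8'
  simpa using this

/-! ## F2a: a good ordinary-mod-3 prime `q ≡ 2 (3)` gives a Frobenius of order `8` on `E[3]` -/

/-- **F2a.** `E/ℚ` globally minimal, `q ≡ 2 (mod 3)` a good prime with `3 ∤ a_q`, `ρ̄` a framed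
model of `E[3]`: an arithmetic Frobenius `σ_q` has `det ρ̄(σ_q) = q̄ = -1`
(`det_galoisRepTorsion_frobenius_eq`) and `tr ρ̄(σ_q) = ā_q ≠ 0`
(`trace_galoisRepTorsion_frobenius_eq`), hence order `8`. -/
theorem exists_orderOf_eq_eight_of_not_dvd_frobeniusTrace (W : WeierstrassCurve ℚ) [W.IsElliptic]
    [W.IsGloballyMinimal] (q : ℕ) [Fact q.Prime] (hq : q % 3 = 2)
    (hgood : W.HasGoodReductionAtPrime q) (ha : ¬ (3 : ℤ) ∣ W.frobeniusTrace q)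
    {ρ : ModPGaloisRep ℚ (ZMod 3) 2} (hρ : W.IsTorsionGaloisRep 3 ρ) :
    ∃ σ : absoluteGaloisGroup ℚ, orderOf (ρ σ) = 8 := by
  classical
  have h2 : ((2 : ℕ) : ZMod 3) = -1 := by decide
  haveI : Fact (Nat.Prime 3) := ⟨Nat.prime_three⟩
  have hq3 : q ≠ 3 := by rintro rfl; simp at hq
  obtain ⟨v, 𝔓, σ, hv, -, h𝔓, hσ⟩ := exists_isArithFrobAt_placeOver q
  have htr := W.trace_galoisRepTorsion_frobenius_eq 3 hq3 hgood hv h𝔓 hσ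
  have hdet := W.det_galoisRepTorsion_frobenius_eq 3 hq3 hgood hv h𝔓 hσ
  obtain ⟨htr', hdet'⟩ := trace_det_galoisRepTorsion_eq_of_isTorsionGaloisRep W 3 hρ σ
  refine ⟨σ, orderOf_eq_eight_of_det_eq_neg_one (ρ σ) ?_ ?_⟩
  · rw [← hdet', hdet, ← ZMod.natCast_mod q 3, hq, h2]
  · rw [← htr', htr]
    intro h0
    apply ha
    exact (ZMod.intCast_zmod_eq_zero_iff_dvd _ 3).mp h0

/-- **F2 PROVED**: `FrobeniusCertificate` from F2a, `det ρ̄ = χ̄₃`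
(`det_eq_modPCyclotomicCharacter_of_isTorsionGaloisRep_holds`) and the tree's group criterion
`Theorems.isAbsIrreducibleOverSqrt_negThree_of_orderOf_eq_eight`. -/
theorem frobeniusCertificate : FrobeniusCertificate := by
  intro W _ _ q _ hq hgood ha ρ₃ hρ
  have hdet := W.det_eq_modPCyclotomicCharacter_of_isTorsionGaloisRep_holds 3 ρ₃ hρ
  obtain ⟨σ, h8⟩ := exists_orderOf_eq_eight_of_not_dvd_frobeniusTrace W q hq hgood ha hρ
  exact Summit.ABC.ABC.Theorems.isAbsIrreducibleOverSqrt_negThree_of_orderOf_eq_eight ρ₃ hdet h8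


/-! # §G Vocabulary, numerators, G6, G2, G3 (PROVED) -/


/-! ## §0 Vocabulary (verbatim g4 §1) -/

/-- Fisher's Hesse member `E_{l,m} : y² = x³ − 27𝔠₄(l,m)x − 54𝔠₆(l,m)` over `(c₄, c₆)`. -/
abbrev member (c₄ c₆ l m : ℚ) : WeierstrassCurve ℚ :=
  ⟨0, 0, 0, -27 * C4 c₄ c₆ l m, -54 * C6 c₄ c₆ l m⟩

/-- The `c₄c₆`-model (= the member at `(l:m) = (1:0)`). -/
abbrev base (c₄ c₆ : ℚ) : WeierstrassCurve ℚ := ⟨0, 0, 0, -27 * c₄, -54 * c₆⟩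

/-! ## §N Integer numerators of Fisher's `𝔠₄, 𝔠₆` and their homogeneity -/

section Numerators

variable {R S : Type*} [CommRing R] [CommRing S]

/-- `N4 := −(𝔇_λλ𝔇_μμ − 𝔇_λμ²)`, so that `𝔠₄ = N4 / 17424` (degree `20` in `(l,m)`). -/
def N4 (c₄ c₆ l m : R) : R :=
  -(Dll c₄ c₆ l m * Dmm c₄ c₆ l m - Dlm c₄ c₆ l m ^ 2)

/-- `Pl := 𝔇_λλλ𝔇_μμ + 𝔇_λλ𝔇_λμμ − 2𝔇_λμ𝔇_λλμ` (`𝔠₄,λ = −Pl/17424`; degree `19`). -/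
def Pl (c₄ c₆ l m : R) : R :=
  Dlll c₄ c₆ l m * Dmm c₄ c₆ l m + Dll c₄ c₆ l m * Dlmm c₄ c₆ l m
    - 2 * Dlm c₄ c₆ l m * Dllm c₄ c₆ l m

/-- `Pm := 𝔇_λλμ𝔇_μμ + 𝔇_λλ𝔇_μμμ − 2𝔇_λμ𝔇_λμμ` (`𝔠₄,μ = −Pm/17424`; degree `19`). -/
def Pm (c₄ c₆ l m : R) : R :=
  Dllm c₄ c₆ l m * Dmm c₄ c₆ l m + Dll c₄ c₆ l m * Dmmm c₄ c₆ l m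
    - 2 * Dlm c₄ c₆ l m * Dlmm c₄ c₆ l m

/-- `N6 := 𝔇_μ·Pl − 𝔇_λ·Pm`, so that `𝔠₆ = N6 / (17424·240)` (degree `30` in `(l,m)`). -/
def N6 (c₄ c₆ l m : R) : R :=
  Dm c₄ c₆ l m * Pl c₄ c₆ l m - Dl c₄ c₆ l m * Pm c₄ c₆ l m

theorem map_N4 {F : Type*} [FunLike F R S] [RingHomClass F R S] (f : F) (c₄ c₆ l m : R) :
    f (N4 c₄ c₆ l m) = N4 (f c₄) (f c₆) (f l) (f m) := by
  simp only [N4, Dll, Dmm, Dlm, map_add, map_sub, map_mul, map_pow, map_neg, map_ofNat]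

theorem map_N6 {F : Type*} [FunLike F R S] [RingHomClass F R S] (f : F) (c₄ c₆ l m : R) :
    f (N6 c₄ c₆ l m) = N6 (f c₄) (f c₆) (f l) (f m) := by
  simp only [N6, Pl, Pm, Dl, Dm, Dll, Dmm, Dlm, Dlll, Dllm, Dlmm, Dmmm, map_add, map_sub, map_mul,
    map_pow, map_neg, map_ofNat]

theorem intCast_N4 (c₄ c₆ l m : ℤ) :
    ((N4 c₄ c₆ l m : ℤ) : R) = N4 (c₄ : R) (c₆ : R) (l : R) (m : R) := by
  have h := map_N4 (Int.castRingHom R) c₄ c₆ l m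
  simpa only [eq_intCast] using h

theorem intCast_N6 (c₄ c₆ l m : ℤ) :
    ((N6 c₄ c₆ l m : ℤ) : R) = N6 (c₄ : R) (c₆ : R) (l : R) (m : R) := by
  have h := map_N6 (Int.castRingHom R) c₄ c₆ l m
  simpa only [eq_intCast] using h

/-! ### homogeneity, derivative by derivative -/

theorem Dl_smul (c₄ c₆ n l m : R) : Dl c₄ c₆ (n * l) (n * m) = n ^ 11 * Dl c₄ c₆ l m := by
  simp only [Dl]; ring
theorem Dm_smul (c₄ c₆ n l m : R) : Dm c₄ c₆ (n * l) (n * m) = n ^ 11 * Dm c₄ c₆ l m := by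
  simp only [Dm]; ring
theorem Dll_smul (c₄ c₆ n l m : R) : Dll c₄ c₆ (n * l) (n * m) = n ^ 10 * Dll c₄ c₆ l m := by
  simp only [Dll]; ring
theorem Dlm_smul (c₄ c₆ n l m : R) : Dlm c₄ c₆ (n * l) (n * m) = n ^ 10 * Dlm c₄ c₆ l m := by
  simp only [Dlm]; ring
theorem Dmm_smul (c₄ c₆ n l m : R) : Dmm c₄ c₆ (n * l) (n * m) = n ^ 10 * Dmm c₄ c₆ l m := by
  simp only [Dmm]; ring
theorem Dlll_smul (c₄ c₆ n l m : R) : Dlll c₄ c₆ (n * l) (n * m) = n ^ 9 * Dlll c₄ c₆ l m := by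
  simp only [Dlll]; ring
theorem Dllm_smul (c₄ c₆ n l m : R) : Dllm c₄ c₆ (n * l) (n * m) = n ^ 9 * Dllm c₄ c₆ l m := by
  simp only [Dllm]; ring
theorem Dlmm_smul (c₄ c₆ n l m : R) : Dlmm c₄ c₆ (n * l) (n * m) = n ^ 9 * Dlmm c₄ c₆ l m := by
  simp only [Dlmm]; ring
theorem Dmmm_smul (c₄ c₆ n l m : R) : Dmmm c₄ c₆ (n * l) (n * m) = n ^ 9 * Dmmm c₄ c₆ l m := by
  simp only [Dmmm]; ring

/-- `N4` is homogeneous of degree `20` in `(l, m)`. -/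
theorem N4_smul (c₄ c₆ n l m : R) : N4 c₄ c₆ (n * l) (n * m) = n ^ 20 * N4 c₄ c₆ l m := by
  simp only [N4, Dll_smul, Dlm_smul, Dmm_smul]; ring

/-- `N6` is homogeneous of degree `30` in `(l, m)`. -/
theorem N6_smul (c₄ c₆ n l m : R) : N6 c₄ c₆ (n * l) (n * m) = n ^ 30 * N6 c₄ c₆ l m := by
  simp only [N6, Pl, Pm, Dl_smul, Dm_smul, Dll_smul, Dlm_smul, Dmm_smul, Dlll_smul, Dllm_smul,
    Dlmm_smul, Dmmm_smul]
  ring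

theorem N4_smul_one (c₄ c₆ n l : R) : N4 c₄ c₆ (n * l) n = n ^ 20 * N4 c₄ c₆ l 1 := by
  simpa only [mul_one] using N4_smul c₄ c₆ n l 1

theorem N6_smul_one (c₄ c₆ n l : R) : N6 c₄ c₆ (n * l) n = n ^ 30 * N6 c₄ c₆ l 1 := by
  simpa only [mul_one] using N6_smul c₄ c₆ n l 1

/-- Congruent arguments give congruent values of `N4`. -/
theorem mk_N4_congr (I : Ideal R) {c₄ c₆ x y n : R} (h : x - y ∈ I) :
    Ideal.Quotient.mk I (N4 c₄ c₆ x n) = Ideal.Quotient.mk I (N4 c₄ c₆ y n) := by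
  rw [map_N4, map_N4, (Ideal.Quotient.eq (I := I)).mpr h]

/-- Congruent arguments give congruent values of `N6`. -/
theorem mk_N6_congr (I : Ideal R) {c₄ c₆ x y n : R} (h : x - y ∈ I) :
    Ideal.Quotient.mk I (N6 c₄ c₆ x n) = Ideal.Quotient.mk I (N6 c₄ c₆ y n) := by
  rw [map_N6, map_N6, (Ideal.Quotient.eq (I := I)).mpr h]

end Numerators

section Field

variable {F : Type*} [Field F]

theorem C4_eq_N4_div (c₄ c₆ l m : F) : C4 c₄ c₆ l m = N4 c₄ c₆ l m / 17424 := rfl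

theorem C6_eq_N6_div [CharZero F] (c₄ c₆ l m : F) :
    C6 c₄ c₆ l m = N6 c₄ c₆ l m / (17424 * 240) := by
  simp only [C6, C4l, C4m, N6, Pl, Pm]
  field_simp
  ring

/-- the same identity over any field in which `17424·240` is invertible (e.g. `𝔽_ℓ`, `ℓ ∤ 66·60`). -/
theorem C6_eq_N6_div' (c₄ c₆ l m : F) (h1 : (17424 : F) ≠ 0) (h2 : (240 : F) ≠ 0) :
    C6 c₄ c₆ l m = N6 c₄ c₆ l m / (17424 * 240) := by
  simp only [C6, C4l, C4m, N6, Pl, Pm]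
  field_simp
  ring

/-- a prime `p ≠ ℓ` is nonzero in `𝔽_ℓ`. -/
theorem natCast_ne_zero_of_prime_ne {ℓ : ℕ} [Fact ℓ.Prime] {p : ℕ} (hp : p.Prime) (hne : ℓ ≠ p) :
    (p : ZMod ℓ) ≠ 0 := by
  rw [Ne, ZMod.natCast_eq_zero_iff]
  intro h
  exact hne ((Nat.prime_dvd_prime_iff_eq (Fact.out : ℓ.Prime) hp).mp h)

end Field

/-! ## §G6 The integral `c₄c₆`-model (XS; = k1-g11 `integralModel`, AEC III.1) — PROVED -/

/-- G6a (verbatim g4 signature). -/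
theorem exists_integral_scaling (x y : ℚ) :
    ∃ (u : ℤ) (c₄ c₆ : ℤ), u ≠ 0 ∧ (c₄ : ℚ) = (u : ℚ) ^ 4 * x ∧ (c₆ : ℚ) = (u : ℚ) ^ 6 * y := by
  refine ⟨((x.den * y.den : ℕ) : ℤ), x.num * x.den ^ 3 * y.den ^ 4, y.num * y.den ^ 5 * x.den ^ 6,
    ?_, ?_, ?_⟩
  · exact_mod_cast (Nat.mul_pos x.den_pos y.den_pos).ne'
  · have h : (((x.den * y.den : ℕ) : ℤ) : ℚ) ^ 4 * x =
        (x.den : ℚ) ^ 3 * (y.den : ℚ) ^ 4 * (x * x.den) := by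
      push_cast; ring
    rw [h, Rat.mul_den_eq_num]; push_cast; ring
  · have h : (((x.den * y.den : ℕ) : ℤ) : ℚ) ^ 6 * y =
        (y.den : ℚ) ^ 5 * (x.den : ℚ) ^ 6 * (y * y.den) := by
      push_cast; ring
    rw [h, Rat.mul_den_eq_num]; push_cast; ring

/-- G6b (verbatim g4 signature): `fisherChange_smul` + `scale_smul_short`. -/
theorem base_scaled (W : WeierstrassCurve ℚ) [W.IsElliptic] {u c₄ c₆ : ℤ} (hu : u ≠ 0)
    (h4 : (c₄ : ℚ) = (u : ℚ) ^ 4 * W.c₄) (h6 : (c₆ : ℚ) = (u : ℚ) ^ 6 * W.c₆) :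
    ∃ Cv : VariableChange ℚ, Cv • W = base c₄ c₆ := by
  have hu0 : (u : ℚ) ≠ 0 := by exact_mod_cast hu
  refine ⟨⟨Units.mk0 (u : ℚ)⁻¹ (inv_ne_zero hu0), 0, 0, 0⟩ * fisherChange W, ?_⟩
  rw [mul_smul, fisherChange_smul, scale_smul_short (u : ℚ) hu0]
  ext <;> simp [h4, h6] <;> ring

/-! ## §G2 The member's integral short model, reduction read off `𝔠₄, 𝔠₆ (mod ℓ)` (S) — PROVED -/

/-- **G2 (verbatim g4 signature).** `v := 17424·240`: `⟨v⁻¹,0,0,0⟩ • E_{t,1} = E_{A,B}` with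
`A = −27·17424³·240⁴·N4(t,1)`, `B = −54·17424⁵·240⁵·N6(t,1)`; for `ℓ ∉ {2,3,5,11}` the constants
are `ℓ`-units. -/
theorem member_integral_short_mod (ℓ : ℕ) [Fact ℓ.Prime] (hℓ : ℓ ∉ ({2, 3, 5, 11} : Finset ℕ))
    (c₄ c₆ t : ℤ) :
    ∃ (A B : ℤ) (Cv : VariableChange ℚ),
      Cv • member c₄ c₆ t 1 = shortWeierstrass (A, B) ∧
      ((A : ZMod ℓ) = 0 ↔ C4 (c₄ : ZMod ℓ) (c₆ : ZMod ℓ) (t : ZMod ℓ) 1 = 0) ∧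
      ((B : ZMod ℓ) = 0 ↔ C6 (c₄ : ZMod ℓ) (c₆ : ZMod ℓ) (t : ZMod ℓ) 1 = 0) := by
  have hℓ2 : ℓ ≠ 2 := fun h => hℓ (by simp [h])
  have hℓ3 : ℓ ≠ 3 := fun h => hℓ (by simp [h])
  have hℓ5 : ℓ ≠ 5 := fun h => hℓ (by simp [h])
  have hℓ11 : ℓ ≠ 11 := fun h => hℓ (by simp [h])
  have h2 : (2 : ZMod ℓ) ≠ 0 := by exact_mod_cast natCast_ne_zero_of_prime_ne Nat.prime_two hℓ2
  have h3 : (3 : ZMod ℓ) ≠ 0 := by exact_mod_cast natCast_ne_zero_of_prime_ne Nat.prime_three hℓ3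
  have h5 : (5 : ZMod ℓ) ≠ 0 := by exact_mod_cast natCast_ne_zero_of_prime_ne Nat.prime_five hℓ5
  have h11 : (11 : ZMod ℓ) ≠ 0 := by
    exact_mod_cast natCast_ne_zero_of_prime_ne (by norm_num) hℓ11
  have h17424 : (17424 : ZMod ℓ) ≠ 0 := by
    rw [show (17424 : ZMod ℓ) = 2 ^ 4 * 3 ^ 2 * 11 ^ 2 by norm_num]
    exact mul_ne_zero (mul_ne_zero (pow_ne_zero _ h2) (pow_ne_zero _ h3)) (pow_ne_zero _ h11)
  have h240 : (240 : ZMod ℓ) ≠ 0 := by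
    rw [show (240 : ZMod ℓ) = 2 ^ 4 * 3 * 5 by norm_num]
    exact mul_ne_zero (mul_ne_zero (pow_ne_zero _ h2) h3) h5
  have h27 : (27 : ZMod ℓ) ≠ 0 := by
    rw [show (27 : ZMod ℓ) = 3 ^ 3 by norm_num]; exact pow_ne_zero _ h3
  have h54 : (54 : ZMod ℓ) ≠ 0 := by
    rw [show (54 : ZMod ℓ) = 2 * 3 ^ 3 by norm_num]; exact mul_ne_zero h2 (pow_ne_zero _ h3)
  have hv : (17424 * 240 : ℚ) ≠ 0 := by norm_num
  refine ⟨-27 * (17424 ^ 3 * 240 ^ 4) * N4 c₄ c₆ t 1, -54 * (17424 ^ 5 * 240 ^ 5) * N6 c₄ c₆ t 1,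
    ⟨Units.mk0 (17424 * 240 : ℚ)⁻¹ (inv_ne_zero hv), 0, 0, 0⟩, ?_, ?_, ?_⟩
  · rw [show member (c₄ : ℚ) c₆ t 1 =
        ⟨0, 0, 0, -27 * C4 (c₄ : ℚ) c₆ t 1, -54 * C6 (c₄ : ℚ) c₆ t 1⟩ from rfl,
      scale_smul_short _ hv]
    ext <;> simp only [shortWeierstrass] <;> push_cast <;>
      simp only [C4_eq_N4_div, C6_eq_N6_div, intCast_N4, intCast_N6, Int.cast_one] <;>
      field_simp <;> ring
  · have hK : (-27 * (17424 ^ 3 * 240 ^ 4) : ZMod ℓ) ≠ 0 :=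
      mul_ne_zero (neg_ne_zero.mpr h27) (mul_ne_zero (pow_ne_zero _ h17424) (pow_ne_zero _ h240))
    have hcast : (((-27 * (17424 ^ 3 * 240 ^ 4) * N4 c₄ c₆ t 1 : ℤ)) : ZMod ℓ) =
        (-27 * (17424 ^ 3 * 240 ^ 4) : ZMod ℓ) * N4 (c₄ : ZMod ℓ) (c₆ : ZMod ℓ) (t : ZMod ℓ) 1 := by
      push_cast; rw [intCast_N4, Int.cast_one]; norm_num
    rw [hcast, C4_eq_N4_div, mul_eq_zero, div_eq_zero_iff]
    constructor
    · rintro (h | h)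
      · exact absurd h hK
      · exact Or.inl h
    · rintro (h | h)
      · exact Or.inr h
      · exact absurd h h17424
  · have hK : (-54 * (17424 ^ 5 * 240 ^ 5) : ZMod ℓ) ≠ 0 :=
      mul_ne_zero (neg_ne_zero.mpr h54) (mul_ne_zero (pow_ne_zero _ h17424) (pow_ne_zero _ h240))
    have hcast : (((-54 * (17424 ^ 5 * 240 ^ 5) * N6 c₄ c₆ t 1 : ℤ)) : ZMod ℓ) =
        (-54 * (17424 ^ 5 * 240 ^ 5) : ZMod ℓ) * N6 (c₄ : ZMod ℓ) (c₆ : ZMod ℓ) (t : ZMod ℓ) 1 := by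
      push_cast; rw [intCast_N6, Int.cast_one]; norm_num
    have h1 : (17424 * 240 : ZMod ℓ) ≠ 0 := mul_ne_zero h17424 h240
    rw [hcast, C6_eq_N6_div' _ _ _ _ h17424 h240, mul_eq_zero, div_eq_zero_iff]
    constructor
    · rintro (h | h)
      · exact absurd h hK
      · exact Or.inl h
    · rintro (h | h)
      · exact Or.inr h
      · exact absurd h h1


/-! ## §G3 Chebotarev at the twisted `1728`-fibre (M) — atoms -/

section G3

/-- **G3a (Chebotarev in a coset, for `ℚ(x, y)`).**  Outside any finite set of places there is a
place `v` with a prime `𝔓 ∣ v` of `\bar ℤ` and an arithmetic Frobenius `φ` at `𝔓` such that `φg⁻¹`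
fixes `ℚ(x, y)` pointwise.  (`N := Gal(\bar ℚ/E)`, `E` the normal closure of `ℚ(x,y)`: open
(`fixingSubgroup_isOpen`), normal (`InfiniteGalois.normal_iff_isGalois`); tree PROVED
`exists_isArithFrobAt_mul_inv_mem_not_mem`.) [Neukirch ANT VII.13.4] -/
theorem exists_frob_fixing_adjoin (x y : AlgebraicClosure ℚ) (g : absoluteGaloisGroup ℚ)
    (S : Set (HeightOneSpectrum (𝓞 ℚ))) (hS : S.Finite) :
    ∃ v ∉ S, ∃ 𝔓 ∈ v.primesAbove, ∃ φ : absoluteGaloisGroup ℚ, IsArithFrobAt (𝓞 ℚ) φ 𝔓 ∧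
      ∀ z ∈ IntermediateField.adjoin ℚ ({x, y} : Set (AlgebraicClosure ℚ)), (φ * g⁻¹) • z = z := by
  classical
  set K : IntermediateField ℚ (AlgebraicClosure ℚ) :=
    IntermediateField.adjoin ℚ ({x, y} : Set (AlgebraicClosure ℚ)) with hK
  haveI : Algebra.IsAlgebraic ℚ (AlgebraicClosure ℚ) := AlgebraicClosure.isAlgebraic ℚ
  haveI : IsAlgClosure ℚ (AlgebraicClosure ℚ) := ⟨inferInstance, inferInstance⟩
  haveI : Normal ℚ (AlgebraicClosure ℚ) := inferInstance
  haveI : IsGalois ℚ (AlgebraicClosure ℚ) := IsGalois.mk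
  haveI : FiniteDimensional ℚ K :=
    IntermediateField.finiteDimensional_adjoin
      (fun z _ => (Algebra.IsAlgebraic.isAlgebraic (R := ℚ) z).isIntegral)
  set E : IntermediateField ℚ (AlgebraicClosure ℚ) :=
    IntermediateField.normalClosure ℚ K (AlgebraicClosure ℚ) with hE
  haveI : FiniteDimensional ℚ E := normalClosure.is_finiteDimensional ℚ K (AlgebraicClosure ℚ)
  haveI hEG : IsGalois ℚ E := IsGalois.normalClosure ℚ K (AlgebraicClosure ℚ)
  set N : Subgroup (absoluteGaloisGroup ℚ) := E.fixingSubgroup with hN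
  haveI : N.Normal := (InfiniteGalois.normal_iff_isGalois E).mpr hEG
  have hNopen : IsOpen (N : Set (absoluteGaloisGroup ℚ)) := IntermediateField.fixingSubgroup_isOpen E
  obtain ⟨v, hvS, -, 𝔓, h𝔓, φ, hφ, hmem⟩ :=
    exists_isArithFrobAt_mul_inv_mem_not_mem ℚ N hNopen g S hS
  refine ⟨v, hvS, 𝔓, h𝔓, φ, hφ, fun z hz => ?_⟩
  have hKE : K ≤ E := IntermediateField.le_normalClosure K
  exact (mem_fixingSubgroup_iff_forall_smul E (φ * g⁻¹)).mp hmem ⟨z, hKE hz⟩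

/-- `𝔓 ∩ ℤ = p_v ℤ` for `𝔓 ∣ v`. -/
theorem intCast_mem_iff_dvd {v : HeightOneSpectrum (𝓞 ℚ)} {𝔓 : Ideal (absIntegers (𝓞 ℚ) ℚ)}
    (h𝔓 : 𝔓 ∈ v.primesAbove) (n : ℤ) :
    (n : absIntegers (𝓞 ℚ) ℚ) ∈ 𝔓 ↔ (natGenerator v : ℤ) ∣ n := by
  haveI : 𝔓.LiesOver v.asIdeal := (HeightOneSpectrum.mem_primesAbove_iff.mp h𝔓).2
  rw [← Rat.intCast_mem_asIdeal_iff, Ideal.mem_of_liesOver 𝔓 v.asIdeal, map_intCast]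

/-- a rational prime that dies in `\bar ℤ/𝔓` is the prime under `𝔓`. -/
theorem natGenerator_eq_of_natCast_quot_eq_zero {v : HeightOneSpectrum (𝓞 ℚ)}
    {𝔓 : Ideal (absIntegers (𝓞 ℚ) ℚ)} (h𝔓 : 𝔓 ∈ v.primesAbove) {p : ℕ} (hp : p.Prime)
    (h : (p : absIntegers (𝓞 ℚ) ℚ ⧸ 𝔓) = 0) : natGenerator v = p := by
  rw [← map_natCast (Ideal.Quotient.mk 𝔓), Ideal.Quotient.eq_zero_iff_mem] at h
  have h' : ((p : ℤ) : absIntegers (𝓞 ℚ) ℚ) ∈ 𝔓 := by rwa [Int.cast_natCast]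
  rw [intCast_mem_iff_dvd h𝔓, Int.natCast_dvd_natCast] at h'
  exact (Nat.prime_dvd_prime_iff_eq (prime_natGenerator v) hp).mp h'

/-- **B5 (PROVED by k1-g11, copied verbatim): a Frobenius-fixed algebraic integer is congruent to a
rational integer mod `𝔓`.** -/
theorem helper_exists_int_congr_of_frob_fixed {v : HeightOneSpectrum (𝓞 ℚ)}
    {𝔓 : Ideal (absIntegers (𝓞 ℚ) ℚ)} (h𝔓 : 𝔓 ∈ v.primesAbove)
    {φ : absoluteGaloisGroup ℚ} (hφ : IsArithFrobAt (𝓞 ℚ) φ 𝔓)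
    (A : absIntegers (𝓞 ℚ) ℚ) (hA : φ • A = A) : ∃ a : ℤ, A - a ∈ 𝔓 := by
  haveI h𝔓max : 𝔓.IsMaximal := HeightOneSpectrum.isMaximal_of_mem_primesAbove h𝔓
  haveI : 𝔓.LiesOver v.asIdeal := (HeightOneSpectrum.mem_primesAbove_iff.mp h𝔓).2
  have hover : v.asIdeal = 𝔓.under (𝓞 ℚ) := Ideal.LiesOver.over
  -- the Frobenius congruence for the fixed element `A`
  have h1 : φ • A - A ^ Nat.card (𝓞 ℚ ⧸ 𝔓.under (𝓞 ℚ)) ∈ 𝔓 := hφ A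
  rw [hA, ← hover] at h1
  -- residue fields
  letI : Field (absIntegers (𝓞 ℚ) ℚ ⧸ 𝔓) := Ideal.Quotient.field 𝔓
  haveI : v.asIdeal.IsMaximal := v.isMaximal
  letI : Field (𝓞 ℚ ⧸ v.asIdeal) := Ideal.Quotient.field v.asIdeal
  haveI : Finite (𝓞 ℚ ⧸ v.asIdeal) := by rw [hover]; exact hφ.finite_quotient
  let ι : 𝓞 ℚ ⧸ v.asIdeal →+* absIntegers (𝓞 ℚ) ℚ ⧸ 𝔓 :=
    Ideal.quotientMap 𝔓 (algebraMap (𝓞 ℚ) (absIntegers (𝓞 ℚ) ℚ)) hover.le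
  have h2 : (Ideal.Quotient.mk 𝔓 A) ^ Nat.card (𝓞 ℚ ⧸ v.asIdeal) = Ideal.Quotient.mk 𝔓 A := by
    rw [← map_pow, eq_comm, Ideal.Quotient.eq]; exact h1
  obtain ⟨w, hw⟩ := Literature.AlgebraicGeometry.Motives.mem_range_of_pow_card_eq ι h2
  obtain ⟨r, rfl⟩ := Ideal.Quotient.mk_surjective w
  have hw' : Ideal.Quotient.mk 𝔓 (algebraMap (𝓞 ℚ) (absIntegers (𝓞 ℚ) ℚ) r) =
      Ideal.Quotient.mk 𝔓 A := by
    rw [← hw]; exact (Ideal.quotientMap_mk).symm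
  -- `r ∈ 𝓞 ℚ` is a rational integer
  obtain ⟨a, ha⟩ : ∃ a : ℤ, (a : 𝓞 ℚ) = r :=
    ⟨Rat.ringOfIntegersEquiv r, Rat.ringOfIntegersEquiv.injective (by rw [map_intCast, Int.cast_id])⟩
  subst ha
  rw [map_intCast] at hw'
  exact ⟨a, Ideal.Quotient.eq.mp hw'.symm⟩

/-- `ζ₁₂⁶ = −1` and `ζ₁₂⁸ + ζ₁₂⁴ + 1 = 0` for a primitive `12`-th root of unity in a field. -/
theorem zeta12_relations {L : Type*} [Field L] {ζ : L} (hζ : IsPrimitiveRoot ζ 12) :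
    ζ ^ 12 = 1 ∧ ζ ^ 6 = -1 ∧ ζ ^ 8 + ζ ^ 4 + 1 = 0 := by
  have h12 : ζ ^ 12 = 1 := hζ.pow_eq_one
  refine ⟨h12, ?_, ?_⟩
  · have h1 : (ζ ^ 6 - 1) * (ζ ^ 6 + 1) = 0 := by linear_combination h12
    have h2 : ζ ^ 6 ≠ 1 := fun h => by
      have := (hζ.pow_eq_one_iff_dvd 6).mp h
      omega
    rcases mul_eq_zero.mp h1 with h | h
    · exact absurd (sub_eq_zero.mp h) h2
    · linear_combination h
  · have hω1 : ζ ^ 4 ≠ 1 := fun h => by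
      have := (hζ.pow_eq_one_iff_dvd 4).mp h
      omega
    have h0 : (ζ ^ 4 - 1) * (ζ ^ 8 + ζ ^ 4 + 1) = 0 := by linear_combination h12
    exact (mul_eq_zero.mp h0).resolve_left (sub_ne_zero.mpr hω1)

/-- **G3b: a Frobenius acting on `μ₁₂` by `5` lies over `ℓ ≡ 5 (mod 12)`** (`ℓ ≠ 2, 3`):
`ζ⁵ = φζ ≡ ζ^ℓ (mod 𝔓)`, and the `12`-th roots of unity stay distinct mod `𝔓 ∤ 6`
(`ζ⁶ ≡ −1`, `ζ⁸ + ζ⁴ + 1 ≡ 0` force `2 ∈ 𝔓` or `3 ∈ 𝔓` otherwise). -/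
theorem mod_twelve_eq_five {ℓ : ℕ} [Fact ℓ.Prime] (hℓ2 : ℓ ≠ 2) (hℓ3 : ℓ ≠ 3)
    {v : HeightOneSpectrum (𝓞 ℚ)} (hv : (primesEquiv v : ℕ) = ℓ)
    {𝔓 : Ideal (absIntegers (𝓞 ℚ) ℚ)} (h𝔓 : 𝔓 ∈ v.primesAbove)
    {φ : absoluteGaloisGroup ℚ} (hφ : IsArithFrobAt (𝓞 ℚ) φ 𝔓)
    {ζ : AlgebraicClosure ℚ} (hζ : IsPrimitiveRoot ζ 12) (hφζ : φ • ζ = ζ ^ 5) : ℓ % 12 = 5 := by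
  classical
  have hℓ : ℓ.Prime := Fact.out
  have hgen : natGenerator v = ℓ := hv
  obtain ⟨hζ12, hζ6, hζ8⟩ := zeta12_relations hζ
  -- `ζ ∈ \bar ℤ`
  have hζint : ζ ∈ absIntegers (𝓞 ℚ) ℚ := by
    rw [mem_integralClosure_iff]
    exact (hζ.isIntegral (by norm_num)).tower_top
  set Z : absIntegers (𝓞 ℚ) ℚ := ⟨ζ, hζint⟩ with hZ
  have hφZ : φ • Z = Z ^ 5 := Subtype.ext (by
    rw [integralClosure.coe_smul, SubmonoidClass.coe_pow]; exact hφζ)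
  have hZ12 : Z ^ 12 = 1 := Subtype.ext (by
    rw [SubmonoidClass.coe_pow, OneMemClass.coe_one]; exact hζ12)
  have hZ6 : Z ^ 6 = -1 := Subtype.ext (by
    rw [SubmonoidClass.coe_pow, NegMemClass.coe_neg, OneMemClass.coe_one]; exact hζ6)
  have hZ8 : Z ^ 8 + Z ^ 4 + 1 = 0 := Subtype.ext (by
    rw [AddMemClass.coe_add, AddMemClass.coe_add, SubmonoidClass.coe_pow, SubmonoidClass.coe_pow,
      OneMemClass.coe_one, ZeroMemClass.coe_zero]; exact hζ8)
  -- Frobenius: `φ Z ≡ Z^ℓ (mod 𝔓)`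
  have hfrob : Z ^ 5 - Z ^ ℓ ∈ 𝔓 := by
    have h := smul_sub_pow_mem_of_isArithFrobAt hv h𝔓 hφ Z
    rwa [hφZ] at h
  -- in the residue field
  haveI : 𝔓.IsMaximal := HeightOneSpectrum.isMaximal_of_mem_primesAbove h𝔓
  letI : Field (absIntegers (𝓞 ℚ) ℚ ⧸ 𝔓) := Ideal.Quotient.field 𝔓
  set π := Ideal.Quotient.mk 𝔓 with hπ
  set z := π Z with hz
  have hz5 : z ^ 5 = z ^ ℓ := by
    rw [← sub_eq_zero, hz, ← map_pow, ← map_pow, ← map_sub, Ideal.Quotient.eq_zero_iff_mem]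
    exact hfrob
  have hz12 : z ^ 12 = 1 := by rw [hz, ← map_pow, hZ12, map_one]
  have hz6 : z ^ 6 = -1 := by rw [hz, ← map_pow, hZ6, map_neg, map_one]
  have hz8 : z ^ 8 + z ^ 4 + 1 = 0 := by
    have h := congrArg π hZ8
    rwa [map_add, map_add, map_pow, map_pow, map_one, map_zero] at h
  have hz0 : z ≠ 0 := fun h0 => by
    rw [h0, zero_pow (by norm_num)] at hz12; exact zero_ne_one hz12
  have hpow : z ^ ℓ = z ^ (ℓ % 12) := by
    conv_lhs => rw [← Nat.mod_add_div ℓ 12]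
    rw [pow_add, pow_mul, hz12, one_pow, mul_one]
  rw [hpow] at hz5
  -- `ℓ % 12 ∈ {1, 5, 7, 11}`
  have hr : ℓ % 12 = 1 ∨ ℓ % 12 = 5 ∨ ℓ % 12 = 7 ∨ ℓ % 12 = 11 := by
    have h2 : ¬ 2 ∣ ℓ := fun h => hℓ2 ((Nat.prime_dvd_prime_iff_eq Nat.prime_two hℓ).mp h).symm
    have h3 : ¬ 3 ∣ ℓ := fun h => hℓ3 ((Nat.prime_dvd_prime_iff_eq Nat.prime_three hℓ).mp h).symm
    omega
  -- the three impossible residues put `3` or `2` into `𝔓`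
  have two_ne : (2 : absIntegers (𝓞 ℚ) ℚ ⧸ 𝔓) ≠ 0 := fun h =>
    hℓ2 (hgen.symm.trans (natGenerator_eq_of_natCast_quot_eq_zero h𝔓 Nat.prime_two
      (by exact_mod_cast h)))
  have three_ne : (3 : absIntegers (𝓞 ℚ) ℚ ⧸ 𝔓) ≠ 0 := fun h =>
    hℓ3 (hgen.symm.trans (natGenerator_eq_of_natCast_quot_eq_zero h𝔓 Nat.prime_three
      (by exact_mod_cast h)))
  rcases hr with h | h | h | h
  · exfalso
    rw [h, pow_one] at hz5
    have h4 : z ^ 4 = 1 := by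
      have : z * z ^ 4 = z * 1 := by rw [mul_one, ← pow_succ']; exact hz5
      exact mul_left_cancel₀ hz0 this
    have h8 : z ^ 8 = 1 := by rw [show z ^ 8 = (z ^ 4) ^ 2 by ring, h4, one_pow]
    rw [h8, h4] at hz8
    exact three_ne (by linear_combination hz8)
  · exact h
  · exfalso
    rw [h] at hz5
    have h2 : z ^ 2 = 1 := by
      have : z ^ 5 * z ^ 2 = z ^ 5 * 1 := by rw [mul_one, ← pow_add]; exact hz5.symm
      exact mul_left_cancel₀ (pow_ne_zero _ hz0) this
    have h6 : z ^ 6 = 1 := by rw [show z ^ 6 = (z ^ 2) ^ 3 by ring, h2, one_pow]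
    exact two_ne (by linear_combination hz6 - h6)
  · exfalso
    rw [h] at hz5
    have h6 : z ^ 6 = 1 := by
      have : z ^ 5 * z ^ 6 = z ^ 5 * 1 := by rw [mul_one, ← pow_add]; exact hz5.symm
      exact mul_left_cancel₀ (pow_ne_zero _ hz0) this
    exact two_ne (by linear_combination hz6 - h6)

/-- **G3 (verbatim g4 signature) — the Chebotarev prime.**  `β := n·t₁ ∈ \bar ℤ` (`n ∈ ℤ∖0`,
`exists_integral_multiple`); `x := N4(β, n) = n²⁰N4(t₁,1) ≠ 0`, `d := d·x⁻¹ ∈ \bar ℤ`-multiple;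
Chebotarev (G3a) in the coset `σ·Gal(\bar ℚ/E)` outside `S ∪ {2,3,5,11} ∪ primes(n) ∪ primes(d)`
gives `ℓ`, `𝔓`, `φ` with `φt₁ = t₁`, `φζ = ζ⁵`; G3b gives `ℓ ≡ 5 (12)`; B5 gives `b ∈ ℤ` with
`β ≡ b (mod 𝔓)`; `N6(β,n) = n³⁰N6(t₁,1) = 0` and `N6(b,n) ≡ N6(β,n)` put `ℓ ∣ N6(b,n)`, while
`ℓ ∣ N4(b,n)` would put `x`, hence `d = x·(d x⁻¹)`, into `𝔓`; finally `t :≡ b·n⁻¹ (mod ℓ)` and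
homogeneity descend to `𝔠₆(t,1) = 0 ≠ 𝔠₄(t,1)` in `𝔽_ℓ`. -/
theorem exists_prime_five_mod_twelve_root (c₄ c₆ : ℤ) (hc : c₄ ^ 3 ≠ c₆ ^ 2)
    (t₁ ζ : AlgebraicClosure ℚ) (h6 : C6 (c₄ : AlgebraicClosure ℚ) c₆ t₁ 1 = 0)
    (h4 : C4 (c₄ : AlgebraicClosure ℚ) c₆ t₁ 1 ≠ 0) (hζ : IsPrimitiveRoot ζ 12)
    (σ : Field.absoluteGaloisGroup ℚ) (hσt : σ • t₁ = t₁) (hσζ : σ • ζ = ζ ^ 5) (S : Finset ℕ) :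
    ∃ (ℓ : ℕ) (_ : Fact ℓ.Prime), ℓ ∉ S ∧ ℓ % 12 = 5 ∧
      ∃ t : ℤ, C6 (c₄ : ZMod ℓ) (c₆ : ZMod ℓ) (t : ZMod ℓ) 1 = 0 ∧
        C4 (c₄ : ZMod ℓ) (c₆ : ZMod ℓ) (t : ZMod ℓ) 1 ≠ 0 := by
  classical
  haveI : Algebra.IsAlgebraic ℚ (AlgebraicClosure ℚ) := AlgebraicClosure.isAlgebraic ℚ
  -- Step 1: an integral multiple `β = n t₁`
  have ht₁alg : IsAlgebraic ℤ t₁ :=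
    (IsFractionRing.isAlgebraic_iff ℤ ℚ (AlgebraicClosure ℚ)).mpr (Algebra.IsAlgebraic.isAlgebraic t₁)
  obtain ⟨n, hn0, hnint⟩ := ht₁alg.exists_integral_multiple
  set β : AlgebraicClosure ℚ := (n : AlgebraicClosure ℚ) * t₁ with hβ
  have hβint : β ∈ absIntegers (𝓞 ℚ) ℚ := by
    rw [mem_integralClosure_iff]
    have h : IsIntegral ℤ β := by rw [hβ, ← zsmul_eq_mul]; exact hnint
    exact h.tower_top
  have hnL : (n : AlgebraicClosure ℚ) ≠ 0 := by exact_mod_cast hn0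
  -- Step 2: `N6(β, n) = 0`, `x := N4(β, n) ≠ 0`
  have hN6t : N6 (c₄ : AlgebraicClosure ℚ) c₆ t₁ 1 = 0 := by
    rw [C6_eq_N6_div, div_eq_zero_iff] at h6
    exact h6.resolve_right (by norm_num)
  have hN4t : N4 (c₄ : AlgebraicClosure ℚ) c₆ t₁ 1 ≠ 0 := by
    intro h0; apply h4; rw [C4_eq_N4_div, h0, zero_div]
  have hN6β : N6 (c₄ : AlgebraicClosure ℚ) c₆ β n = 0 := by
    rw [hβ, N6_smul_one, hN6t, mul_zero]
  set x : AlgebraicClosure ℚ := N4 (c₄ : AlgebraicClosure ℚ) c₆ β n with hx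
  have hx0 : x ≠ 0 := by
    rw [hx, hβ, N4_smul_one]; exact mul_ne_zero (pow_ne_zero _ hnL) hN4t
  -- Step 3: `d ∈ ℤ∖0` with `d x⁻¹ ∈ \bar ℤ`
  have hxalg : IsAlgebraic ℤ x⁻¹ :=
    (IsFractionRing.isAlgebraic_iff ℤ ℚ (AlgebraicClosure ℚ)).mpr (Algebra.IsAlgebraic.isAlgebraic _)
  obtain ⟨d, hd0, hdint⟩ := hxalg.exists_integral_multiple
  have hyint : (d : AlgebraicClosure ℚ) * x⁻¹ ∈ absIntegers (𝓞 ℚ) ℚ := by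
    rw [mem_integralClosure_iff]
    have h : IsIntegral ℤ ((d : AlgebraicClosure ℚ) * x⁻¹) := by rw [← zsmul_eq_mul]; exact hdint
    exact h.tower_top
  -- Step 4: the excluded primes, and Chebotarev
  set S₀ : Finset ℕ := ((S ∪ {2, 3, 5, 11}) ∪ n.natAbs.primeFactors) ∪ d.natAbs.primeFactors with hS₀
  have hSfin : {v : HeightOneSpectrum (𝓞 ℚ) | natGenerator v ∈ S₀}.Finite := by
    refine Set.Finite.preimage (f := fun v : HeightOneSpectrum (𝓞 ℚ) => natGenerator v)
      (Set.injOn_of_injective ?_) S₀.finite_toSet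
    intro v w h
    exact primesEquiv.injective (Subtype.ext h)
  obtain ⟨v, hvS, 𝔓, h𝔓, φ, hφ, hfix⟩ := exists_frob_fixing_adjoin t₁ ζ σ _ hSfin
  set ℓ : ℕ := natGenerator v with hℓdef
  haveI hℓ : Fact ℓ.Prime := ⟨prime_natGenerator v⟩
  have hv : (primesEquiv v : ℕ) = ℓ := rfl
  have hℓS₀ : ℓ ∉ S₀ := hvS
  have hmemS₀ : ∀ p, (p ∈ S ∨ p ∈ ({2, 3, 5, 11} : Finset ℕ)) ∨ p ∈ n.natAbs.primeFactors ∨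
      p ∈ d.natAbs.primeFactors → p ∈ S₀ := by
    rintro p (hp | hp | hp)
    · exact Finset.mem_union_left _ (Finset.mem_union_left _ (Finset.mem_union.mpr hp))
    · exact Finset.mem_union_left _ (Finset.mem_union_right _ hp)
    · exact Finset.mem_union_right _ hp
  have hℓS : ℓ ∉ S := fun h => hℓS₀ (hmemS₀ ℓ (Or.inl (Or.inl h)))
  have hℓ2 : ℓ ≠ 2 := fun h => hℓS₀ (hmemS₀ ℓ (Or.inl (Or.inr (by simp [h]))))
  have hℓ3 : ℓ ≠ 3 := fun h => hℓS₀ (hmemS₀ ℓ (Or.inl (Or.inr (by simp [h]))))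
  have hℓ5 : ℓ ≠ 5 := fun h => hℓS₀ (hmemS₀ ℓ (Or.inl (Or.inr (by simp [h]))))
  have hℓ11 : ℓ ≠ 11 := fun h => hℓS₀ (hmemS₀ ℓ (Or.inl (Or.inr (by simp [h]))))
  have hℓn : ¬ (ℓ : ℤ) ∣ n := fun h => hℓS₀ (hmemS₀ ℓ (Or.inr (Or.inl
    (Nat.mem_primeFactors.mpr ⟨hℓ.out, Int.natCast_dvd.mp h, Int.natAbs_ne_zero.mpr hn0⟩))))
  have hℓd : ¬ (ℓ : ℤ) ∣ d := fun h => hℓS₀ (hmemS₀ ℓ (Or.inr (Or.inr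
    (Nat.mem_primeFactors.mpr ⟨hℓ.out, Int.natCast_dvd.mp h, Int.natAbs_ne_zero.mpr hd0⟩))))
  -- Step 5: `φ t₁ = t₁`, `φ ζ = ζ⁵`, hence `ℓ ≡ 5 (12)`
  have hsub : ({t₁, ζ} : Set (AlgebraicClosure ℚ)) ⊆
      IntermediateField.adjoin ℚ ({t₁, ζ} : Set (AlgebraicClosure ℚ)) :=
    IntermediateField.subset_adjoin ℚ _
  have hφt : φ • t₁ = t₁ := by
    have h := hfix t₁ (hsub (Set.mem_insert t₁ {ζ}))
    calc φ • t₁ = (φ * σ⁻¹) • (σ • t₁) := by rw [mul_smul, inv_smul_smul]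
      _ = t₁ := by rw [hσt, h]
  have hφζ : φ • ζ = ζ ^ 5 := by
    have h := hfix (ζ ^ 5) (pow_mem (hsub (Set.mem_insert_of_mem t₁ rfl)) 5)
    calc φ • ζ = (φ * σ⁻¹) • (σ • ζ) := by rw [mul_smul, inv_smul_smul]
      _ = ζ ^ 5 := by rw [hσζ, h]
  have h12 : ℓ % 12 = 5 := mod_twelve_eq_five hℓ2 hℓ3 hv h𝔓 hφ hζ hφζ
  -- Step 6: `β ≡ b ∈ ℤ (mod 𝔓)`
  set B : absIntegers (𝓞 ℚ) ℚ := ⟨β, hβint⟩ with hB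
  have hφB : φ • B = B := Subtype.ext (by
    rw [integralClosure.coe_smul]
    show φ • β = β
    rw [hβ, smul_mul', hφt, absoluteGaloisGroup.smul_def, map_intCast])
  obtain ⟨b, hb⟩ := helper_exists_int_congr_of_frob_fixed h𝔓 hφ B hφB
  -- Step 7: `ℓ ∣ N6(b, n)` in `ℤ`
  haveI : 𝔓.IsMaximal := HeightOneSpectrum.isMaximal_of_mem_primesAbove h𝔓
  have hinj : Function.Injective (algebraMap (absIntegers (𝓞 ℚ) ℚ) (AlgebraicClosure ℚ)) :=
    Subtype.val_injective
  have hN6B : N6 (c₄ : absIntegers (𝓞 ℚ) ℚ) c₆ B n = 0 := by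
    apply hinj
    rw [map_N6, map_intCast, map_intCast, map_intCast, map_zero]
    exact hN6β
  have hN6b : (ℓ : ℤ) ∣ N6 c₄ c₆ b n := by
    have h1 : Ideal.Quotient.mk 𝔓 (N6 (c₄ : absIntegers (𝓞 ℚ) ℚ) c₆ (b : absIntegers (𝓞 ℚ) ℚ) n) = 0 := by
      rw [← mk_N6_congr 𝔓 hb, hN6B, map_zero]
    rw [Ideal.Quotient.eq_zero_iff_mem, ← intCast_N6, intCast_mem_iff_dvd h𝔓] at h1
    exact h1
  -- Step 8: `ℓ ∤ N4(b, n)` in `ℤ`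
  have hN4b : ¬ (ℓ : ℤ) ∣ N4 c₄ c₆ b n := by
    intro hdvd
    have h1 : ((N4 c₄ c₆ b n : ℤ) : absIntegers (𝓞 ℚ) ℚ) ∈ 𝔓 := (intCast_mem_iff_dvd h𝔓 _).mpr hdvd
    have h2 : N4 (c₄ : absIntegers (𝓞 ℚ) ℚ) c₆ B n ∈ 𝔓 := by
      rw [← Ideal.Quotient.eq_zero_iff_mem, mk_N4_congr 𝔓 hb, Ideal.Quotient.eq_zero_iff_mem,
        ← intCast_N4]
      exact h1
    -- `x · (d x⁻¹) = d ∈ 𝔓`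
    have hX : (⟨x, by rw [hx]; exact (N4 (c₄ : absIntegers (𝓞 ℚ) ℚ) c₆ B n).2⟩ :
        absIntegers (𝓞 ℚ) ℚ) = N4 (c₄ : absIntegers (𝓞 ℚ) ℚ) c₆ B n := by
      apply hinj
      rw [map_N4, map_intCast, map_intCast, map_intCast]
      rfl
    have h3 : ((d : ℤ) : absIntegers (𝓞 ℚ) ℚ) ∈ 𝔓 := by
      have hprod : ((d : ℤ) : absIntegers (𝓞 ℚ) ℚ) =
          N4 (c₄ : absIntegers (𝓞 ℚ) ℚ) c₆ B n * ⟨(d : AlgebraicClosure ℚ) * x⁻¹, hyint⟩ := by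
        rw [← hX]
        apply Subtype.ext
        simp only [MulMemClass.coe_mul]
        rw [mul_comm, mul_assoc, inv_mul_cancel₀ hx0, mul_one]
        rfl
      rw [hprod]
      exact 𝔓.mul_mem_right _ h2
    exact hℓd ((intCast_mem_iff_dvd h𝔓 d).mp h3)
  -- Step 9: descend to `𝔽_ℓ` with `t ≡ b n⁻¹`
  have hnF : (n : ZMod ℓ) ≠ 0 := by rwa [Ne, ZMod.intCast_zmod_eq_zero_iff_dvd]
  have h17424 : (17424 : ZMod ℓ) ≠ 0 := by
    have h2 : (2 : ZMod ℓ) ≠ 0 := by exact_mod_cast natCast_ne_zero_of_prime_ne Nat.prime_two hℓ2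
    have h3 : (3 : ZMod ℓ) ≠ 0 := by exact_mod_cast natCast_ne_zero_of_prime_ne Nat.prime_three hℓ3
    have h11 : (11 : ZMod ℓ) ≠ 0 := by
      exact_mod_cast natCast_ne_zero_of_prime_ne (by norm_num) hℓ11
    rw [show (17424 : ZMod ℓ) = 2 ^ 4 * 3 ^ 2 * 11 ^ 2 by norm_num]
    exact mul_ne_zero (mul_ne_zero (pow_ne_zero _ h2) (pow_ne_zero _ h3)) (pow_ne_zero _ h11)
  have h240 : (240 : ZMod ℓ) ≠ 0 := by
    have h2 : (2 : ZMod ℓ) ≠ 0 := by exact_mod_cast natCast_ne_zero_of_prime_ne Nat.prime_two hℓ2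
    have h3 : (3 : ZMod ℓ) ≠ 0 := by exact_mod_cast natCast_ne_zero_of_prime_ne Nat.prime_three hℓ3
    have h5 : (5 : ZMod ℓ) ≠ 0 := by exact_mod_cast natCast_ne_zero_of_prime_ne Nat.prime_five hℓ5
    rw [show (240 : ZMod ℓ) = 2 ^ 4 * 3 * 5 by norm_num]
    exact mul_ne_zero (mul_ne_zero (pow_ne_zero _ h2) h3) h5
  set t : ℤ := b * (((n : ZMod ℓ)⁻¹).val : ℕ) with ht
  have htF : (n : ZMod ℓ) * (t : ZMod ℓ) = b := by
    rw [ht]; push_cast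
    rw [ZMod.natCast_zmod_val, mul_left_comm, mul_inv_cancel₀ hnF, mul_one]
  refine ⟨ℓ, hℓ, hℓS, h12, t, ?_, ?_⟩
  · -- `n³⁰ N6(t,1) = N6(nt, n) = N6(b, n) = 0`
    have h1 : N6 (c₄ : ZMod ℓ) c₆ ((n : ZMod ℓ) * t) n = 0 := by
      rw [htF]
      have := (ZMod.intCast_zmod_eq_zero_iff_dvd _ ℓ).mpr hN6b
      rwa [intCast_N6] at this
    rw [N6_smul_one] at h1
    rw [C6_eq_N6_div' _ _ _ _ h17424 h240,
      (mul_eq_zero.mp h1).resolve_left (pow_ne_zero _ hnF), zero_div]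
  · -- `n²⁰ N4(t,1) = N4(b, n) ≢ 0`
    intro h0
    apply hN4b
    rw [← ZMod.intCast_zmod_eq_zero_iff_dvd, intCast_N4, ← htF, N4_smul_one]
    rw [C4_eq_N4_div, div_eq_zero_iff] at h0
    rw [h0.resolve_right h17424, mul_zero]

end G3


/-! # §4 Generation-4 blocks, verbatim (`…StubSwitchK3g4`): transport, `Core1728`, T3, N3, Dirichlet, tail, assembly -/

/-- PROVED (gen 1): transport of a framed `5`-torsion model along a `5`-congruence. -/
theorem isTorsionGaloisRep_of_congr {W W' : WeierstrassCurve ℚ} (h : Congr W' W)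
    {ρ : ModPGaloisRep ℚ (ZMod 5) 2} (hρ : W.IsTorsionGaloisRep 5 ρ) :
    W'.IsTorsionGaloisRep 5 ρ := by
  obtain ⟨e', he'⟩ := h
  obtain ⟨e, he⟩ := hρ
  refine ⟨e'.trans e, fun σ P => ?_⟩
  rw [AddEquiv.trans_apply, AddEquiv.trans_apply, he', he]

/-- PROVED (k1-g3): a nonzero integer of absolute value below `q` is not divisible by `q`. -/
theorem not_dvd_of_natAbs_lt {q : ℕ} {z : ℤ} (hz : z ≠ 0) (hlt : z.natAbs < q) : ¬ (q : ℤ) ∣ z := by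
  intro h
  have h1 : q ∣ z.natAbs := by
    rcases h with ⟨k, hk⟩
    exact ⟨k.natAbs, by rw [hk, Int.natAbs_mul, Int.natAbs_natCast]⟩
  exact absurd (Nat.le_of_dvd (Int.natAbs_pos.mpr hz) h1) (not_le.mpr hlt)

/-! ## §2 The generation-3 CORE as one hypothesis

`Core1728` is the conclusion of g3's kernel-checked `exists_fixed_root_1728`
(`STUB_IDEAS_stub_switch_3g3_Sketch.lean`, l.472) with ONE re-cut — the off-cusp clause is
`𝔠₄(t₁,1) ≠ 0` (what G3 consumes; for a `j = 1728` member it is `c₄(E') ≠ 0`, sparing G4″ the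
degree-`60` syzygy `𝔠₄³ − 𝔠₆² = (c₄³−c₆²)𝔇⁵`) instead of `𝔇(t₁,1) ≠ 0`; g3 derives it from T0
`exists_inertial_elt` (M), T1 `smul_torsion_E₉` (M), T2 `smul_smul_torsion_Em₃` (M), G4″
`exists_root_C6_fixed_of_conj` (L → re-cut over a finite level, see the plan) and the named fact
`Thm132iiMemHesseFamily` (Fisher 13.2 (ii) over `K ⊆ ℚ̄`), through the PROVED finite-group lemmas
F1–F4 (`SL₂(𝔽₅) = 2I`: `b¹⁵ ∈ {1, -1, order 4}`, one class of order-`4` elements). -/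
def Core1728 : Prop :=
  ∀ (c₄ c₆ : ℤ), c₄ ^ 3 ≠ c₆ ^ 2 → c₆ ≠ 0 →
    ∃ (τ : Field.absoluteGaloisGroup ℚ) (t₁ : AlgebraicClosure ℚ),
      (∀ s : AlgebraicClosure ℚ, s ^ 2 = -3 → τ • s = -s) ∧
      (∀ z : AlgebraicClosure ℚ, z ^ 4 = 1 → τ • z = z) ∧
      C6 (c₄ : AlgebraicClosure ℚ) c₆ t₁ 1 = 0 ∧ C4 (c₄ : AlgebraicClosure ℚ) c₆ t₁ 1 ≠ 0 ∧
      τ • t₁ = t₁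

/-! ## §3 Helpers -/

/-- T3 (PROVED, verbatim g3): `τ ζ₁₂ = ζ₁₂⁵` for `τ` negating `√-3` and fixing `μ₄`. -/
theorem smul_zeta12 (τ : Field.absoluteGaloisGroup ℚ)
    (hs : ∀ s : AlgebraicClosure ℚ, s ^ 2 = -3 → τ • s = -s)
    (hi : ∀ z : AlgebraicClosure ℚ, z ^ 4 = 1 → τ • z = z)
    (ζ : AlgebraicClosure ℚ) (hζ : IsPrimitiveRoot ζ 12) : τ • ζ = ζ ^ 5 := by
  have h12 : ζ ^ 12 = 1 := hζ.pow_eq_one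
  have hω1 : ζ ^ 4 ≠ 1 := fun h => by
    have := (hζ.pow_eq_one_iff_dvd 4).mp h
    omega
  have hquad : (ζ ^ 4) ^ 2 + ζ ^ 4 + 1 = 0 := by
    have h0 : (ζ ^ 4 - 1) * ((ζ ^ 4) ^ 2 + ζ ^ 4 + 1) = 0 := by
      have : (ζ ^ 4) ^ 3 = 1 := by rw [← pow_mul]; exact h12
      linear_combination this
    exact (mul_eq_zero.mp h0).resolve_left (sub_ne_zero.mpr hω1)
  have hsq : (ζ ^ 4 + ζ ^ 4 + 1) ^ 2 = -3 := by linear_combination 4 * hquad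
  have H1 := hs _ hsq
  rw [smul_add, smul_add, smul_one] at H1
  have hτω : τ • ζ ^ 4 = (ζ ^ 4) ^ 2 := by
    linear_combination (1 / 2 : AlgebraicClosure ℚ) * H1 - hquad
  have hτ9 : τ • ζ ^ 9 = ζ ^ 9 := hi _ (by
    rw [← pow_mul, show 9 * 4 = 12 * 3 by norm_num, pow_mul, h12, one_pow])
  have hζ13 : ζ ^ 9 * ζ ^ 4 = ζ := by
    rw [← pow_add, show 9 + 4 = 12 + 1 by norm_num, pow_add, h12, one_mul, pow_one]
  calc τ • ζ = τ • (ζ ^ 9 * ζ ^ 4) := by rw [hζ13]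
    _ = ζ ^ 9 * (ζ ^ 4) ^ 2 := by rw [smul_mul', hτ9, hτω]
    _ = ζ ^ 5 := by
        rw [← pow_mul, ← pow_add, show 9 + 4 * 2 = 12 + 5 by norm_num, pow_add, h12, one_mul]

open Literature.NumberTheory.QuadraticFields.GaussianPrimary GaussianQuartic in
/-- **N3 (S, NEW, PROVED): `3 ∤ #E(𝔽_ℓ)` for `E : y² = x³ + ax`, `a ≠ 0`, `ℓ ≡ 5 (mod 12)`.**
Gauss / Ireland–Rosen 18 §4 Thm 5 (tree PROVED `IrelandRosen1990_card_points_one_mod_four_holds`):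
`#E(𝔽_ℓ) = ℓ + 1 − 2 Re π'`, `π' ∈ ℤ[i]`, `N(π') = ℓ`; `ℓ ≡ 2 (mod 3)` forces `3 ∤ Re π'`
(`x² + y² ≡ 2 (3) ⇒ x ≢ 0`), and `3 ∣ ℓ + 1`.  (Elementary alternative: a point of order `3` would
give `Ψ₃ = 3x⁴ + 6ax² − a² = 0`, i.e. `3(x²+a)² = (2a)²`, but `(3/ℓ) = −1`.)
[IrelandRosen1990 Ch. 18 §4 Thm 5; numerics `num/n3_check.py`: 0/3476 exceptions, `ℓ < 400`] -/
theorem not_three_dvd_natCard_j1728 {p : ℕ} [Fact p.Prime] (hp12 : p % 12 = 5) (a : ZMod p)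
    (ha : a ≠ 0) : ¬ 3 ∣ Nat.card (⟨0, 0, 0, a, 0⟩ : WeierstrassCurve (ZMod p)).toAffine.Point := by
  have hp : p.Prime := Fact.out
  have hp1 : p % 4 = 1 := by omega
  -- `a = -D̄`, `p ∤ D`
  set D : ℤ := -((a.val : ℤ)) with hD
  have hDp : (D : ZMod p) = -a := by rw [hD]; push_cast; rw [ZMod.natCast_zmod_val]
  have hDnd : ¬ (p : ℤ) ∣ D := by
    rw [← ZMod.intCast_zmod_eq_zero_iff_dvd, hDp, neg_eq_zero]; exact ha
  have hW : (⟨0, 0, 0, a, 0⟩ : WeierstrassCurve (ZMod p)) = ⟨0, 0, 0, -(D : ZMod p), 0⟩ := by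
    rw [hDp, neg_neg]
  -- a primary `π` of norm `p`
  obtain ⟨u, v, huv⟩ := Nat.Prime.sq_add_sq (p := p) (by omega)
  set π₀ : GaussianInt := ⟨u, v⟩ with hπ₀
  have hπ₀p : π₀.norm = p := by
    rw [Zsqrtd.norm_def, hπ₀]; push_cast; rw [← huv]; push_cast; ring
  have hpar : (π₀.re + π₀.im) % 2 = 1 := by
    rw [← norm_emod_two, hπ₀p]; exact_mod_cast (show (p : ℤ) % 2 = 1 by omega)
  set π : GaussianInt := primary π₀ with hπ
  have hπP : IsPrimary π := isPrimary_primary hpar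
  have hπp : π.norm = p := by rw [hπ, norm_primary hpar, hπ₀p]
  have hπ1 : (⟨2, 2⟩ : GaussianInt) ∣ π - 1 := (isPrimary_iff_dvd π).mp hπP
  -- `χ_π(D) = i^k`
  have hD0 : ((D : ℤ) : ZMod p) ≠ 0 := by rwa [Ne, ZMod.intCast_zmod_eq_zero_iff_dvd]
  obtain ⟨k, hk⟩ : ∃ k : ℕ, chi hp1 hπp (D : ZMod p) = ⟨0, 1⟩ ^ k := by
    rcases eq_of_isUnit (isUnit_chi hp1 hπp hD0) with h | h | h | h
    · exact ⟨0, by rw [h, pow_zero]⟩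
    · exact ⟨2, by rw [h]; decide⟩
    · exact ⟨1, by rw [h, pow_one]⟩
    · exact ⟨3, by rw [h]; decide⟩
  have hkdvd : π ∣ (D : GaussianInt) ^ ((p - 1) / 4) - ⟨0, 1⟩ ^ k := by
    apply dvd_of_red_eq_zero hπp
    have hred := (chi_eq_iff hp1 hπp hD0 (isUnit_I.pow k)).mp hk
    rw [map_sub, map_pow, map_intCast, show (p - 1) / 4 = p / 4 by omega, ← hred, sub_self]
  -- Ireland–Rosen 18.5: `N = p + 1 - 2 Re π'`, `N(π') = p`
  have hN := IrelandRosen1990_card_points_one_mod_four_holds hp1 hDnd hπp hπ1 hkdvd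
  rw [← hW] at hN
  set π' : GaussianInt := star ((⟨0, 1⟩ : GaussianInt) ^ k) * π with hπ'
  have hu' : IsUnit (star ((⟨0, 1⟩ : GaussianInt) ^ k)) := (isUnit_I.pow k).star
  have hπ'p : π'.norm = p := by
    rw [hπ', Zsqrtd.norm_mul, (Zsqrtd.norm_eq_one_iff' (by norm_num) _).mpr hu', one_mul, hπp]
  have hnorm : π'.re * π'.re + π'.im * π'.im = p := by
    have h := hπ'p
    rw [Zsqrtd.norm_def] at h
    linear_combination h
  -- reduce everything mod 3
  rintro ⟨c, hc⟩
  set N := Nat.card (⟨0, 0, 0, a, 0⟩ : WeierstrassCurve (ZMod p)).toAffine.Point with hNdef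
  have hp3 : (p : ZMod 3) = 2 := by
    have h := ZMod.natCast_mod p 3
    rw [show p % 3 = 2 by omega] at h
    exact_mod_cast h.symm
  have e1 : ((π'.re : ℤ) : ZMod 3) * (π'.re : ZMod 3) + (π'.im : ZMod 3) * (π'.im : ZMod 3) = 2 := by
    have := congrArg (Int.cast : ℤ → ZMod 3) hnorm
    push_cast at this
    rw [hp3] at this
    exact this
  have e2 : (3 : ZMod 3) * (c : ZMod 3) = 2 + 1 - 2 * (π'.re : ZMod 3) := by
    have := congrArg (Int.cast : ℤ → ZMod 3) hN
    rw [hc] at this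
    push_cast at this
    rw [hp3] at this
    exact this
  have fin : ∀ X Y C : ZMod 3, X * X + Y * Y = 2 → 3 * C = 2 + 1 - 2 * X → False := by decide
  exact fin _ _ _ e1 e2

/-- G6c (PROVED, Dirichlet: `Nat.forall_exists_prime_gt_and_eq_mod`). -/
theorem exists_prime_five_mod_twelve_gt (n : ℕ) : ∃ ℓ : ℕ, ℓ.Prime ∧ n < ℓ ∧ ℓ % 12 = 5 := by
  have h5 : IsUnit ((5 : ℕ) : ZMod 12) := by decide
  obtain ⟨ℓ, hgt, hp, hmod⟩ := Nat.forall_exists_prime_gt_and_eq_mod h5 n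
  refine ⟨ℓ, hp, hgt, ?_⟩
  have := (ZMod.natCast_eq_natCast_iff' ℓ 5 12).1 hmod
  simpa using this

/-! ## §4 The ORDER-8 TAIL (PROVED from N3 + tree theorems, F2 as hypothesis) -/

/-- **The tail.**  An integral short model `E_{A,B}` that is `5`-congruent to `W`, and a prime
`ℓ ≡ 5 (12)` with `ℓ ∤ A`, `ℓ ∣ B`: then a global minimal model `W'` of `E_{A,B}` answers the stub —
`W'[5] ≅ ρ`, and every framed `W'[3]` is absolutely irreducible over `ℚ(√-3)`.  Chain (all tree,
PROVED): `hasGlobalMinimalModel_rat_holds`; `int_Δ` (`Δ ≡ −64A³ ≢ 0`);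
`frobeniusTrace_eq_of_smul_eq_shortWeierstrass` (`a_ℓ(W') = ℓ + 1 − #Ē_{A,B}(𝔽_ℓ)`);
N3 (`3 ∤ #`, and `3 ∣ ℓ + 1`); `hasGoodReductionAtPrime_shortWeierstrass_of_not_dvd_Δ` +
`hasGoodReductionAtPrime_smul_iff`; F2. -/
theorem tail (hF2 : FrobeniusCertificate) (W : WeierstrassCurve ℚ) [W.IsElliptic] (A B : ℤ)
    [(shortWeierstrass (A, B)).IsElliptic] (hEW : Congr (shortWeierstrass (A, B)) W)
    (ℓ : ℕ) [Fact ℓ.Prime] (h12 : ℓ % 12 = 5) (hA : ¬ (ℓ : ℤ) ∣ A) (hB : (ℓ : ℤ) ∣ B)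
    (ρ : ModPGaloisRep ℚ (ZMod 5) 2) (hρ : W.IsTorsionGaloisRep 5 ρ) :
    ∃ (W' : WeierstrassCurve ℚ) (_ : W'.IsElliptic), W'.IsTorsionGaloisRep 5 ρ ∧
      ∃ ρ₃' : ModPGaloisRep ℚ (ZMod 3) 2, W'.IsTorsionGaloisRep 3 ρ₃' ∧
        ρ₃'.IsAbsIrreducibleOverSqrt (-3) := by
  set E : WeierstrassCurve ℚ := shortWeierstrass (A, B) with hE
  obtain ⟨C, hmin⟩ := hasGlobalMinimalModel_rat_holds E
  haveI := hmin
  have hsmul : C⁻¹ • (C • E) = shortWeierstrass (A, B) := inv_smul_smul C E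
  have hℓ1 : ℓ % 4 = 1 := by omega
  have h2 : (2 : ZMod ℓ) ≠ 0 := GaussianQuartic.two_ne_zero_of_one_mod_four hℓ1
  have hA' : (A : ZMod ℓ) ≠ 0 := by rwa [Ne, ZMod.intCast_zmod_eq_zero_iff_dvd]
  have hB' : (B : ZMod ℓ) = 0 := by rwa [ZMod.intCast_zmod_eq_zero_iff_dvd]
  -- `ℓ ∤ Δ(A,B) = -16(4A³ + 27B²) ≡ -64A³`
  have hΔ : ¬ (ℓ : ℤ) ∣ (⟨0, 0, 0, (A, B).1, (A, B).2⟩ : WeierstrassCurve ℤ).Δ := by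
    rw [int_Δ, ← ZMod.intCast_zmod_eq_zero_iff_dvd]
    push_cast
    rw [hB']
    have : (-16 : ZMod ℓ) * (4 * (A : ZMod ℓ) ^ 3 + 27 * (0 : ZMod ℓ) ^ 2) =
        -(2 ^ 6 * (A : ZMod ℓ) ^ 3) := by ring
    rw [this, neg_eq_zero]
    exact mul_ne_zero (pow_ne_zero _ h2) (pow_ne_zero _ hA')
  -- `a_ℓ(W') = ℓ + 1 − #Ē_{A,B}(𝔽_ℓ)` and the reduction is `y² = x³ + Āx`
  have hft : (C • E).frobeniusTrace ℓ =
      Literature.NumberTheory.Automorphic.frobeniusTrace ⟨0, 0, 0, A, B⟩ ℓ :=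
    frobeniusTrace_eq_of_smul_eq_shortWeierstrass (W := C • E) (AB := (A, B)) hsmul ℓ hΔ
  have hmap : (⟨0, 0, 0, A, B⟩ : WeierstrassCurve ℤ).map (Int.castRingHom (ZMod ℓ)) =
      ⟨0, 0, 0, (A : ZMod ℓ), 0⟩ := by
    ext <;> simp [WeierstrassCurve.map, hB']
  have hN3 := not_three_dvd_natCard_j1728 (p := ℓ) h12 (A : ZMod ℓ) hA'
  have h3ft : ¬ (3 : ℤ) ∣ (C • E).frobeniusTrace ℓ := by
    rw [hft, Literature.NumberTheory.Automorphic.frobeniusTrace,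
      Literature.NumberTheory.Automorphic.numPointsMod, hmap]
    intro h
    apply hN3
    have h3ℓ : (3 : ℤ) ∣ (ℓ : ℤ) + 1 := by
      have : 3 ∣ ℓ + 1 := Nat.dvd_of_mod_eq_zero (by omega)
      exact_mod_cast Int.natCast_dvd_natCast.mpr this
    have hN := (Int.dvd_sub h3ℓ h)
    rw [sub_sub_cancel] at hN
    exact Int.natCast_dvd_natCast.mp hN
  -- good reduction at `ℓ`
  have hgood : (C • E).HasGoodReductionAtPrime ℓ :=
    (hasGoodReductionAtPrime_smul_iff E C ℓ).mpr
      (hasGoodReductionAtPrime_shortWeierstrass_of_not_dvd_Δ (AB := (A, B)) ℓ hΔ)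
  have h3 : ℓ % 3 = 2 := by omega
  obtain ⟨ρ₃, hρ₃⟩ := (C • E).exists_isTorsionGaloisRep 3
  have hirr := hF2 (C • E) ℓ h3 hgood h3ft ρ₃ hρ₃
  have hcongr : Congr (C • E) W := congr_trans (congr_symm (congr_smul E C)) hEW
  exact ⟨C • E, inferInstance, isTorsionGaloisRep_of_congr hcongr hρ, ρ₃, hρ₃, hirr⟩

/-! ## §5 Assembly: Fisher (i) + Core1728 + F2 (+ G3, G2, G6, N3) ⇒ the stub, no hypothesis at `3` -/

/-- **The line (generation 4).**  `W ↦ W♭ = base(c₄,c₆)` (G6); `c₆ = 0`: `W♭ = E_{−27c₄,0}` itself,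
any Dirichlet prime `ℓ ≡ 5 (12)` above `27|c₄|`; `c₆ ≠ 0`: `Core1728 → T3 → G3 → G2 → Fisher (i)`;
both branches end in `tail`.  NONE of the stub's hypotheses (`27 ∤ N`, no abs. irreducible `ρ̄₃`,
`ρ̄₅` abs. irreducible) is used. -/
theorem stub_switch_of_core_and_tail (hF : thm132_geomTorsionFive_of_hesseFamily)
    (hCore : Core1728) (hF2 : FrobeniusCertificate) : CDT_three_five_switch := by
  intro W _ _ _ ρ hρ _
  -- integral `c₄c₆`-model
  obtain ⟨u, c₄, c₆, hu, h4, h6⟩ := exists_integral_scaling W.c₄ W.c₆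
  obtain ⟨Cv, hCv⟩ := base_scaled W hu h4 h6
  haveI hBell : (base (c₄ : ℚ) c₆).IsElliptic := by rw [← hCv]; infer_instance
  have hcongrB : Congr (base (c₄ : ℚ) c₆) W := congr_symm (congr_of_smul_eq Cv hCv)
  have hcQ : (c₄ : ℚ) ^ 3 ≠ (c₆ : ℚ) ^ 2 := by
    intro h
    have h1728 : (1728 : ℚ) * (base (c₄ : ℚ) c₆).Δ =
        (base (c₄ : ℚ) c₆).c₄ ^ 3 - (base (c₄ : ℚ) c₆).c₆ ^ 2 := (base (c₄ : ℚ) c₆).c_relation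
    have hc4 : (base (c₄ : ℚ) c₆).c₄ = 6 ^ 4 * c₄ := by
      simp only [WeierstrassCurve.c₄, WeierstrassCurve.b₂, WeierstrassCurve.b₄]; ring
    have hc6 : (base (c₄ : ℚ) c₆).c₆ = 6 ^ 6 * c₆ := by
      simp only [WeierstrassCurve.c₆, WeierstrassCurve.b₂, WeierstrassCurve.b₄, WeierstrassCurve.b₆]; ring
    rw [hc4, hc6, mul_pow, mul_pow, h, show ((6 : ℚ) ^ 4) ^ 3 = (6 ^ 6) ^ 2 by norm_num, ← sub_mul,
      sub_self, zero_mul] at h1728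
    exact (base (c₄ : ℚ) c₆).isUnit_Δ.ne_zero (by simpa using h1728)
  have hc : c₄ ^ 3 ≠ c₆ ^ 2 := fun h => hcQ (by exact_mod_cast h)
  by_cases hc₆ : c₆ = 0
  · -- `j(W) = 1728`: `W♭ = E_{−27c₄, 0}` itself
    subst hc₆
    have hc₄ : c₄ ≠ 0 := by rintro rfl; exact hc (by norm_num)
    have hz : (-27 * c₄ : ℤ) ≠ 0 := by omega
    obtain ⟨ℓ, hℓ, hgt, h12⟩ := exists_prime_five_mod_twelve_gt (-27 * c₄).natAbs
    haveI : Fact ℓ.Prime := ⟨hℓ⟩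
    have hbase : base (c₄ : ℚ) ((0 : ℤ) : ℚ) = shortWeierstrass (-27 * c₄, 0) := by
      ext <;> simp [shortWeierstrass]
    haveI : (shortWeierstrass (-27 * c₄, 0)).IsElliptic := by rw [← hbase]; exact hBell
    have hcongrE : Congr (shortWeierstrass (-27 * c₄, 0)) W := by rw [← hbase]; exact hcongrB
    exact tail hF2 W (-27 * c₄) 0 hcongrE ℓ h12 (not_dvd_of_natAbs_lt hz hgt) (dvd_zero _) ρ hρ
  · -- generic case: the twisted `1728`-fibre (Core1728) read at a Chebotarev prime `ℓ ≡ 5 (12)`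
    obtain ⟨τ, t₁, hs, hi, ht6, ht4, hfix⟩ := hCore c₄ c₆ hc hc₆
    obtain ⟨ζ, hζ⟩ := HasEnoughRootsOfUnity.exists_primitiveRoot (AlgebraicClosure ℚ) 12
    have hτζ : τ • ζ = ζ ^ 5 := smul_zeta12 τ hs hi ζ hζ
    obtain ⟨ℓ, hℓF, hℓS, h12, t, ht6', ht4'⟩ :=
      exists_prime_five_mod_twelve_root c₄ c₆ hc t₁ ζ ht6 ht4 hζ τ hfix hτζ {2, 3, 5, 11}
    haveI := hℓF
    obtain ⟨A, B, Cv', hCv', hA4, hB6⟩ := member_integral_short_mod ℓ hℓS c₄ c₆ t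
    have hA : ¬ (ℓ : ℤ) ∣ A := by
      rw [← ZMod.intCast_zmod_eq_zero_iff_dvd, hA4]; exact ht4'
    have hB : (ℓ : ℤ) ∣ B := by
      rw [← ZMod.intCast_zmod_eq_zero_iff_dvd, hB6]; exact ht6'
    -- `E_{A,B}` is elliptic: `4A³ + 27B² ≡ 4A³ ≢ 0 (mod ℓ)`
    have hℓ1 : ℓ % 4 = 1 := by omega
    have h2 : (2 : ZMod ℓ) ≠ 0 := GaussianQuartic.two_ne_zero_of_one_mod_four hℓ1
    have hA' : (A : ZMod ℓ) ≠ 0 := by rwa [Ne, ZMod.intCast_zmod_eq_zero_iff_dvd]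
    have hB' : (B : ZMod ℓ) = 0 := by rwa [ZMod.intCast_zmod_eq_zero_iff_dvd]
    have hne : 4 * (A, B).1 ^ 3 + 27 * (A, B).2 ^ 2 ≠ 0 := by
      intro h0
      have h0' := congrArg (Int.cast : ℤ → ZMod ℓ) h0
      push_cast at h0'
      rw [hB'] at h0'
      have : (4 : ZMod ℓ) * (A : ZMod ℓ) ^ 3 + 27 * (0 : ZMod ℓ) ^ 2 = 2 ^ 2 * (A : ZMod ℓ) ^ 3 := by ring
      rw [this] at h0'
      exact mul_ne_zero (pow_ne_zero _ h2) (pow_ne_zero _ hA') h0'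
    haveI hEell : (shortWeierstrass (A, B)).IsElliptic := isElliptic_of_ne_zero hne
    set E' : WeierstrassCurve ℚ := member c₄ c₆ t 1 with hE'
    haveI hE'ell : E'.IsElliptic := by
      have : E' = Cv'⁻¹ • shortWeierstrass (A, B) := by rw [← hCv', inv_smul_smul]
      rw [this]; infer_instance
    obtain ⟨e, he⟩ := hF (base (c₄ : ℚ) c₆) E' (c₄ : ℚ) (c₆ : ℚ) (t : ℚ) 1 rfl rfl
    have hcongrE : Congr (shortWeierstrass (A, B)) W :=
      congr_trans (congr_symm (congr_of_smul_eq Cv' hCv')) (congr_trans ⟨e, he⟩ hcongrB)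
    exact tail hF2 W A B hcongrE ℓ h12 hA hB ρ hρ

/-! ## §11 Generation 11 bottom line: F2, G2, G3, G6 discharged -/

/-- **The k3 road after generation 11.**  Only Fisher 13.2 (i) (named fact F1) and `Core1728`
(THEOREM `StubSwitchK3g10.core1728_of_icosahedral_descent`, crux dir, 0 sorries) remain as
hypotheses; `CDT_three_five_switch` is `Sketch.stub_switch` by `Iff.rfl`. -/
theorem stub_switch_of_fisher_and_core (hF : thm132_geomTorsionFive_of_hesseFamily)
    (hCore : Core1728) : CDT_three_five_switch :=
  stub_switch_of_core_and_tail hF hCore frobeniusCertificate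

end

end Summit.ABC.ABC.Cruxes.FreyModularity.StubSwitchK3g11


namespace Summit.ABC.ABC.Cruxes.FreyModularity.StubSwitchK3g11

/-- **THE k3 ROAD, CLOSED MODULO F1.**  Fisher's Theorem 13.2 (i) for the Hesse family of degree `5`
(tree named fact `HesseFamilyFive.thm132_geomTorsionFive_of_hesseFamily`, statement-only) implies
Wiles' `3–5` switch `BCDT.CDT_three_five_switch` (= `Sketch.stub_switch`, `Iff.rfl`): g10's THEOREM
`Core1728` + this generation's F2/G2/G3/G6 + g4's tail. -/
theorem CDT_three_five_switch_of_thm132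
    (hF : Literature.NumberTheory.EllipticCurves.HesseFamilyFive.thm132_geomTorsionFive_of_hesseFamily) :
    Literature.NumberTheory.Automorphic.BCDT.CDT_three_five_switch :=
  stub_switch_of_fisher_and_core hF StubSwitchK3g10.core1728_of_icosahedral_descent

#print axioms CDT_three_five_switch_of_thm132

end Summit.ABC.ABC.Cruxes.FreyModularity.StubSwitchK3g11
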